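import Mathlib
import Summits.Langlands.Langlands.Theorems.CapacityClassicalityHilbertIntegralOverconvergentIsCongruenceStubSeedPow
import Summits.Langlands.Langlands.Theorems.CapacityClassicalityHilbertIntegralOverconvergentIsCongruenceStubSeedOfNonconstant
import Summits.Langlands.Langlands.Theorems.CapacityClassicalityHilbertIntegralOverconvergentIsCongruenceStubSeedDataMultiple
import Summits.Langlands.Langlands.Theorems.CapacityClassicalityHilbertIntegralOverconvergentIsCongruenceSupplyFromSeed
import Summits.Langlands.Langlands.Theorems.CapacityClassicalityHilbertIntegralOverconvergentIsCongruenceHilbertClassicalitySturmReduction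
import Summits.Langlands.Langlands.Theorems.CapacityClassicalityHilbertIntegralOverconvergentIsCongruenceStubShadowMain
import Summits.Langlands.Langlands.Theorems.CapacityClassicalityHilbertIntegralOverconvergentIsCongruenceShadowUnconditional
import Summits.Langlands.Langlands.Theorems.CapacityClassicalityHilbertIntegralOverconvergentIsCongruenceStubGainConversion
import Summits.Langlands.Langlands.Theorems.CapacityClassicalityHilbertIntegralOverconvergentIsCongruenceEngineInstanceQ
import Summits.Langlands.Langlands.Theorems.CapacityClassicalityHilbertIntegralOverconvergentIsCongruenceStubFiniteTotallyPositiveTraceLt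
import Summits.Langlands.Langlands.Theorems.CapacityClassicalityHilbertIntegralOverconvergentIsCongruenceStubLatticeCountTrace
import Summits.Langlands.Langlands.Theorems.CapacityClassicalityHilbertIntegralOverconvergentIsCongruenceStubWindowDeterminantTrick
import Summits.Langlands.Langlands.Theorems.CapacityClassicalityHilbertIntegralOverconvergentIsCongruenceStubSupNormOfWindow
import Summits.Langlands.Langlands.Theorems.CapacityClassicalityHilbertIntegralOverconvergentIsCongruenceStubLocalSpanningFamilyOfLattice
import Summits.Langlands.Langlands.Theorems.CapacityClassicalityHilbertIntegralOverconvergentIsCongruenceItemSeedSupply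
import Summits.Langlands.Langlands.Theorems.CapacityClassicalityHilbertIntegralOverconvergentIsCongruenceSupplyFromSeedCoprime

/-!
# Line `Sketch-ideate-r1-k1` for crux `HilbertIntegralOverconvergentIsCongruence` (stmt-Langlands-8485)

Crux (route `CapacityClassicality`, item stmt-Langlands-8485, rank 4): the HILBERT ENGINE — an overconvergent
Hilbert modular form over a totally real `F`, `[F:ℚ] ≥ 2`, of integer paritious weight, level `Γ₁(𝔫)`, `p ≥ 5`
unramified and prime to `𝔫`, whose standard-cusp `q`-expansion has `O_E`-coefficients and converges on the whole
tube domain under every complex embedding, is classical (refuter-repaired reading C′; never the printed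
`∃ D`-form).  **The crux is INFORMAL** (payload `crux.signature = null`), so no theorem of this file concludes it BY
NAME; the skeleton drives the line's typable content and lands it as `--supports` theorems.

## The line (ideas `sturm-slope-engine` + `csp-koecher-collapse`) and its reshapes

* LEVER (`sturm-slope-engine`): integral Sturm bound + Katz expansion on `{|E_{p-1}| ≥ p^{-r}}` = a `p`-adic
  Schwarz lemma at the cusp; with Siegel's lemma over `𝓞_E` and the `p`-adic Liouville inequality it becomes an
  Arakelov-free ALGEBRAIZATION ENGINE.  §§ 0–3: the `d = 1` shadow `SturmSchwarzShadowCuspQ` (unconditional,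
  p117492; Sturm 1987 proved in the tree) and the `d`-free lever/endgame (RESHAPES 1–3, leads -0/c1).  § 4: the
  `d = 1` engine `IntegralOverconvergentIsAlgebraicQ` (RESHAPE 4, lead c2, p119443).  § 5: the `d`-FREE
  VECTOR-WEIGHT engine `AbstractKatzSturmAlgebraic` (RESHAPE 5, lead c3, p120879); § 6 the `d = 1` regression
  through it and the instance preparations (5b); § 8 the sup-norm Sturm principle from an `O`-lattice integral
  structure (5d).
* TRANSFER (`csp-koecher-collapse`): algebraic over the Hilbert modular function field ⇒ fixed by some `Γ(𝔪)`,
  by Serre's congruence subgroup property — PROVED in the tree (p124758; stub 7 p125304) — + finite slash orbit +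
  orbit–stabiliser (§ 7, RESHAPE 5c, p122925); then classical by Götzky–Koecher: § K (RESHAPE 7, lead c4) proves
  it at `∞` in analytic form, § L (RESHAPE 8, lead c5) adds the Fourier expansion on the tube domain and
  concludes `HilbertModular.IsBoundedAtInfty` in the landed vocabulary (p125267).

The full reshape-by-reshape history (stub tables with proposal ids, what each wave landed) is in the evidence
snapshots of this skeleton on the crux item (`cycle*-skeleton*.lean`, leads -0 … c4) and in
`Cruxes/HilbertIntegralOverconvergentIsCongruence/NOTES.md` (planner-facing: how to TYPE the crux now, and which
named facts remain: Hilbert Sturm bound with affine trace window, integral structure / dimension growth, Katz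
expansion or surrogate).  Every registered stub of §§ 0–T has LANDED (§ T, RESHAPE 16, lead c6: the end-to-end
assembly `Final.HilbertClassicalityModuloNamedFacts` — typed C′ from the named facts, p135355); the `sorry`s of this
file are exactly the registered stubs of the current reshape (§ U, RESHAPE 17, lead c7: named fact (ii) from ONE
seed form, `Seed.SupplyFromSeed` — U1–U10 ALL LANDED, codas `Seed.TypedCrux_of_seedItems`, `Seed.TypedCruxParallel_of_items`;
§ V, RESHAPE 18, lead c7 cycle 2: the THETA SEED `Theta.ThetaSeed` = `Seed.ItemNonconstantForm 2` as a theorem, stubs V1–V8 ALL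
LANDED; § W, RESHAPE 19, lead c7 cycle 2: the WEIGHT-ONE theta seed `Theta.ThetaSeedOne` = `Seed.ItemNonconstantForm 1` (LANDED), whence
`Theta.TypedCruxParallelOne_of_items : ItemSturmModP → ItemBoundedDenominators → Seed.TypedCruxParallel 1` — EVERY parallel weight;
§ X, RESHAPE 20, lead c7 cycle 3: the NON-PARALLEL supply `Bracket.ItemSeedSupplyThm` = `Seed.ItemSeedSupply` via Rankin–Cohen brackets,
stubs X1–X7, coda `Bracket.TypedCrux_of_two_items : ItemSturmModP → ItemBoundedDenominators → Final.TypedCrux`).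

## Disproof.lean used

None exists for this crux (payload `disproof_path` does not exist in this jail; the crux directory has no
`Disproof.lean`; re-checked by lead c5, 2026-08-16T21:35Z, by lead c6, 2026-08-17T00:10Z, and by lead c7, 2026-08-17T01:45Z).  The only refuter evidence (rattack-8485: the printed
`∃ D` conclusion is trivial via `D = 0`) is not touched: no multiplier `D` is quantified anywhere below.
-/

set_option linter.dupNamespace false

noncomputable section

open scoped MatrixGroups NumberField

namespace Summit.Langlands.Langlands.Cruxes.HilbertIntegralOverconvergentIsCongruence.SketchIdeateR1K1

/-! ## §§ 0–4, 6, 7 and the parts of §§ 5, 8 (ARCHIVED by leads c5/c6 to keep this workfile under the 200 KB crux-write limit)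

Sections 0–3 held the `d = 1` SHADOWS of the line's first lemmas and the `d`-free lever/endgame (leads -0, c1, c2;
RESHAPES 1–3; stubs 1′, 2–18′ ALL LANDED: p102900 p102878 p102890 p102949 p104356 p106372 p107623 p107096 p108254 p108878
p110022 p110144 p110143 p110589 p110615 p110655 p110787 p111355 p114627; Serre CSP p124758/p125304); § 4 the `d = 1` engine
`IntegralOverconvergentIsAlgebraicQ` (RESHAPE 4, lead c2: R1 p116487, R3 p116682, R4 p116943, R5 p117231, R6 p117462, R8 p119443);
§ 5's parts S1–S6 (p120405 p120417 p120413 p120443 p120466 p120491); § 6 the `d = 1` regression through the abstract engine and the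
instance preparations (RESHAPE 5b: S8 p122103, S9 p121506, S10a/b/c p121489 p121508 p121595, S11 p121552); § 7 the abstract TRANSFER
and the exponent count (RESHAPE 5c: S12 p122925/p125304, S13a p122931, S13b p122928; `HilbertEngineModuloVocabulary_proof`); § 8's
S14–S16 (p123850 p123792 p124026; superseded for the engine instance by § T's T3/T4).  Their full text is preserved verbatim in the
evidence snapshots of this skeleton on the crux item (`20260816T204158Z-HilbertIntegralOverconvergentIsCongruence.lean`,
`cycle8-final-skeleton-c5.lean`) and in the landed Theorems files named there.  § T below refers to the landed Theorems
declarations directly (`…Theorems.HilbertIntegralOverconvergentIsCongruence.stub_siegelCountFromGrowth`, `…stub_mvWeightedNormMul`, …). -/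


/-! ## § 5 RESHAPE 5 — the `d`-FREE ALGEBRAIZATION ENGINE with vector weights (lead c3) — ARCHIVED by lead c7 (size limit)

`AbstractKatzSturmAlgebraic` = the statement of the LANDED theorem `…Theorems.HilbertIntegralOverconvergentIsCongruence.stub_abstractEngineMain`
(p120879; parts S1–S6 p120405 p120417 p120413 p120443 p120466 p120491); its in-skeleton copy (def + stub S7 + `abstractKatzSturmAlgebraic_of`,
11 KB, nothing below refers to it) is preserved verbatim in the evidence snapshots `cycle1-skeleton-c7.lean` / `cycle8-final-skeleton-c5.lean`. -/

/-! ## § 8 RESHAPE 5d — S17 only (S14–S16 archived): `stub_summable_of_levelGrowth` (LANDED p123906), used by § R's `ArchFromTube_of`. -/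

namespace Stubs

/-- **stub S17 — `stub_summable_of_levelGrowth` (LANDED p123906; weighted sizes from radius-type bounds).** For a weight `wt : X → ℕ` with finite level sets of polynomial size `#{wt = n} ≤ A (n+1)^d` and coefficients `a : X → ℂ` with `‖a_x‖ s^{wt x} ≤ C_s` for every `0 < s < 1`: `Σ_x … (abridged; see the landed file). [folklore] -/
theorem stub_summable_of_levelGrowth {X : Type*} (wt : X → ℕ) (dd : ℕ) (Aℓ : ℝ)
    (hlevel : ∀ n : ℕ, {x : X | wt x = n}.Finite ∧ (({x : X | wt x = n}.ncard : ℕ) : ℝ) ≤ Aℓ * ((n : ℝ) + 1) ^ dd)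
    (a : X → ℂ) (hbound : ∀ s : ℝ, 0 < s → s < 1 → ∃ C : ℝ, ∀ x, ‖a x‖ * s ^ wt x ≤ C)
    (t : ℝ) (ht0 : 0 ≤ t) (ht1 : t < 1) :
    Summable (fun x : X ↦ ‖a x‖ * t ^ wt x) :=
  Summit.Langlands.Langlands.Theorems.HilbertIntegralOverconvergentIsCongruence.stub_summable_of_levelGrowth wt dd Aℓ hlevel a hbound t ht0 ht1

end Stubs

/-- Statement of registered stub S17, by name. -/
def stub_summable_of_levelGrowth : Prop := type_of% @Stubs.stub_summable_of_levelGrowth.{0}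

end Summit.Langlands.Langlands.Cruxes.HilbertIntegralOverconvergentIsCongruence.SketchIdeateR1K1

end

/-!
# § K — RESHAPE 7 (lead c4): the Götzky–Koecher principle at the standard cusp, analytic form — ARCHIVED by lead c6 (size limit)

`Koecher.KoecherAtInfinity` (stubs K-A1 … K-G, ALL LANDED: p125653 p125930 p126603 p126000 p126132 p126111 p126501 p126382; glue
p126914; vocabulary form `…Theorems…koecher_fourierCoeffAt_eq_zero` p127139/p127497).  Full text in the evidence snapshots
(`cycle8-final-skeleton-c5.lean`) and the landed Theorems files; § L below uses the landed vocabulary form directly.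
-/

/-!
# § L — RESHAPE 8 (lead c5): the Fourier expansion on the tube domain and Götzky–Koecher ⇒ bounded at `∞`,
# in the landed vocabulary `Literature.NumberTheory.Automorphic.HilbertModular` (p125267)

Freitag I.4.1 (first half): a holomorphic `𝓞 F`-periodic `f` on `ℍ^{Hom(F,ℝ)}` is the sum of its Fourier series
`f(z) = ∑_{ν ∈ 𝔡⁻¹} a_ν e^{2πi S(νz)}`, absolutely convergent, `a_ν = HilbertModular.fourierCoeff f ν`; with § K
(Götzky–Koecher) this yields the vocabulary's cusp condition `HilbertModular.IsBoundedAtInfty` — named fact (iv) of the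
crux NOTES in full, and the analytic plumbing of every typed proof of C′ (`bounded_at_cusps`; `qExpansion` = the
engine's formal series).  Proof: at height `y = Im z`, `x ↦ f(x + iy)` is a smooth `ℤ^ι`-periodic function on `ℝ^ι`
(L2a), expanded by the tree's torus theory (`Torus.hasSum_mFourier_scalar`, Grafakos 3.3.9) over `n ∈ ℤ^ι` (L2b);
`𝔡⁻¹ ≃ ℤ^ι` by `ν ↦ (Tr(ν b_i))_i` (L1), `S(ν(x+iy)) = n(ν)·x + i⟨ν,y⟩` (L3), so the coefficient at `n(ν)` is
`e^{-2π⟨ν,y⟩} a_ν(y) = e^{-2π⟨ν,y⟩} a_ν` (height independence, L4); boundedness for `Im z_σ ≥ 1` from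
`|f(z)| ≤ ∑ |a_ν| e^{-2π⟨ν, Im z⟩} ≤ ∑ |a_ν| e^{-2π Tr ν}` once `a_ν = 0` off `{0} ∪ {ν ≫ 0}` (L6, L7 = § K in the
vocabulary).  Stubs L1, L2a, L3, L4, L6, L7 waved (all LANDED in wave 1), L2b the lead's.
-/

namespace Summit.Langlands.Langlands.Cruxes.HilbertIntegralOverconvergentIsCongruence.SketchIdeateR1K1

open MeasureTheory Complex NumberField
open Literature.NumberTheory.Automorphic Literature.NumberTheory.Automorphic.HilbertModular

/-! ### § L body ARCHIVED by lead c7 (size limit): stubs L1 `stub_dualLatticeEquiv` p127414, L2a `stub_contDiff_cube` p127437,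
L2b `stub_hasSum_cube` p127515, L3 `stub_pairing_cubePoint` p127416, L4 `stub_fourierCoeffAt_indep` p127433, L6 `stub_bounded_of_coeff_support`
p127468, L7 `stub_koecher_fourierCoeffAt_eq_zero` p127497 and the compositions `Fourier.FourierExpansion_of` / `Fourier.KoecherBounded_of`
(ALL LANDED; endpoints `…Theorems….hasSum_fourierCoeff`, `…isBoundedAtInfty_of_unit_equivariant`, p128567).  Full text (20 KB) in the
evidence snapshots `cycle1-skeleton-c7.lean` / `cycle8-final-skeleton-c5.lean`; § M below now calls the landed endpoint directly. -/


/-!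
# § M — RESHAPE 9 (lead c5, cycle 2): the KOECHER PRINCIPLE for Hilbert modular forms and `q`-series with
# prescribed coefficients, in the vocabulary `HilbertModular`

(A) Freitag I.4.9 Cor.: for `[F:ℚ] ≥ 2`, a holomorphic `f` on `ℍ` with the weight-`k` law under a congruence subgroup
`Γ ⊇ Γ(𝔫)`, `𝔫 ≠ 0` (and `0` off `ℍ`) IS a Hilbert modular form: `bounded_at_cusps` at every cusp `g ∈ SL₂(F)` is
automatic.  Proof: `h = f|_k g` is holomorphic (M-A6); `g⁻¹Γ(𝔫)g` contains the translations by an ideal `𝔪 ≠ 0`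
and `diag(ε, ε⁻¹)`, `ε ≡ 1 (mod 𝔪)` (M-A3), so by the slash action law (M-A1) `h` is `𝔪`-periodic and
`h(ε²z) = ∏σ(ε)^{-k_σ} h(z)`; the squares of the congruence units contain a finite-index subgroup (M-A5); rescaling
`z ↦ Nz`, `N = Nm 𝔪 ∈ 𝔪` (M-A4) makes `h` `𝓞 F`-periodic, and § L's `KoecherBounded` applies.
(B) `q`-series `∑_{ν ∈ 𝔡⁻¹} a_ν e^{2πi S(νz)}` with `∑|a_ν|e^{-2π⟨ν,y⟩} < ∞` at all heights are holomorphic (M-B3, the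
tree's several-variable Weierstrass theorem), `𝓞 F`-periodic, and have `fourierCoeffAt = a` (M-B2, uniqueness by
termwise integration and orthogonality on the cube; the lead's).  Together: `CuspPackage`.
-/

open scoped MatrixGroups

namespace Stubs

/-- **stub M-A1 — `stub_slash_mul` (LANDED p128468, `…StubSlashMul.lean`).** The Möbius action of `SL₂(F)` on `ℍ^{Hom(F,ℝ)}` through the real embeddings is an action preserving `ℍ`, the automorphy factor is a cocycle, and consequently the weight-`k` slash … (abridged; see the landed file). [cite: Freitag1990, Ch. I §4] -/
theorem stub_slash_mul (F : Type) [Field F] [NumberField F] (k : (F →+* ℝ) → ℤ) (g₁ g₂ : SL(2, F))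
    (f : Point F → ℂ) (z : Point F) (hz : z ∈ halfSpace F) :
    moeb g₂ z ∈ halfSpace F ∧ moeb (g₁ * g₂) z = moeb g₁ (moeb g₂ z) ∧
      autFactor k (g₁ * g₂) z = autFactor k g₁ (moeb g₂ z) * autFactor k g₂ z ∧
      slash k (g₁ * g₂) f z = slash k g₂ (slash k g₁ f) z :=
  Summit.Langlands.Langlands.Theorems.HilbertIntegralOverconvergentIsCongruence.stub_slash_mul F k g₁ g₂ f z hz

/-- **stub M-A6 — `stub_slash_holomorphic` (LANDED p128670, `…StubSlashHolomorphic.lean`).** The slash `f|_k g` of a function holomorphic on `ℍ` is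
holomorphic on `ℍ` (`z ↦ g z` is holomorphic `ℍ → ℍ`, coordinatewise a Möbius map; `J_k(g, z)` is holomorphic
and non-vanishing on `ℍ`). [cite: Freitag1990, Ch. I §4] -/
theorem stub_slash_holomorphic (F : Type) [Field F] [NumberField F] (k : (F →+* ℝ) → ℤ) (g : SL(2, F))
    (f : Point F → ℂ) (hf : IsHolomorphicOn F f) : IsHolomorphicOn F (slash k g f) :=
  Summit.Langlands.Langlands.Theorems.HilbertIntegralOverconvergentIsCongruence.stub_slash_holomorphic F k g f hf

/-- **stub M-A3 — `stub_conj_principal_congruence` (LANDED p128686, `…StubConjPrincipalCongruence.lean`).** For `g ∈ SL₂(F)` and a non-zero ideal `𝔫`, the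
conjugate `g⁻¹ Γ(𝔫) g` contains the translations by a non-zero ideal `𝔪` and the diagonal matrices `diag(ε, ε⁻¹)`
of the units `ε ≡ 1 (mod 𝔪)` … (abridged; full text in the landed Theorems file). -/
theorem stub_conj_principal_congruence (F : Type) [Field F] [NumberField F] (𝔫 : Ideal (𝓞 F))
    (h𝔫 : 𝔫 ≠ ⊥) (g : SL(2, F)) :
    ∃ 𝔪 : Ideal (𝓞 F), 𝔪 ≠ ⊥ ∧
      (∀ a : 𝓞 F, a ∈ 𝔪 → ∃ t : SL(2, F), (t : Matrix (Fin 2) (Fin 2) F) = !![1, (a : F); 0, 1] ∧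
        ∃ γ ∈ Bianchi.Gamma 𝔫, toSL2F γ * g = g * t) ∧
      (∀ ε : (𝓞 F)ˣ, (ε : 𝓞 F) - 1 ∈ 𝔪 → ∃ t : SL(2, F),
        (t : Matrix (Fin 2) (Fin 2) F) = !![((ε : 𝓞 F) : F), 0; 0, (((ε⁻¹ : (𝓞 F)ˣ) : 𝓞 F) : F)] ∧
        ∃ γ ∈ Bianchi.Gamma 𝔫, toSL2F γ * g = g * t) :=
  Summit.Langlands.Langlands.Theorems.HilbertIntegralOverconvergentIsCongruence.stub_conj_principal_congruence F 𝔫 h𝔫 g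

/-- **stub M-A4 — `stub_rescale` (LANDED p128477, `…StubRescale.lean`).** Rescaling by a positive integer: `z ↦ h(Nz)` is holomorphic on `ℍ` when
`h` is, and if it is bounded at `∞` then so is `h` (heights scale by `N`). [folklore] -/
theorem stub_rescale (F : Type) [Field F] [NumberField F] (h : Point F → ℂ) (N : ℕ) (hN : 0 < N) :
    (IsHolomorphicOn F h → IsHolomorphicOn F (fun z ↦ h (fun σ ↦ (N : ℂ) * z σ))) ∧
    (IsBoundedAtInfty F (fun z ↦ h (fun σ ↦ (N : ℂ) * z σ)) → IsBoundedAtInfty F h) :=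
  Summit.Langlands.Langlands.Theorems.HilbertIntegralOverconvergentIsCongruence.stub_rescale F h N hN

/-- **stub M-A5 — `stub_unitCongruence_sq_finiteIndex` (LANDED p128551, `…StubUnitCongruenceSqFiniteIndex.lean`).** For a non-zero ideal `𝔪` of a number ring, the squares of the units `≡ 1 (mod 𝔪)` contain a finite-index subgroup of the unit group (the congruence units are the kernel of `(𝓞 K)ˣ … (abridged; see the landed file). [folklore] -/
theorem stub_unitCongruence_sq_finiteIndex (K : Type) [Field K] [NumberField K] (𝔪 : Ideal (𝓞 K))
    (h𝔪 : 𝔪 ≠ ⊥) :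
    ∃ U : Subgroup (𝓞 K)ˣ, U.FiniteIndex ∧ ∀ η ∈ U, ∃ ε : (𝓞 K)ˣ, (ε : 𝓞 K) - 1 ∈ 𝔪 ∧ η = ε ^ 2 :=
  Summit.Langlands.Langlands.Theorems.HilbertIntegralOverconvergentIsCongruence.stub_unitCongruence_sq_finiteIndex K 𝔪 h𝔪

/-- **stub M-B2 — `stub_fourierCoeffAt_of_hasSum` (LANDED p128476, `…StubFourierCoeffAtOfHasSum.lean` (lead)).** Uniqueness of `q`-expansion coefficients:
if `f(x + iy) = ∑_{ν ∈ 𝔡⁻¹} a_ν e^{2πi S(ν(x+iy))}` on the whole height-`y` slice with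
`∑ |a_ν| e^{-2π⟨ν,y⟩} < ∞`, then `a_ν(y) = a_ν` (termwise … (abridged; full text in the landed Theorems file). -/
theorem stub_fourierCoeffAt_of_hasSum (F : Type) [Field F] [NumberField F] [NumberField.IsTotallyReal F]
    (f : Point F → ℂ) (a : F → ℂ) (y : (F →+* ℝ) → ℝ)
    (hsum : ∀ x : Coord F, HasSum (fun ν : {ν : F | ∀ b : 𝓞 F, ∃ n : ℤ, Algebra.trace ℚ F (ν * b) = n} ↦
      a ν * cexp (2 * Real.pi * I * pairing (ν : F) (cubePoint x y))) (f (cubePoint x y)))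
    (habs : Summable (fun ν : {ν : F | ∀ b : 𝓞 F, ∃ n : ℤ, Algebra.trace ℚ F (ν * b) = n} ↦
      ‖a ν‖ * Real.exp (-(2 * Real.pi * ∑ σ : F →+* ℝ, σ (ν : F) * y σ))))
    (ν : F) (hν : ∀ b : 𝓞 F, ∃ n : ℤ, Algebra.trace ℚ F (ν * b) = n) :
    fourierCoeffAt f ν y = a ν :=
  Summit.Langlands.Langlands.Theorems.HilbertIntegralOverconvergentIsCongruence.stub_fourierCoeffAt_of_hasSum F f a y hsum habs ν hν

/-- **stub M-B3 — `stub_qSeries_holomorphic` (LANDED p128628, `…StubQSeriesHolomorphic.lean`).** A `q`-series `∑_{ν ∈ S} a_ν e^{2πi S(νz)}` with `∑ |a_ν| e^{-2π⟨ν,y⟩} < ∞` at every height `y ≫ 0` is holomorphic on `ℍ` (normal convergence on every sub-tube `{Im z_σ > y_σ}`: … (abridged; see the landed file). [folklore] -/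
theorem stub_qSeries_holomorphic (F : Type) [Field F] [NumberField F] (S : Set F) (a : F → ℂ)
    (habs : ∀ y : (F →+* ℝ) → ℝ, (∀ σ, 0 < y σ) →
      Summable (fun ν : S ↦ ‖a ν‖ * Real.exp (-(2 * Real.pi * ∑ σ : F →+* ℝ, σ (ν : F) * y σ)))) :
    IsHolomorphicOn F (fun z ↦ ∑' ν : S, a ν * cexp (2 * Real.pi * I * pairing (ν : F) z)) :=
  Summit.Langlands.Langlands.Theorems.HilbertIntegralOverconvergentIsCongruence.stub_qSeries_holomorphic F S a habs

end Stubs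

namespace Cusp

/-- Statement of stub M-A1, by name. -/
def stub_slash_mul : Prop := type_of% @Stubs.stub_slash_mul
/-- Statement of stub M-A6, by name. -/
def stub_slash_holomorphic : Prop := type_of% @Stubs.stub_slash_holomorphic
/-- Statement of stub M-A3, by name. -/
def stub_conj_principal_congruence : Prop := type_of% @Stubs.stub_conj_principal_congruence
/-- Statement of stub M-A4, by name. -/
def stub_rescale : Prop := type_of% @Stubs.stub_rescale
/-- Statement of stub M-A5, by name. -/
def stub_unitCongruence_sq_finiteIndex : Prop := type_of% @Stubs.stub_unitCongruence_sq_finiteIndex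
/-- Statement of stub M-B2, by name. -/
def stub_fourierCoeffAt_of_hasSum : Prop := type_of% @Stubs.stub_fourierCoeffAt_of_hasSum
/-- Statement of stub M-B3, by name. -/
def stub_qSeries_holomorphic : Prop := type_of% @Stubs.stub_qSeries_holomorphic

/-- **The Koecher principle for Hilbert modular forms** (Freitag I.4.9 Cor.): over a totally real field of degree
`≥ 2`, a holomorphic function on `ℍ` satisfying the weight-`k` transformation law under a congruence subgroup
`Γ ⊇ Γ(𝔫)` (`𝔫 ≠ 0`) of `SL₂(𝓞 F)` (and normalised to `0` off `ℍ`) is a Hilbert modular form in the sense of the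
vocabulary — the cusp condition `bounded_at_cusps` at EVERY cusp is automatic. -/
def KoecherPrinciple : Prop :=
  ∀ (F : Type) [Field F] [NumberField F] [NumberField.IsTotallyReal F], 1 < Module.finrank ℚ F →
  ∀ (𝔫 : Ideal (𝓞 F)), 𝔫 ≠ ⊥ → ∀ (Γ : Subgroup SL(2, 𝓞 F)), Bianchi.Gamma 𝔫 ≤ Γ →
  ∀ (k : (F →+* ℝ) → ℤ) (f : Point F → ℂ), IsHolomorphicOn F f →
    (∀ γ ∈ Γ, ∀ z ∈ halfSpace F, f (moeb (toSL2F γ) z) = autFactor k (toSL2F γ) z * f z) →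
    (∀ z ∉ halfSpace F, f z = 0) → IsModularForm Γ k f

/-- **`q`-series as holomorphic periodic functions with prescribed coefficients**: for `a : F → ℂ` with
`∑_{ν ∈ 𝔡⁻¹} |a_ν| e^{-2π⟨ν,y⟩} < ∞` at every `y ≫ 0`, the function `q(z) = ∑_{ν ∈ 𝔡⁻¹} a_ν e^{2πi S(νz)}` is
holomorphic on `ℍ`, `𝓞 F`-periodic on `ℍ`, and `HilbertModular.fourierCoeffAt q ν y = a_ν` for every `ν ∈ 𝔡⁻¹`,
`y ≫ 0` (so `HilbertModular.qExpansion q = a` on the index set). -/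
def QSeriesPackage : Prop :=
  ∀ (F : Type) [Field F] [NumberField F] [NumberField.IsTotallyReal F] (a : F → ℂ),
    (∀ y : (F →+* ℝ) → ℝ, (∀ σ, 0 < y σ) →
      Summable (fun ν : {ν : F | ∀ b : 𝓞 F, ∃ n : ℤ, Algebra.trace ℚ F (ν * b) = n} ↦
        ‖a ν‖ * Real.exp (-(2 * Real.pi * ∑ σ : F →+* ℝ, σ (ν : F) * y σ)))) →
    IsHolomorphicOn F (fun z ↦ ∑' ν : {ν : F | ∀ b : 𝓞 F, ∃ n : ℤ, Algebra.trace ℚ F (ν * b) = n},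
        a ν * cexp (2 * Real.pi * I * pairing (ν : F) z)) ∧
    (∀ (b : 𝓞 F) (z : Point F), z ∈ halfSpace F →
      (∑' ν : {ν : F | ∀ b : 𝓞 F, ∃ n : ℤ, Algebra.trace ℚ F (ν * b) = n},
          a ν * cexp (2 * Real.pi * I * pairing (ν : F) (fun σ ↦ z σ + ((σ (b : F) : ℝ) : ℂ)))) =
        ∑' ν : {ν : F | ∀ b : 𝓞 F, ∃ n : ℤ, Algebra.trace ℚ F (ν * b) = n},
          a ν * cexp (2 * Real.pi * I * pairing (ν : F) z)) ∧
    ∀ (ν : F), (∀ b : 𝓞 F, ∃ n : ℤ, Algebra.trace ℚ F (ν * b) = n) →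
      ∀ y : (F →+* ℝ) → ℝ, (∀ σ, 0 < y σ) →
        fourierCoeffAt (fun z ↦ ∑' μ : {ν : F | ∀ b : 𝓞 F, ∃ n : ℤ, Algebra.trace ℚ F (ν * b) = n},
          a μ * cexp (2 * Real.pi * I * pairing (μ : F) z)) ν y = a ν

/-- The package of RESHAPE 9. -/
def CuspPackage : Prop := KoecherPrinciple ∧ QSeriesPackage

section Composition

variable {F : Type} [Field F] [NumberField F]

omit [NumberField F] in
/-- Entries of a special linear matrix from an equality of its underlying matrix with an explicit one. -/
theorem entries_of_coe_eq {t : SL(2, F)} {a b c d : F} (ht : (t : Matrix (Fin 2) (Fin 2) F) = !![a, b; c, d]) :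
    t 0 0 = a ∧ t 0 1 = b ∧ t 1 0 = c ∧ t 1 1 = d := by
  have h : ∀ i j, t i j = !![a, b; c, d] i j := fun i j ↦ by rw [← ht]
  exact ⟨by simpa using h 0 0, by simpa using h 0 1, by simpa using h 1 0, by simpa using h 1 1⟩

/-- The translation `z ↦ z + a` as a Möbius map: action and automorphy factor. -/
theorem moeb_transl {t : SL(2, F)} {a : F} (ht : (t : Matrix (Fin 2) (Fin 2) F) = !![1, a; 0, 1])
    (k : (F →+* ℝ) → ℤ) (z : Point F) :
    moeb t z = (fun σ ↦ z σ + ((σ a : ℝ) : ℂ)) ∧ autFactor k t z = 1 := by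
  obtain ⟨h00, h01, h10, h11⟩ := entries_of_coe_eq ht
  refine ⟨funext fun σ ↦ ?_, ?_⟩
  · simp [moeb, denom, h00, h01, h10, h11]
  · simp [autFactor, denom, h10, h11]

/-- The diagonal unit matrix `diag(ε, ε⁻¹)` as a Möbius map: `z ↦ ε² z`, automorphy factor `∏_σ σ(ε⁻¹)^{k_σ}`. -/
theorem moeb_diag {t : SL(2, F)} {ε : (𝓞 F)ˣ}
    (ht : (t : Matrix (Fin 2) (Fin 2) F) = !![((ε : 𝓞 F) : F), 0; 0, (((ε⁻¹ : (𝓞 F)ˣ) : 𝓞 F) : F)])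
    (k : (F →+* ℝ) → ℤ) (z : Point F) :
    moeb t z = (fun σ ↦ ((σ ((ε : 𝓞 F) : F) : ℝ) : ℂ) ^ 2 * z σ) ∧
      autFactor k t z = ∏ σ : F →+* ℝ, ((σ (((ε⁻¹ : (𝓞 F)ˣ) : 𝓞 F) : F) : ℝ) : ℂ) ^ k σ := by
  obtain ⟨h00, h01, h10, h11⟩ := entries_of_coe_eq ht
  have hinv : (((ε⁻¹ : (𝓞 F)ˣ) : 𝓞 F) : F) * ((ε : 𝓞 F) : F) = 1 := by
    rw [← map_mul, Units.inv_mul, map_one]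
  have hσinv : ∀ σ : F →+* ℝ, (σ (((ε⁻¹ : (𝓞 F)ˣ) : 𝓞 F) : F) : ℂ) * (σ ((ε : 𝓞 F) : F) : ℂ) = 1 := by
    intro σ
    have h := congrArg (fun x : F ↦ ((σ x : ℝ) : ℂ)) hinv
    simp only [map_mul, map_one, Complex.ofReal_mul, Complex.ofReal_one] at h
    exact h
  refine ⟨funext fun σ ↦ ?_, ?_⟩
  · have hinvσ : ((σ (((ε⁻¹ : (𝓞 F)ˣ) : 𝓞 F) : F) : ℝ) : ℂ) = (((σ ((ε : 𝓞 F) : F) : ℝ) : ℂ))⁻¹ :=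
      eq_inv_of_mul_eq_one_left (hσinv σ)
    simp only [moeb, denom, h00, h01, h10, h11, map_zero, Complex.ofReal_zero, zero_mul, add_zero, zero_add,
      hinvσ, div_inv_eq_mul]
    ring
  · simp [autFactor, denom, h10, h11]


/-- The size of a `q`-monomial term: `|a e^{2πi S(νz)}| = |a| e^{-2π ∑_σ σ(ν) Im z_σ}`. -/
theorem norm_qTerm (a : ℂ) (ν : F) (z : Point F) :
    ‖a * cexp (2 * Real.pi * I * pairing ν z)‖ =
      ‖a‖ * Real.exp (-(2 * Real.pi * ∑ σ : F →+* ℝ, σ ν * (z σ).im)) := by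
  have him : (pairing ν z).im = ∑ σ : F →+* ℝ, σ ν * (z σ).im := by
    rw [pairing, Complex.im_sum]
    exact Finset.sum_congr rfl fun σ _ ↦ Complex.im_ofReal_mul _ _
  have hre : (2 * Real.pi * I * pairing ν z).re = -(2 * Real.pi * ∑ σ : F →+* ℝ, σ ν * (z σ).im) := by
    rw [← him]
    simp [Complex.mul_re]
  rw [norm_mul, Complex.norm_exp, hre]

omit [NumberField F] in
/-- Scaling a point of `ℍ` by a positive natural number stays in `ℍ`. -/
theorem natMul_mem_halfSpace {N : ℕ} (hN : 0 < N) {z : Point F} (hz : z ∈ halfSpace F) :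
    (fun σ ↦ (N : ℂ) * z σ) ∈ halfSpace F := fun σ ↦ by
  simp only [Complex.mul_im, Complex.natCast_re, Complex.natCast_im, zero_mul, add_zero]
  exact mul_pos (Nat.cast_pos.2 hN) (hz σ)

/-- **The Koecher principle from the stubs and § L's `KoecherBounded`** (composition of M-A1, M-A6, M-A3, M-A4,
M-A5; real proof). -/
theorem KoecherPrinciple_of (hA1 : stub_slash_mul) (hA6 : stub_slash_holomorphic) (hA3 : stub_conj_principal_congruence) (hA4 : stub_rescale)
    (hA5 : stub_unitCongruence_sq_finiteIndex) : KoecherPrinciple := by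
  classical
  intro F _ _ _ hd 𝔫 h𝔫 Γ hΓ k f hf htrans hzero
  refine ⟨hf, htrans, fun g ↦ ?_, hzero⟩
  set h : Point F → ℂ := slash k g f with hhdef
  have hh : IsHolomorphicOn F h := hA6 F k g f hf
  obtain ⟨𝔪, h𝔪, htr, hdiag⟩ := hA3 F 𝔫 h𝔫 g
  -- transport of the transformation law along `γ g = g t`, `γ ∈ Γ(𝔫) ≤ Γ`
  have transport : ∀ t : SL(2, F), (∃ γ ∈ Bianchi.Gamma 𝔫, toSL2F γ * g = g * t) →
      ∀ z ∈ halfSpace F, h (moeb t z) = autFactor k t z * h z := by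
    rintro t ⟨γ, hγ, hconj⟩ z hz
    have hγΓ : γ ∈ Γ := hΓ hγ
    have hfix : ∀ w ∈ halfSpace F, slash k (toSL2F γ) f w = f w := by
      intro w hw
      simp only [slash]
      rw [htrans γ hγΓ w hw, ← mul_assoc, inv_mul_cancel₀ (autFactor_ne_zero k _ hw), one_mul]
    obtain ⟨hgz, -, -, hsl1⟩ := hA1 F k (toSL2F γ) g f z hz
    have e1 : slash k (toSL2F γ * g) f z = h z := by
      rw [hsl1]
      show (autFactor k g z)⁻¹ * slash k (toSL2F γ) f (moeb g z) = slash k g f z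
      rw [hfix _ hgz]
      rfl
    obtain ⟨-, -, -, hsl2⟩ := hA1 F k g t f z hz
    have e2 : slash k (g * t) f z = (autFactor k t z)⁻¹ * h (moeb t z) := by
      rw [hsl2, hhdef]
      rfl
    rw [← hconj, e1] at e2
    rw [e2, ← mul_assoc, mul_inv_cancel₀ (autFactor_ne_zero k t hz), one_mul]
  -- translations by `𝔪`
  have hper𝔪 : ∀ a : 𝓞 F, a ∈ 𝔪 → ∀ z ∈ halfSpace F, h (fun σ ↦ z σ + ((σ (a : F) : ℝ) : ℂ)) = h z := by
    intro a ha z hz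
    obtain ⟨t, ht, hγ⟩ := htr a ha
    obtain ⟨hmoeb, haut⟩ := moeb_transl ht k z
    have key := transport t hγ z hz
    rwa [hmoeb, haut, one_mul] at key
  -- the multipliers of the diagonal units
  set d : (𝓞 F)ˣ → ℂ := fun ε ↦ ∏ σ : F →+* ℝ, ((σ (((ε⁻¹ : (𝓞 F)ˣ) : 𝓞 F) : F) : ℝ) : ℂ) ^ k σ
    with hddef
  have hd_ne : ∀ ε, d ε ≠ 0 := by
    intro ε
    refine Finset.prod_ne_zero_iff.2 fun σ _ ↦ zpow_ne_zero _ ?_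
    have hε : (((ε⁻¹ : (𝓞 F)ˣ) : 𝓞 F) : F) ≠ 0 :=
      mt RingOfIntegers.coe_eq_zero_iff.mp (Units.ne_zero _)
    exact_mod_cast (map_ne_zero σ).2 hε
  have hunit : ∀ ε : (𝓞 F)ˣ, (ε : 𝓞 F) - 1 ∈ 𝔪 → ∀ z ∈ halfSpace F,
      h (fun σ ↦ ((σ ((ε : 𝓞 F) : F) : ℝ) : ℂ) ^ 2 * z σ) = d ε * h z := by
    intro ε hε z hz
    obtain ⟨t, ht, hγ⟩ := hdiag ε hε
    obtain ⟨hmoeb, haut⟩ := moeb_diag ht k z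
    have key := transport t hγ z hz
    rwa [hmoeb, haut] at key
  -- a finite-index group of totally positive multipliers
  obtain ⟨U, hU, hUsq⟩ := hA5 F 𝔪 h𝔪
  set c : (𝓞 F)ˣ → ℂ := fun η ↦
    if hη : ∃ ε : (𝓞 F)ˣ, (ε : 𝓞 F) - 1 ∈ 𝔪 ∧ η = ε ^ 2 then d hη.choose else 1 with hcdef
  have hc : ∀ η ∈ U, c η ≠ 0 := by
    intro η _
    simp only [hcdef]
    split_ifs with hη
    · exact hd_ne _
    · exact one_ne_zero
  -- rescaling by `N = Nm(𝔪) ∈ 𝔪`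
  set N : ℕ := Ideal.absNorm 𝔪 with hNdef
  have hN : 0 < N := Nat.pos_of_ne_zero fun h0 ↦ h𝔪 (Ideal.absNorm_eq_zero_iff.1 h0)
  have hNmem : ((N : ℕ) : 𝓞 F) ∈ 𝔪 := Ideal.absNorm_mem 𝔪
  set hN_fun : Point F → ℂ := fun z ↦ h (fun σ ↦ (N : ℂ) * z σ) with hN_fun_def
  have hhol_N : IsHolomorphicOn F hN_fun := (hA4 F h N hN).1 hh
  have hper_N : ∀ (b : 𝓞 F) (z : Point F), z ∈ halfSpace F →
      hN_fun (fun σ ↦ z σ + ((σ (b : F) : ℝ) : ℂ)) = hN_fun z := by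
    intro b z hz
    have hmem : ((N : ℕ) : 𝓞 F) * b ∈ 𝔪 := 𝔪.mul_mem_right b hNmem
    have key := hper𝔪 (((N : ℕ) : 𝓞 F) * b) hmem (fun σ ↦ (N : ℂ) * z σ) (natMul_mem_halfSpace hN hz)
    simp only [hN_fun_def]
    convert key using 2
    funext σ
    push_cast [map_mul, map_natCast]
    ring
  have hmod_N : ∀ η ∈ U, (∀ σ : F →+* ℝ, 0 < σ ((η : 𝓞 F) : F)) → ∀ z ∈ halfSpace F,
      hN_fun (fun σ ↦ ((σ ((η : 𝓞 F) : F) : ℝ) : ℂ) * z σ) = c η * hN_fun z := by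
    intro η hη _ z hz
    have hex : ∃ ε : (𝓞 F)ˣ, (ε : 𝓞 F) - 1 ∈ 𝔪 ∧ η = ε ^ 2 := hUsq η hη
    have hcη : c η = d hex.choose := by simp only [hcdef, dif_pos hex]
    obtain ⟨hε1, hηε⟩ := hex.choose_spec
    have key := hunit hex.choose hε1 (fun σ ↦ (N : ℂ) * z σ) (natMul_mem_halfSpace hN hz)
    simp only [hN_fun_def]
    rw [hcη]
    have hval : ((η : 𝓞 F) : F) = ((hex.choose : 𝓞 F) : F) ^ 2 := by
      have hc2 := congrArg (fun u : (𝓞 F)ˣ ↦ ((u : 𝓞 F) : F)) hηε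
      simpa [Units.val_pow_eq_pow_val] using hc2
    convert key using 2
    funext σ
    rw [hval, map_pow]
    push_cast
    ring
  have hbN : IsBoundedAtInfty F hN_fun :=
    Summit.Langlands.Langlands.Theorems.HilbertIntegralOverconvergentIsCongruence.isBoundedAtInfty_of_unit_equivariant
      F hd hN_fun hhol_N hper_N U hU c hc hmod_N
  exact (hA4 F h N hN).2 hbN

/-- **The `q`-series package from the stubs** (composition of M-B2, M-B3 and the landed K-D; real proof). -/
theorem QSeriesPackage_of (hB2 : stub_fourierCoeffAt_of_hasSum) (hB3 : stub_qSeries_holomorphic) :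
    QSeriesPackage := by
  intro F _ _ _ a habs
  obtain ⟨htr, -⟩ :=
    Summit.Langlands.Langlands.Theorems.HilbertIntegralOverconvergentIsCongruence.stub_totallyReal_embeddings F
  refine ⟨hB3 F _ a habs, ?_, ?_⟩
  · intro b z _
    refine tsum_congr fun ν ↦ ?_
    obtain ⟨n, hn⟩ :=
      Summit.Langlands.Langlands.Theorems.HilbertIntegralOverconvergentIsCongruence.koe_sum_mul_embedding_int
        htr ν.2 b
    have hphase : pairing (ν : F) (fun σ ↦ z σ + ((σ (b : F) : ℝ) : ℂ)) = pairing (ν : F) z + n := by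
      simp only [pairing, mul_add, Finset.sum_add_distrib]
      congr 1
      exact_mod_cast hn
    rw [hphase, mul_add, Complex.exp_add]
    have h1 : cexp (2 * Real.pi * I * (n : ℂ)) = 1 := by
      rw [show 2 * Real.pi * I * (n : ℂ) = n * (2 * Real.pi * I) by ring]
      exact Complex.exp_int_mul_two_pi_mul_I n
    rw [h1, mul_one]
  · intro ν hν y hy
    refine hB2 F _ a y (fun x ↦ ?_) (habs y hy) ν hν
    have hs : Summable (fun μ : {ν : F | ∀ b : 𝓞 F, ∃ n : ℤ, Algebra.trace ℚ F (ν * b) = n} ↦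
        a μ * cexp (2 * Real.pi * I * pairing (μ : F) (cubePoint x y))) := by
      refine Summable.of_norm ((habs y hy).congr fun μ ↦ ?_)
      rw [norm_qTerm]
      simp [Summit.Langlands.Langlands.Theorems.HilbertIntegralOverconvergentIsCongruence.koe_cubePoint_im]
    exact hs.hasSum

/-- **RESHAPE 9 from the stubs.** -/
theorem CuspPackage_of (hA1 : stub_slash_mul) (hA6 : stub_slash_holomorphic)
    (hA3 : stub_conj_principal_congruence) (hA4 : stub_rescale) (hA5 : stub_unitCongruence_sq_finiteIndex)
    (hB2 : stub_fourierCoeffAt_of_hasSum) (hB3 : stub_qSeries_holomorphic) : CuspPackage :=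
  ⟨KoecherPrinciple_of hA1 hA6 hA3 hA4 hA5, QSeriesPackage_of hB2 hB3⟩

/-- Feeding the composition the stubs themselves (all LANDED; endpoints landed as `…KoecherPrinciple.lean`). -/
theorem CuspPackage_proof : CuspPackage :=
  CuspPackage_of @Stubs.stub_slash_mul @Stubs.stub_slash_holomorphic @Stubs.stub_conj_principal_congruence
    @Stubs.stub_rescale @Stubs.stub_unitCongruence_sq_finiteIndex @Stubs.stub_fourierCoeffAt_of_hasSum
    @Stubs.stub_qSeries_holomorphic

end Composition

end Cusp

/-!
# § N — RESHAPE 10 (lead c5, cycle 3): the TRANSFER HALF of the crux at function level, unconditional —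
# algebraic over Hilbert modular forms ⇒ modular (`Transfer.AlgebraicIsModular`)

Idea `csp-koecher-collapse` in full: for `F` totally real, `[F:ℚ] ≥ 2`, a holomorphic `𝓞 F`-periodic `g` on `ℍ` (`0` off `ℍ`)
satisfying a non-trivial relation `∑_{j ≤ D} F_j g^j = 0` with `F_j ∈ M_{b_j}(Γ₁(𝔫))`, `b_j + jk = b_0`, lies in
`M_k(Γ₁(𝔪))` for some `𝔪 ≠ 0`.  Proof: the landed abstract transfer `transferAbstract` (Serre's CSP, PROVED, + finite slash
orbit + orbit–stabiliser; p125304) instantiated on the DOMAIN `L` of holomorphic functions on `ℍ` (no zero divisors by the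
identity theorem in several variables, N2) with the slash action of `SL₂(𝓞 F)` (`(γ • φ)(z) = φ(γ⁻¹ z)`, a
`MulSemiringAction` by the action law M-A1) and the cocycle `J_b(γ) = (z ↦ J_b(γ⁻¹, z)) ∈ Lˣ`, `Γ = Γ₁(𝔫)` of finite index
(N4) — this packaging is the lead's N5 — gives the weight-`k` law under some `Γ(𝔪)`; `Γ₁(𝔪) = T(𝓞 F)·Γ(𝔪)` (N3) and
periodicity upgrade it to `Γ₁(𝔪)`; the Koecher principle (§ M) supplies the cusp conditions.
-/

namespace Stubs

/-- **stub N2 — `stub_hol_noZeroDivisors` (LANDED p129326, `…StubHolNoZeroDivisors.lean`).** Holomorphic functions on the (connected) tube domain have no zero divisors: if `f g = 0` on `ℍ` and `f` does not vanish identically on `ℍ`, then `g = 0` on `ℍ` (Osgood + the … (abridged; see the landed file). [folklore] -/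
theorem stub_hol_noZeroDivisors (F : Type) [Field F] [NumberField F] (f g : Point F → ℂ)
    (hf : IsHolomorphicOn F f) (hg : IsHolomorphicOn F g) (hfg : ∀ z ∈ halfSpace F, f z * g z = 0)
    (hf0 : ∃ z ∈ halfSpace F, f z ≠ 0) : ∀ z ∈ halfSpace F, g z = 0 :=
  Summit.Langlands.Langlands.Theorems.HilbertIntegralOverconvergentIsCongruence.stub_hol_noZeroDivisors F f g hf hg hfg hf0

/-- **stub N3 — `stub_gamma1_decomposition` (LANDED p129359, `…StubGamma1Decomposition.lean`).** `Γ₁(𝔪) = T(𝓞 F) · Γ(𝔪)`: every element of `Γ₁(𝔪)` is a translation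
`(1 b; 0 1)`, `b ∈ 𝓞 F`, times an element of the principal congruence subgroup `Γ(𝔪)` (take `b` = the upper-right entry:
`(1 -b; 0 1)γ ≡ 1 (mod 𝔪)` because `d ≡ 1`, `c ≡ 0`, `a ≡ ad - bc = 1`). [folklore] -/
theorem stub_gamma1_decomposition (F : Type) [Field F] [NumberField F] (𝔪 : Ideal (𝓞 F)) (γ : SL(2, 𝓞 F))
    (hγ : γ ∈ Bianchi.Gamma1 𝔪) :
    ∃ (b : 𝓞 F) (t γ' : SL(2, 𝓞 F)), (t : Matrix (Fin 2) (Fin 2) (𝓞 F)) = !![1, b; 0, 1] ∧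
      γ' ∈ Bianchi.Gamma 𝔪 ∧ γ = t * γ' :=
  Summit.Langlands.Langlands.Theorems.HilbertIntegralOverconvergentIsCongruence.stub_gamma1_decomposition F 𝔪 γ hγ

/-- **stub N4 — `stub_gamma1_finiteIndex` (LANDED p129361, `…StubGamma1FiniteIndex.lean`).** `Γ₁(𝔫)` has finite index in `SL₂(𝓞 F)` for `𝔫 ≠ 0` (it contains the kernel
`Γ(𝔫)` of the reduction map to the finite group `SL₂(𝓞 F ⧸ 𝔫)`). [folklore] -/
theorem stub_gamma1_finiteIndex (F : Type) [Field F] [NumberField F] (𝔫 : Ideal (𝓞 F)) (h𝔫 : 𝔫 ≠ ⊥) :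
    (Bianchi.Gamma1 𝔫 : Subgroup SL(2, 𝓞 F)).FiniteIndex :=
  Summit.Langlands.Langlands.Theorems.HilbertIntegralOverconvergentIsCongruence.stub_gamma1_finiteIndex F 𝔫 h𝔫

/-- **stub N5 — `stub_transfer_functions` (LANDED pending, `…StubTransferFunctions.lean` (lead)).** The TRANSFER at function level, unconditional: a holomorphic `g` on `ℍ`, algebraic over the ring of Hilbert modular forms of a finite-index level `Γ₁(𝔫)` — a non-trivial relation … (abridged; see the landed file). [folklore] -/
theorem stub_transfer_functions (F : Type) [Field F] [NumberField F] [NumberField.IsTotallyReal F]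
    (hd : 1 < Module.finrank ℚ F)
    (hnzd : ∀ f g : Point F → ℂ, IsHolomorphicOn F f → IsHolomorphicOn F g →
      (∀ z ∈ halfSpace F, f z * g z = 0) → (∃ z ∈ halfSpace F, f z ≠ 0) → ∀ z ∈ halfSpace F, g z = 0)
    (𝔫 : Ideal (𝓞 F)) (hΓ : (Bianchi.Gamma1 𝔫 : Subgroup SL(2, 𝓞 F)).FiniteIndex) (k : (F →+* ℝ) → ℤ) (D : ℕ)
    (b : ℕ → (F →+* ℝ) → ℤ) (hb : ∀ j ≤ D, b j + j • k = b 0)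
    (Fm : ℕ → Point F → ℂ) (hFm : ∀ j ≤ D, Fm j ∈ modularForms (Bianchi.Gamma1 𝔫) (b j))
    (hFm0 : ∃ j ≤ D, ∃ z ∈ halfSpace F, Fm j z ≠ 0)
    (g : Point F → ℂ) (hg : IsHolomorphicOn F g)
    (hrel : ∀ z ∈ halfSpace F, ∑ j ∈ Finset.range (D + 1), Fm j z * g z ^ j = 0) :
    ∃ 𝔪 : Ideal (𝓞 F), 𝔪 ≠ ⊥ ∧ ∀ γ ∈ Bianchi.Gamma 𝔪, ∀ z ∈ halfSpace F,
      g (moeb (toSL2F γ) z) = autFactor k (toSL2F γ) z * g z :=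
  Summit.Langlands.Langlands.Theorems.HilbertIntegralOverconvergentIsCongruence.stub_transfer_functions F hd hnzd 𝔫 hΓ k D b hb Fm hFm hFm0 g hg hrel

end Stubs

namespace Transfer

/-- Statement of stub N2, by name. -/
def stub_hol_noZeroDivisors : Prop := type_of% @Stubs.stub_hol_noZeroDivisors
/-- Statement of stub N3, by name. -/
def stub_gamma1_decomposition : Prop := type_of% @Stubs.stub_gamma1_decomposition
/-- Statement of stub N4, by name. -/
def stub_gamma1_finiteIndex : Prop := type_of% @Stubs.stub_gamma1_finiteIndex
/-- Statement of stub N5, by name. -/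
def stub_transfer_functions : Prop := type_of% @Stubs.stub_transfer_functions

/-- **Algebraic over Hilbert modular forms ⇒ modular** (target of RESHAPE 10; idea `csp-koecher-collapse` in full,
unconditional): for `F` totally real of degree `≥ 2`, a holomorphic `𝓞 F`-periodic `g` on `ℍ`, `0` off `ℍ`, which satisfies
a non-trivial polynomial relation with Hilbert-modular-form coefficients of level `Γ₁(𝔫)`, `𝔫 ≠ 0`, and weights
`b_j + jk = b_0`, is a Hilbert modular form of weight `k` on `Γ₁(𝔪)` for some `𝔪 ≠ 0`. -/
def AlgebraicIsModular : Prop :=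
  ∀ (F : Type) [Field F] [NumberField F] [NumberField.IsTotallyReal F], 1 < Module.finrank ℚ F →
  ∀ (𝔫 : Ideal (𝓞 F)), 𝔫 ≠ ⊥ → ∀ (k : (F →+* ℝ) → ℤ) (D : ℕ) (b : ℕ → (F →+* ℝ) → ℤ),
    (∀ j ≤ D, b j + j • k = b 0) →
  ∀ (Fm : ℕ → Point F → ℂ), (∀ j ≤ D, Fm j ∈ modularForms (Bianchi.Gamma1 𝔫) (b j)) →
    (∃ j ≤ D, ∃ z ∈ halfSpace F, Fm j z ≠ 0) →
  ∀ (g : Point F → ℂ), IsHolomorphicOn F g → (∀ z ∉ halfSpace F, g z = 0) →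
    (∀ (a : 𝓞 F) (z : Point F), z ∈ halfSpace F → g (fun σ ↦ z σ + ((σ (a : F) : ℝ) : ℂ)) = g z) →
    (∀ z ∈ halfSpace F, ∑ j ∈ Finset.range (D + 1), Fm j z * g z ^ j = 0) →
  ∃ 𝔪 : Ideal (𝓞 F), 𝔪 ≠ ⊥ ∧ g ∈ modularForms (Bianchi.Gamma1 𝔪) k

section Composition

variable {F : Type} [Field F] [NumberField F]

omit [NumberField F] in
/-- The image in `SL₂(F)` of an integral translation matrix is the translation matrix. -/
theorem coe_toSL2F_transl {t : SL(2, 𝓞 F)} {b : 𝓞 F} (ht : (t : Matrix (Fin 2) (Fin 2) (𝓞 F)) = !![1, b; 0, 1]) :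
    ((toSL2F t : SL(2, F)) : Matrix (Fin 2) (Fin 2) F) = !![1, (b : F); 0, 1] := by
  have h : ∀ i j, t i j = !![(1 : 𝓞 F), b; 0, 1] i j := fun i j ↦ by rw [← ht]
  ext i j
  rw [Matrix.SpecialLinearGroup.map_apply_coe, RingHom.mapMatrix_apply, Matrix.map_apply, h i j]
  fin_cases i <;> fin_cases j <;> simp

/-- **Algebraic over Hilbert modular forms ⇒ modular, from the stubs** (composition of N2, N3, N4, N5 with the landed M-A1
and the Koecher principle of § M; real proof). -/
theorem AlgebraicIsModular_of (hN2 : stub_hol_noZeroDivisors) (hN3 : stub_gamma1_decomposition)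
    (hN4 : stub_gamma1_finiteIndex) (hN5 : stub_transfer_functions) : AlgebraicIsModular := by
  intro F _ _ _ hd 𝔫 h𝔫 k D b hb Fm hFm hFm0 g hg hzero hper hrel
  obtain ⟨𝔪, h𝔪, hlaw⟩ := hN5 F hd (hN2 F) 𝔫 (hN4 F 𝔫 h𝔫) k D b hb Fm hFm hFm0 g hg hrel
  refine ⟨𝔪, h𝔪, ?_⟩
  -- the law under `Γ₁(𝔪) = T(𝓞 F) · Γ(𝔪)`
  have hlaw1 : ∀ γ ∈ Bianchi.Gamma1 𝔪, ∀ z ∈ halfSpace F,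
      g (moeb (toSL2F γ) z) = autFactor k (toSL2F γ) z * g z := by
    intro γ hγ z hz
    obtain ⟨a, t, γ', ht, hγ', rfl⟩ := hN3 F 𝔪 γ hγ
    obtain ⟨hγ'z, hmoeb, haut, -⟩ :=
      Summit.Langlands.Langlands.Theorems.HilbertIntegralOverconvergentIsCongruence.stub_slash_mul F k (toSL2F t)
        (toSL2F γ') g z hz
    obtain ⟨htm, hta⟩ := Cusp.moeb_transl (coe_toSL2F_transl ht) k (moeb (toSL2F γ') z)
    rw [map_mul, hmoeb, haut, htm, hta, one_mul, hper a _ hγ'z, hlaw γ' hγ' z hz]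
  exact (Cusp.CuspPackage_proof).1 F hd 𝔪 h𝔪 (Bianchi.Gamma1 𝔪) (Bianchi.Gamma_le_Gamma1 𝔪) k g hg hlaw1 hzero

/-- Feeding the composition the stubs themselves. -/
theorem AlgebraicIsModular_proof : AlgebraicIsModular :=
  AlgebraicIsModular_of @Stubs.stub_hol_noZeroDivisors @Stubs.stub_gamma1_decomposition @Stubs.stub_gamma1_finiteIndex
    @Stubs.stub_transfer_functions

end Composition

end Transfer

/-!
# § O — RESHAPE 11 (lead c5, cycle 4): the `q`-EXPANSION DICTIONARY — multiplicativity on the cone and the encoding into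
# `MvPowerSeries (Fin d)` (the glue of the engine instance (ALG), see the crux NOTES)

For holomorphic `𝓞 F`-periodic functions whose Fourier coefficients live on the cone `qIndexSet F` (modular forms, by Koecher),
`a_ν(fg) = ∑_{μ+μ'=ν} a_μ(f) a_{μ'}(g)` (finite: O1; Cauchy product + coefficient uniqueness: O2, the lead's), and along the
trace-basis encoding `ν ↦ (Tr(β_j ν))_j ∈ ℕ^d` (O3, from the landed S10a/b, S13a) the encoded `q`-expansion of `fg` is the
`MvPowerSeries` product of the encoded expansions (O4): `Dictionary.QExpansionDictionary`.
-/

namespace Stubs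

/-- **stub O1 — `stub_finite_qIndex_antidiagonal` (LANDED p129894, `…StubFiniteQIndexAntidiagonal.lean`).** For `ν ∈ F`, only finitely many pairs `(μ, μ')` of `q`-expansion indices (`HilbertModular.qIndexSet`: in the dual lattice, `0` or totally positive) have `μ + μ' = ν` (both … (abridged; see the landed file). [folklore] -/
theorem stub_finite_qIndex_antidiagonal (F : Type) [Field F] [NumberField F] [NumberField.IsTotallyReal F] (ν : F) :
    {μ : F × F | μ.1 ∈ qIndexSet F ∧ μ.2 ∈ qIndexSet F ∧ μ.1 + μ.2 = ν}.Finite :=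
  Summit.Langlands.Langlands.Theorems.HilbertIntegralOverconvergentIsCongruence.stub_finite_qIndex_antidiagonal F ν

/-- **stub O2 — `stub_fourierCoeff_mul` (LANDED p129976 pending, `…StubFourierCoeffMul.lean` (lead)).** Multiplicativity of `q`-expansions: for holomorphic `𝓞 F`-periodic `f`, `g` on `ℍ` whose Fourier coefficients vanish off the cone `qIndexSet F` (as they do for modular forms, by … (abridged; see the landed file). [cite: Freitag1990, Ch. I §4] -/
theorem stub_fourierCoeff_mul (F : Type) [Field F] [NumberField F] [NumberField.IsTotallyReal F] (f g : Point F → ℂ)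
    (hf : IsHolomorphicOn F f) (hg : IsHolomorphicOn F g)
    (hperf : ∀ (a : 𝓞 F) (z : Point F), z ∈ halfSpace F → f (fun σ ↦ z σ + ((σ (a : F) : ℝ) : ℂ)) = f z)
    (hperg : ∀ (a : 𝓞 F) (z : Point F), z ∈ halfSpace F → g (fun σ ↦ z σ + ((σ (a : F) : ℝ) : ℂ)) = g z)
    (hsf : ∀ μ : F, (∀ a : 𝓞 F, ∃ n : ℤ, Algebra.trace ℚ F (μ * a) = n) → μ ∉ qIndexSet F → fourierCoeff f μ = 0)
    (hsg : ∀ μ : F, (∀ a : 𝓞 F, ∃ n : ℤ, Algebra.trace ℚ F (μ * a) = n) → μ ∉ qIndexSet F → fourierCoeff g μ = 0)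
    (ν : F) (hν : ∀ a : 𝓞 F, ∃ n : ℤ, Algebra.trace ℚ F (ν * a) = n) (T : Finset (F × F))
    (hT : ∀ μ : F × F, μ ∈ T ↔ μ.1 ∈ qIndexSet F ∧ μ.2 ∈ qIndexSet F ∧ μ.1 + μ.2 = ν) :
    fourierCoeff (f * g) ν = ∑ μ ∈ T, fourierCoeff f μ.1 * fourierCoeff g μ.2 :=
  Summit.Langlands.Langlands.Theorems.HilbertIntegralOverconvergentIsCongruence.stub_fourierCoeff_mul F f g hf hg hperf hperg hsf hsg ν hν T hT

/-- **stub O3 — `stub_qIndex_encoding` (LANDED p129914, `…StubQIndexEncoding.lean`).** The exponents of Hilbert `q`-expansions embed additively and injectively into `ℕ^d`,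
`d = [F:ℚ]`: `ν ↦ (Tr(β_j ν))_j` for a `ℚ`-basis `β` of totally positive algebraic integers (landed S13a, S10a, S10b).
[folklore] -/
theorem stub_qIndex_encoding (F : Type) [Field F] [NumberField F] [NumberField.IsTotallyReal F] :
    ∃ (d : ℕ) (idx : F → (Fin d →₀ ℕ)), Set.InjOn idx (qIndexSet F) ∧
      ∀ μ ∈ qIndexSet F, ∀ μ' ∈ qIndexSet F, idx (μ + μ') = idx μ + idx μ' :=
  Summit.Langlands.Langlands.Theorems.HilbertIntegralOverconvergentIsCongruence.stub_qIndex_encoding F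

/-- **stub O4 — `stub_encoded_mul` (LANDED p130028, `…StubEncodedMul.lean`).** Under an encoding of the cone of `q`-indices into `ℕ^d` (injective, additive on the cone), the `MvPowerSeries` product of two encoded coefficient functions encodes their cone … (abridged; see the landed file). [folklore] -/
theorem stub_encoded_mul (F : Type) [Field F] [NumberField F] {d : ℕ} (idx : F → (Fin d →₀ ℕ))
    (hinj : Set.InjOn idx (qIndexSet F)) (hadd : ∀ μ ∈ qIndexSet F, ∀ μ' ∈ qIndexSet F, idx (μ + μ') = idx μ + idx μ')
    (R : Type) [CommRing R] (a b : F → R) (A B : MvPowerSeries (Fin d) R)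
    (hA : ∀ μ ∈ qIndexSet F, MvPowerSeries.coeff (idx μ) A = a μ)
    (hA0 : ∀ n, (∀ μ ∈ qIndexSet F, idx μ ≠ n) → MvPowerSeries.coeff n A = 0)
    (hB : ∀ μ ∈ qIndexSet F, MvPowerSeries.coeff (idx μ) B = b μ)
    (hB0 : ∀ n, (∀ μ ∈ qIndexSet F, idx μ ≠ n) → MvPowerSeries.coeff n B = 0) :
    (∀ ν ∈ qIndexSet F, ∀ T : Finset (F × F),
        (∀ μ : F × F, μ ∈ T ↔ μ.1 ∈ qIndexSet F ∧ μ.2 ∈ qIndexSet F ∧ μ.1 + μ.2 = ν) →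
        MvPowerSeries.coeff (idx ν) (A * B) = ∑ μ ∈ T, a μ.1 * b μ.2) ∧
      ∀ n, (∀ μ ∈ qIndexSet F, idx μ ≠ n) → MvPowerSeries.coeff n (A * B) = 0 :=
  Summit.Langlands.Langlands.Theorems.HilbertIntegralOverconvergentIsCongruence.stub_encoded_mul F idx hinj hadd R a b A B hA hA0 hB hB0

end Stubs

namespace Dictionary

/-- Statement of stub O1, by name. -/
def stub_finite_qIndex_antidiagonal : Prop := type_of% @Stubs.stub_finite_qIndex_antidiagonal
/-- Statement of stub O2, by name. -/
def stub_fourierCoeff_mul : Prop := type_of% @Stubs.stub_fourierCoeff_mul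
/-- Statement of stub O3, by name. -/
def stub_qIndex_encoding : Prop := type_of% @Stubs.stub_qIndex_encoding
/-- Statement of stub O4, by name. -/
def stub_encoded_mul : Prop := type_of% @Stubs.stub_encoded_mul

/-- `A` encodes the coefficient function `a` along `idx`: the encoded cone indices carry `a`, all other coefficients vanish. -/
def Encodes {F : Type} [Field F] [NumberField F] {d : ℕ} (idx : F → (Fin d →₀ ℕ)) (a : F → ℂ)
    (A : MvPowerSeries (Fin d) ℂ) : Prop :=
  (∀ μ ∈ qIndexSet F, MvPowerSeries.coeff (idx μ) A = a μ) ∧ ∀ n, (∀ μ ∈ qIndexSet F, idx μ ≠ n) → MvPowerSeries.coeff n A = 0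

/-- **The `q`-expansion dictionary** (target of RESHAPE 11): there is an encoding of the cone of `q`-indices into `ℕ^d` along
which the encoded `q`-expansion of a product of holomorphic `𝓞 F`-periodic functions with cone-supported coefficients is the
`MvPowerSeries` product of the encoded `q`-expansions — the multiplicative half of the dictionary the engine instance needs
(`V b` closed under products). -/
def QExpansionDictionary : Prop :=
  ∀ (F : Type) [Field F] [NumberField F] [NumberField.IsTotallyReal F],
  ∃ (d : ℕ) (idx : F → (Fin d →₀ ℕ)), Set.InjOn idx (qIndexSet F) ∧
    (∀ μ ∈ qIndexSet F, ∀ μ' ∈ qIndexSet F, idx (μ + μ') = idx μ + idx μ') ∧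
  ∀ (f g : Point F → ℂ), IsHolomorphicOn F f → IsHolomorphicOn F g →
    (∀ (a : 𝓞 F) (z : Point F), z ∈ halfSpace F → f (fun σ ↦ z σ + ((σ (a : F) : ℝ) : ℂ)) = f z) →
    (∀ (a : 𝓞 F) (z : Point F), z ∈ halfSpace F → g (fun σ ↦ z σ + ((σ (a : F) : ℝ) : ℂ)) = g z) →
    (∀ μ : F, (∀ a : 𝓞 F, ∃ n : ℤ, Algebra.trace ℚ F (μ * a) = n) → μ ∉ qIndexSet F → fourierCoeff f μ = 0) →
    (∀ μ : F, (∀ a : 𝓞 F, ∃ n : ℤ, Algebra.trace ℚ F (μ * a) = n) → μ ∉ qIndexSet F → fourierCoeff g μ = 0) →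
  ∀ (A B P : MvPowerSeries (Fin d) ℂ), Encodes idx (fourierCoeff f) A → Encodes idx (fourierCoeff g) B →
    Encodes idx (fourierCoeff (f * g)) P → P = A * B

/-- **The dictionary for a GIVEN encoding** (parametric form): O1, O2, O4 along any `idx` injective and additive on the cone. -/
theorem dict_of_idx (h1 : stub_finite_qIndex_antidiagonal) (h2 : stub_fourierCoeff_mul) (h4 : stub_encoded_mul)
    (F : Type) [Field F] [NumberField F] [NumberField.IsTotallyReal F] (d : ℕ) (idx : F → (Fin d →₀ ℕ))
    (hinj : Set.InjOn idx (qIndexSet F)) (hadd : ∀ μ ∈ qIndexSet F, ∀ μ' ∈ qIndexSet F, idx (μ + μ') = idx μ + idx μ') :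
    ∀ (f g : Point F → ℂ), IsHolomorphicOn F f → IsHolomorphicOn F g →
      (∀ (a : 𝓞 F) (z : Point F), z ∈ halfSpace F → f (fun σ ↦ z σ + ((σ (a : F) : ℝ) : ℂ)) = f z) →
      (∀ (a : 𝓞 F) (z : Point F), z ∈ halfSpace F → g (fun σ ↦ z σ + ((σ (a : F) : ℝ) : ℂ)) = g z) →
      (∀ μ : F, (∀ a : 𝓞 F, ∃ n : ℤ, Algebra.trace ℚ F (μ * a) = n) → μ ∉ qIndexSet F → fourierCoeff f μ = 0) →
      (∀ μ : F, (∀ a : 𝓞 F, ∃ n : ℤ, Algebra.trace ℚ F (μ * a) = n) → μ ∉ qIndexSet F → fourierCoeff g μ = 0) →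
      ∀ (A B P : MvPowerSeries (Fin d) ℂ), Encodes idx (fourierCoeff f) A → Encodes idx (fourierCoeff g) B →
        Encodes idx (fourierCoeff (f * g)) P → P = A * B := by
  intro f g hf hg hperf hperg hsf hsg A B P hA hB hP
  obtain ⟨hmul, hzero⟩ := h4 F idx hinj hadd ℂ (fourierCoeff f) (fourierCoeff g) A B hA.1 hA.2 hB.1 hB.2
  ext n
  by_cases hn : ∃ ν ∈ qIndexSet F, idx ν = n
  · obtain ⟨ν, hν, rfl⟩ := hn
    set T : Finset (F × F) := (h1 F ν).toFinset with hTdef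
    have hT : ∀ μ : F × F, μ ∈ T ↔ μ.1 ∈ qIndexSet F ∧ μ.2 ∈ qIndexSet F ∧ μ.1 + μ.2 = ν := fun μ ↦ by
      rw [hTdef, Set.Finite.mem_toFinset]; rfl
    rw [hP.1 ν hν, hmul ν hν T hT]
    exact h2 F f g hf hg hperf hperg hsf hsg ν hν.1 T hT
  · push Not at hn
    rw [hP.2 n hn, hzero n hn]

/-- **The dictionary from the stubs** (composition of O1–O4; real proof). -/
theorem QExpansionDictionary_of (h1 : stub_finite_qIndex_antidiagonal) (h2 : stub_fourierCoeff_mul)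
    (h3 : stub_qIndex_encoding) (h4 : stub_encoded_mul) : QExpansionDictionary := by
  intro F _ _ _
  obtain ⟨d, idx, hinj, hadd⟩ := h3 F
  exact ⟨d, idx, hinj, hadd, dict_of_idx h1 h2 h4 F d idx hinj hadd⟩

/-- Feeding the composition the stubs themselves. -/
theorem QExpansionDictionary_proof : QExpansionDictionary :=
  QExpansionDictionary_of @Stubs.stub_finite_qIndex_antidiagonal @Stubs.stub_fourierCoeff_mul @Stubs.stub_qIndex_encoding
    @Stubs.stub_encoded_mul

end Dictionary

/-!
# § P — RESHAPE 12 (lead c5, cycle 5): the `q`-EXPANSION PRINCIPLE over `ℂ` — the graded algebra of Hilbert modular forms of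
# level `Γ₁(𝔫)` embeds into `MvPowerSeries (Fin d) ℂ` along the encoded `q`-expansion (`QPrinciple.HilbertQExpansionRing`)

With § O's dictionary: Fourier coefficients of forms live on the cone (P1, Koecher at `∞` with the congruence-unit multipliers),
are linear in the form (P2), determine the form (P3, the Fourier expansion), the indicator of `ℍ` is the unit form of weight `0`
with `q`-expansion `1` (P4), forms are `𝓞 F`-periodic (P5); hence the encoded `q`-expansion `enc` is an INJECTIVE map from
`⋃_b M_b(Γ₁(𝔫))` to `MvPowerSeries (Fin d) ℂ` with `enc (fg) = enc f · enc g`, `enc (f+g) = enc f + enc g`, `enc (c f) = c enc f`,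
`enc 1_ℍ = 1` — the engine's family axioms for `V b = enc '' M_b` over `ℂ` (the `E`-rational / `p`-adic versions then only need
the named integral-structure facts of the crux NOTES).
-/

namespace Stubs

/-- **stub P1 — `stub_modularForm_coeff_support` (LANDED p130522 pending, `…StubModularFormCoeffSupport.lean` (lead)).** Fourier coefficients of Hilbert modular forms of level `Γ₁(𝔫)` (`𝔫 ≠ 0`, `[F:ℚ] ≥ 2`) live on the cone: `a_μ(f) = 0` for every `μ` of the dual lattice that is neither `0` nor … (abridged; see the landed file). [cite: Freitag1990, Ch. I Prop. 4.9] -/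
theorem stub_modularForm_coeff_support (F : Type) [Field F] [NumberField F] [NumberField.IsTotallyReal F]
    (hd : 1 < Module.finrank ℚ F) (𝔫 : Ideal (𝓞 F)) (h𝔫 : 𝔫 ≠ ⊥) (k : (F →+* ℝ) → ℤ) (f : Point F → ℂ)
    (hf : f ∈ modularForms (Bianchi.Gamma1 𝔫) k) (μ : F) (hμ : ∀ a : 𝓞 F, ∃ n : ℤ, Algebra.trace ℚ F (μ * a) = n)
    (hμc : μ ∉ qIndexSet F) : fourierCoeff f μ = 0 :=
  Summit.Langlands.Langlands.Theorems.HilbertIntegralOverconvergentIsCongruence.stub_modularForm_coeff_support F hd 𝔫 h𝔫 k f hf μ hμ hμc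

/-- **stub P2 — `stub_fourierCoeff_linear` (LANDED p130484, `…StubFourierCoeffLinear.lean`).** The Fourier coefficients at a height `y ≫ 0` are `ℂ`-linear on functions
continuous on `ℍ` (integrability of the cube integrands), and vanish on `0`. [folklore] -/
theorem stub_fourierCoeff_linear (F : Type) [Field F] [NumberField F] (f g : Point F → ℂ)
    (hf : ContinuousOn f (halfSpace F)) (hg : ContinuousOn g (halfSpace F)) (c : ℂ) (ν : F) (y : (F →+* ℝ) → ℝ)
    (hy : ∀ σ, 0 < y σ) :
    fourierCoeffAt (f + g) ν y = fourierCoeffAt f ν y + fourierCoeffAt g ν y ∧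
      fourierCoeffAt (c • f) ν y = c * fourierCoeffAt f ν y ∧ fourierCoeffAt (0 : Point F → ℂ) ν y = 0 :=
  Summit.Langlands.Langlands.Theorems.HilbertIntegralOverconvergentIsCongruence.stub_fourierCoeff_linear F f g hf hg c ν y hy

/-- **stub P3 — `stub_qExpansion_injective` (LANDED p130485, `…StubQExpansionInjective.lean`).** The `q`-expansion principle over `ℂ`: two holomorphic `𝓞 F`-periodic functions on
`ℍ` with the same Fourier coefficients on the dual lattice agree on `ℍ` (both are the sum of the same Fourier series, landed
`hasSum_fourierCoeff`). [cite: Freitag1990, Ch. I Lemma 4.1] -/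
theorem stub_qExpansion_injective (F : Type) [Field F] [NumberField F] [NumberField.IsTotallyReal F] (f g : Point F → ℂ)
    (hf : IsHolomorphicOn F f) (hg : IsHolomorphicOn F g)
    (hperf : ∀ (a : 𝓞 F) (z : Point F), z ∈ halfSpace F → f (fun σ ↦ z σ + ((σ (a : F) : ℝ) : ℂ)) = f z)
    (hperg : ∀ (a : 𝓞 F) (z : Point F), z ∈ halfSpace F → g (fun σ ↦ z σ + ((σ (a : F) : ℝ) : ℂ)) = g z)
    (hcoef : ∀ μ : F, (∀ a : 𝓞 F, ∃ n : ℤ, Algebra.trace ℚ F (μ * a) = n) → fourierCoeff f μ = fourierCoeff g μ) :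
    ∀ z ∈ halfSpace F, f z = g z :=
  Summit.Langlands.Langlands.Theorems.HilbertIntegralOverconvergentIsCongruence.stub_qExpansion_injective F f g hf hg hperf hperg hcoef

/-- **stub P4 — `stub_indicator_modularForm` (LANDED p130564, `…StubIndicatorModularForm.lean`).** The indicator function of `ℍ` (the constant `1`, normalised to `0` off `ℍ`) is a
Hilbert modular form of weight `0` for every level, and its Fourier coefficients on the dual lattice are `[μ = 0]` (cube
orthogonality, landed `qu_cube_orthogonality`). [folklore] -/
theorem stub_indicator_modularForm (F : Type) [Field F] [NumberField F] [NumberField.IsTotallyReal F]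
    (Γ : Subgroup SL(2, 𝓞 F)) :
    (halfSpace F).indicator (fun _ ↦ (1 : ℂ)) ∈ modularForms Γ 0 ∧
      fourierCoeff ((halfSpace F).indicator (fun _ ↦ (1 : ℂ))) 0 = 1 ∧
      ∀ μ : F, (∀ a : 𝓞 F, ∃ n : ℤ, Algebra.trace ℚ F (μ * a) = n) → μ ≠ 0 →
        fourierCoeff ((halfSpace F).indicator (fun _ ↦ (1 : ℂ))) μ = 0 :=
  Summit.Langlands.Langlands.Theorems.HilbertIntegralOverconvergentIsCongruence.stub_indicator_modularForm F Γ

/-- **stub P5 — `stub_modularForm_periodic` (LANDED p130537, `…StubModularFormPeriodic.lean`).** Hilbert modular forms of level `Γ₁(𝔫)` are `𝓞 F`-periodic on `ℍ` (the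
translations `(1 a; 0 1)`, `a ∈ 𝓞 F`, lie in `Γ₁(𝔫)` and act by `z ↦ z + a` with automorphy factor `1`). [folklore] -/
theorem stub_modularForm_periodic (F : Type) [Field F] [NumberField F] (𝔫 : Ideal (𝓞 F)) (k : (F →+* ℝ) → ℤ)
    (f : Point F → ℂ) (hf : f ∈ modularForms (Bianchi.Gamma1 𝔫) k) :
    ∀ (a : 𝓞 F) (z : Point F), z ∈ halfSpace F → f (fun σ ↦ z σ + ((σ (a : F) : ℝ) : ℂ)) = f z :=
  Summit.Langlands.Langlands.Theorems.HilbertIntegralOverconvergentIsCongruence.stub_modularForm_periodic F 𝔫 k f hf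

end Stubs

namespace QPrinciple

/-- Statement of stub P1, by name. -/
def stub_modularForm_coeff_support : Prop := type_of% @Stubs.stub_modularForm_coeff_support
/-- Statement of stub P2, by name. -/
def stub_fourierCoeff_linear : Prop := type_of% @Stubs.stub_fourierCoeff_linear
/-- Statement of stub P3, by name. -/
def stub_qExpansion_injective : Prop := type_of% @Stubs.stub_qExpansion_injective
/-- Statement of stub P4, by name. -/
def stub_indicator_modularForm : Prop := type_of% @Stubs.stub_indicator_modularForm
/-- Statement of stub P5, by name. -/
def stub_modularForm_periodic : Prop := type_of% @Stubs.stub_modularForm_periodic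

/-- **The `q`-expansion principle over `ℂ` for Hilbert modular forms** (target of RESHAPE 12): for `F` totally real of degree
`≥ 2` and `𝔫 ≠ 0` there are an encoding `idx` of the cone of `q`-indices into `ℕ^d` and a map `enc` from functions to
`MvPowerSeries (Fin d) ℂ` which, on Hilbert modular forms of level `Γ₁(𝔫)` (all weights), encodes the `q`-expansion, is
multiplicative, additive, `ℂ`-homogeneous, sends the unit form `1_ℍ` to `1`, and is INJECTIVE. -/
def HilbertQExpansionRing : Prop :=
  ∀ (F : Type) [Field F] [NumberField F] [NumberField.IsTotallyReal F], 1 < Module.finrank ℚ F →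
  ∀ (𝔫 : Ideal (𝓞 F)), 𝔫 ≠ ⊥ →
  ∃ (d : ℕ) (idx : F → (Fin d →₀ ℕ)) (enc : (Point F → ℂ) → MvPowerSeries (Fin d) ℂ),
    Set.InjOn idx (qIndexSet F) ∧ (∀ μ ∈ qIndexSet F, ∀ μ' ∈ qIndexSet F, idx (μ + μ') = idx μ + idx μ') ∧
    (∀ f : Point F → ℂ, (∀ μ ∈ qIndexSet F, MvPowerSeries.coeff (idx μ) (enc f) = fourierCoeff f μ) ∧
        ∀ n, (∀ μ ∈ qIndexSet F, idx μ ≠ n) → MvPowerSeries.coeff n (enc f) = 0) ∧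
    (∀ (k k' : (F →+* ℝ) → ℤ) (f g : Point F → ℂ), f ∈ modularForms (Bianchi.Gamma1 𝔫) k →
        g ∈ modularForms (Bianchi.Gamma1 𝔫) k' → enc (f * g) = enc f * enc g) ∧
    (∀ (k : (F →+* ℝ) → ℤ) (f g : Point F → ℂ), f ∈ modularForms (Bianchi.Gamma1 𝔫) k →
        g ∈ modularForms (Bianchi.Gamma1 𝔫) k → enc (f + g) = enc f + enc g) ∧
    (∀ (k : (F →+* ℝ) → ℤ) (c : ℂ) (f : Point F → ℂ), f ∈ modularForms (Bianchi.Gamma1 𝔫) k →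
        enc (c • f) = c • enc f) ∧
    ((halfSpace F).indicator (fun _ ↦ (1 : ℂ)) ∈ modularForms (Bianchi.Gamma1 𝔫) 0 ∧
        enc ((halfSpace F).indicator (fun _ ↦ (1 : ℂ))) = 1) ∧
    ∀ (k k' : (F →+* ℝ) → ℤ) (f g : Point F → ℂ), f ∈ modularForms (Bianchi.Gamma1 𝔫) k →
        g ∈ modularForms (Bianchi.Gamma1 𝔫) k' → enc f = enc g → f = g

section Composition

variable {F : Type} [Field F] [NumberField F]

/-- **The `q`-expansion principle for a GIVEN encoding** (parametric form of the composition below): any encoding `idx` of the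
cone, injective and additive there, along which the multiplicative dictionary holds, carries the graded-algebra embedding `enc`. -/
theorem qexpRing_of_dict (hP1 : stub_modularForm_coeff_support) (hP2 : stub_fourierCoeff_linear)
    (hP3 : stub_qExpansion_injective) (hP4 : stub_indicator_modularForm) (hP5 : stub_modularForm_periodic)
    (F : Type) [Field F] [NumberField F] [NumberField.IsTotallyReal F] (hd : 1 < Module.finrank ℚ F) (𝔫 : Ideal (𝓞 F))
    (h𝔫 : 𝔫 ≠ ⊥) (d : ℕ) (idx : F → (Fin d →₀ ℕ)) (hinj : Set.InjOn idx (qIndexSet F))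
    (hadd : ∀ μ ∈ qIndexSet F, ∀ μ' ∈ qIndexSet F, idx (μ + μ') = idx μ + idx μ')
    (hdict : ∀ (f g : Point F → ℂ), IsHolomorphicOn F f → IsHolomorphicOn F g →
      (∀ (a : 𝓞 F) (z : Point F), z ∈ halfSpace F → f (fun σ ↦ z σ + ((σ (a : F) : ℝ) : ℂ)) = f z) →
      (∀ (a : 𝓞 F) (z : Point F), z ∈ halfSpace F → g (fun σ ↦ z σ + ((σ (a : F) : ℝ) : ℂ)) = g z) →
      (∀ μ : F, (∀ a : 𝓞 F, ∃ n : ℤ, Algebra.trace ℚ F (μ * a) = n) → μ ∉ qIndexSet F → fourierCoeff f μ = 0) →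
      (∀ μ : F, (∀ a : 𝓞 F, ∃ n : ℤ, Algebra.trace ℚ F (μ * a) = n) → μ ∉ qIndexSet F → fourierCoeff g μ = 0) →
      ∀ (A B P : MvPowerSeries (Fin d) ℂ), Dictionary.Encodes idx (fourierCoeff f) A → Dictionary.Encodes idx (fourierCoeff g) B →
        Dictionary.Encodes idx (fourierCoeff (f * g)) P → P = A * B) :
    ∃ (enc : (Point F → ℂ) → MvPowerSeries (Fin d) ℂ),
      (∀ f : Point F → ℂ, (∀ μ ∈ qIndexSet F, MvPowerSeries.coeff (idx μ) (enc f) = fourierCoeff f μ) ∧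
          ∀ n, (∀ μ ∈ qIndexSet F, idx μ ≠ n) → MvPowerSeries.coeff n (enc f) = 0) ∧
      (∀ (k k' : (F →+* ℝ) → ℤ) (f g : Point F → ℂ), f ∈ modularForms (Bianchi.Gamma1 𝔫) k →
          g ∈ modularForms (Bianchi.Gamma1 𝔫) k' → enc (f * g) = enc f * enc g) ∧
      (∀ (k : (F →+* ℝ) → ℤ) (f g : Point F → ℂ), f ∈ modularForms (Bianchi.Gamma1 𝔫) k →
          g ∈ modularForms (Bianchi.Gamma1 𝔫) k → enc (f + g) = enc f + enc g) ∧
      (∀ (k : (F →+* ℝ) → ℤ) (c : ℂ) (f : Point F → ℂ), f ∈ modularForms (Bianchi.Gamma1 𝔫) k →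
          enc (c • f) = c • enc f) ∧
      ((halfSpace F).indicator (fun _ ↦ (1 : ℂ)) ∈ modularForms (Bianchi.Gamma1 𝔫) 0 ∧
          enc ((halfSpace F).indicator (fun _ ↦ (1 : ℂ))) = 1) ∧
      ∀ (k k' : (F →+* ℝ) → ℤ) (f g : Point F → ℂ), f ∈ modularForms (Bianchi.Gamma1 𝔫) k →
          g ∈ modularForms (Bianchi.Gamma1 𝔫) k' → enc f = enc g → f = g := by
  classical
  -- the encoding of a coefficient function
  let enc : (Point F → ℂ) → MvPowerSeries (Fin d) ℂ := fun f n ↦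
    if h : ∃ μ ∈ qIndexSet F, idx μ = n then fourierCoeff f h.choose else 0
  have enc_coeff : ∀ (f : Point F → ℂ) (n : Fin d →₀ ℕ), MvPowerSeries.coeff n (enc f) =
      if h : ∃ μ ∈ qIndexSet F, idx μ = n then fourierCoeff f h.choose else 0 := fun _ _ ↦ rfl
  have henc : ∀ f : Point F → ℂ, (∀ μ ∈ qIndexSet F, MvPowerSeries.coeff (idx μ) (enc f) = fourierCoeff f μ) ∧
      ∀ n, (∀ μ ∈ qIndexSet F, idx μ ≠ n) → MvPowerSeries.coeff n (enc f) = 0 := by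
    intro f
    refine ⟨fun μ hμ ↦ ?_, fun n hn ↦ ?_⟩
    · have hex : ∃ μ' ∈ qIndexSet F, idx μ' = idx μ := ⟨μ, hμ, rfl⟩
      rw [enc_coeff, dif_pos hex]
      congr 1
      exact hinj hex.choose_spec.1 hμ hex.choose_spec.2
    · have hex : ¬ ∃ μ' ∈ qIndexSet F, idx μ' = n := fun ⟨μ', hμ', h⟩ ↦ hn μ' hμ' h
      rw [enc_coeff, dif_neg hex]
  -- coefficientwise description of `enc` from linear data on the cone
  have enc_ext : ∀ (f : Point F → ℂ) (Q : MvPowerSeries (Fin d) ℂ),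
      (∀ μ ∈ qIndexSet F, MvPowerSeries.coeff (idx μ) Q = fourierCoeff f μ) →
      (∀ n, (∀ μ ∈ qIndexSet F, idx μ ≠ n) → MvPowerSeries.coeff n Q = 0) → enc f = Q := by
    intro f Q hQ hQ0
    ext n
    by_cases hn : ∃ μ ∈ qIndexSet F, idx μ = n
    · obtain ⟨μ, hμ, rfl⟩ := hn
      rw [(henc f).1 μ hμ, hQ μ hμ]
    · push Not at hn
      rw [(henc f).2 n hn, hQ0 n hn]
  have hol : ∀ {k : (F →+* ℝ) → ℤ} {f : Point F → ℂ}, f ∈ modularForms (Bianchi.Gamma1 𝔫) k → IsHolomorphicOn F f :=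
    fun hf ↦ hf.holomorphic
  have cont : ∀ {k : (F →+* ℝ) → ℤ} {f : Point F → ℂ}, f ∈ modularForms (Bianchi.Gamma1 𝔫) k → ContinuousOn f (halfSpace F) :=
    fun hf ↦ hf.holomorphic.continuousOn
  refine ⟨enc, henc, ?_, ?_, ?_, ?_, ?_⟩
  · -- multiplicativity
    intro k k' f g hf hg
    exact (hdict f g (hol hf) (hol hg) (hP5 F 𝔫 k f hf) (hP5 F 𝔫 k' g hg)
      (fun μ hμ hμc ↦ hP1 F hd 𝔫 h𝔫 k f hf μ hμ hμc) (fun μ hμ hμc ↦ hP1 F hd 𝔫 h𝔫 k' g hg μ hμ hμc)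
      (enc f) (enc g) (enc (f * g)) (henc f) (henc g) (henc (f * g)))
  · -- additivity
    intro k f g hf hg
    refine enc_ext (f + g) (enc f + enc g) (fun μ hμ ↦ ?_) (fun n hn ↦ ?_)
    · rw [map_add, (henc f).1 μ hμ, (henc g).1 μ hμ, fourierCoeff_eq, fourierCoeff_eq, fourierCoeff_eq]
      exact ((hP2 F f g (cont hf) (cont hg) 1 μ (fun _ ↦ 1) fun _ ↦ one_pos).1).symm
    · rw [map_add, (henc f).2 n hn, (henc g).2 n hn, add_zero]
  · -- homogeneity
    intro k c f hf
    refine enc_ext (c • f) (c • enc f) (fun μ hμ ↦ ?_) (fun n hn ↦ ?_)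
    · rw [map_smul, (henc f).1 μ hμ, smul_eq_mul, fourierCoeff_eq, fourierCoeff_eq]
      exact ((hP2 F f f (cont hf) (cont hf) c μ (fun _ ↦ 1) fun _ ↦ one_pos).2.1).symm
    · rw [map_smul, (henc f).2 n hn, smul_zero]
  · -- the unit form
    obtain ⟨hmem, h0, hne⟩ := hP4 F (Bianchi.Gamma1 𝔫)
    refine ⟨hmem, enc_ext _ 1 (fun μ hμ ↦ ?_) (fun n hn ↦ ?_)⟩
    · have hidx0 : idx 0 = 0 := by
        have h := hadd 0 zero_mem_qIndexSet 0 zero_mem_qIndexSet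
        rw [add_zero] at h
        exact left_eq_add.1 h
      rw [MvPowerSeries.coeff_one]
      by_cases hμ0 : μ = 0
      · subst hμ0
        rw [if_pos hidx0, h0]
      · have : idx μ ≠ 0 := fun h ↦ hμ0 (hinj hμ zero_mem_qIndexSet (h.trans hidx0.symm))
        rw [if_neg this, hne μ hμ.1 hμ0]
    · rw [MvPowerSeries.coeff_one, if_neg]
      intro h0n
      have hidx0 : idx 0 = 0 := by
        have h := hadd 0 zero_mem_qIndexSet 0 zero_mem_qIndexSet
        rw [add_zero] at h
        exact left_eq_add.1 h
      exact hn 0 zero_mem_qIndexSet (hidx0.trans h0n.symm)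
  · -- injectivity
    intro k k' f g hf hg hfg
    have hcoef : ∀ μ : F, (∀ a : 𝓞 F, ∃ n : ℤ, Algebra.trace ℚ F (μ * a) = n) → fourierCoeff f μ = fourierCoeff g μ := by
      intro μ hμ
      by_cases hμc : μ ∈ qIndexSet F
      · rw [← (henc f).1 μ hμc, ← (henc g).1 μ hμc, hfg]
      · rw [hP1 F hd 𝔫 h𝔫 k f hf μ hμ hμc, hP1 F hd 𝔫 h𝔫 k' g hg μ hμ hμc]
    have hℍ := hP3 F f g (hol hf) (hol hg) (hP5 F 𝔫 k f hf) (hP5 F 𝔫 k' g hg) hcoef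
    funext z
    by_cases hz : z ∈ halfSpace F
    · exact hℍ z hz
    · rw [hf.eq_zero z hz, hg.eq_zero z hz]

/-- **The `q`-expansion principle over `ℂ` from the stubs** (composition of P1–P5 with § O's dictionary; real proof). -/
theorem HilbertQExpansionRing_of (hP1 : stub_modularForm_coeff_support) (hP2 : stub_fourierCoeff_linear)
    (hP3 : stub_qExpansion_injective) (hP4 : stub_indicator_modularForm) (hP5 : stub_modularForm_periodic) :
    HilbertQExpansionRing := by
  intro F _ _ _ hd 𝔫 h𝔫
  obtain ⟨d, idx, hinj, hadd, hdict⟩ := Dictionary.QExpansionDictionary_proof F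
  obtain ⟨enc, h⟩ := qexpRing_of_dict hP1 hP2 hP3 hP4 hP5 F hd 𝔫 h𝔫 d idx hinj hadd hdict
  exact ⟨d, idx, enc, hinj, hadd, h⟩

/-- Feeding the composition the stubs themselves. -/
theorem HilbertQExpansionRing_proof : HilbertQExpansionRing :=
  HilbertQExpansionRing_of @Stubs.stub_modularForm_coeff_support @Stubs.stub_fourierCoeff_linear
    @Stubs.stub_qExpansion_injective @Stubs.stub_indicator_modularForm @Stubs.stub_modularForm_periodic

end Composition

end QPrinciple

/-!
# § Q — RESHAPE 13 (lead c5, cycle 6): the `p`-ADIC GRADED FAMILY of the engine instance — `V b` := the `ℚ̄_p`-span of the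
# `v`-images of the `E`-rational encoded `q`-expansions of `M_b(Γ₁(𝔫))` satisfies the five family axioms of the landed `d`-free
# engine `stub_abstractEngineMain` (`hV1`, `hV0`, `hVadd`, `hVsmul`, `hVmul`) — formal, from § P (`PadicFamily.EngineFamilyAxioms`)

This pins down, in Lean, the object the remaining named facts of the crux NOTES speak about: (i) the sup-norm Sturm principle is
to be proved for THIS `V` (via the landed S14–S16 from the lattice statement), (ii) the Siegel count for the `E`-structure
`{A : MvPowerSeries (Fin d) E | map τ A = enc f, f ∈ M_b}`.  Stubs: Q1 graded spans (generic algebra), Q2 the `E`-rational family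
is closed under graded products and contains `1` (from `hilbertQExpansionRing`'s multiplicativity and unit); composition = lead.
-/

namespace Stubs

/-- **stub Q1 — `stub_gradedSpan_axioms` (LANDED p131013, `…StubGradedSpanAxioms.lean`).** In a commutative algebra over a field, the spans of a graded family of subsets closed
under graded multiplication and containing `1` in degree `0` form a graded family of subspaces closed under graded multiplication
(`Submodule.span_mul_span`). [folklore] -/
theorem stub_gradedSpan_axioms (K : Type) [Field K] (ι : Type) [AddCommGroup ι] (A : Type) [CommRing A] [Algebra K A]
    (S : ι → Set A) (h1 : (1 : A) ∈ S 0) (hmul : ∀ b₁ b₂ : ι, ∀ x ∈ S b₁, ∀ y ∈ S b₂, x * y ∈ S (b₁ + b₂)) :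
    (1 : A) ∈ (Submodule.span K (S 0) : Set A) ∧ (∀ b, (0 : A) ∈ (Submodule.span K (S b) : Set A)) ∧
      (∀ b (φ ψ : A), φ ∈ (Submodule.span K (S b) : Set A) → ψ ∈ (Submodule.span K (S b) : Set A) →
        φ + ψ ∈ (Submodule.span K (S b) : Set A)) ∧
      (∀ b (c : K) (φ : A), φ ∈ (Submodule.span K (S b) : Set A) → c • φ ∈ (Submodule.span K (S b) : Set A)) ∧
      ∀ b₁ b₂ (φ ψ : A), φ ∈ (Submodule.span K (S b₁) : Set A) → ψ ∈ (Submodule.span K (S b₂) : Set A) →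
        φ * ψ ∈ (Submodule.span K (S (b₁ + b₂)) : Set A) :=
  Summit.Langlands.Langlands.Theorems.HilbertIntegralOverconvergentIsCongruence.stub_gradedSpan_axioms K ι A S h1 hmul

/-- **stub Q2 — `stub_rationalFamily_axioms` (LANDED p131057, `…StubRationalFamilyAxioms.lean`).** For an encoding `enc` of `q`-expansions which is multiplicative on Hilbert modular forms of level `Γ₁(𝔫)` and sends the unit form `1_ℍ` to `1` (the landed … (abridged; see the landed file). [folklore] -/
theorem stub_rationalFamily_axioms (F : Type) [Field F] [NumberField F] (𝔫 : Ideal (𝓞 F)) (d : ℕ)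
    (enc : (Point F → ℂ) → MvPowerSeries (Fin d) ℂ)
    (hmul : ∀ (k k' : (F →+* ℝ) → ℤ) (f g : Point F → ℂ), f ∈ modularForms (Bianchi.Gamma1 𝔫) k →
      g ∈ modularForms (Bianchi.Gamma1 𝔫) k' → enc (f * g) = enc f * enc g)
    (hone : (halfSpace F).indicator (fun _ ↦ (1 : ℂ)) ∈ modularForms (Bianchi.Gamma1 𝔫) 0 ∧
      enc ((halfSpace F).indicator (fun _ ↦ (1 : ℂ))) = 1)
    (E : Type) [Field E] [NumberField E] (τ : E →+* ℂ) (p : ℕ) [Fact p.Prime] (v : E →+* PadicAlgCl p) :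
    (∃ (A : MvPowerSeries (Fin d) E) (f : Point F → ℂ), f ∈ modularForms (Bianchi.Gamma1 𝔫) 0 ∧
        MvPowerSeries.map τ A = enc f ∧ (1 : MvPowerSeries (Fin d) (PadicAlgCl p)) = MvPowerSeries.map v A) ∧
      ∀ (b₁ b₂ : (F →+* ℝ) → ℤ) (x y : MvPowerSeries (Fin d) (PadicAlgCl p)),
        (∃ (A : MvPowerSeries (Fin d) E) (f : Point F → ℂ), f ∈ modularForms (Bianchi.Gamma1 𝔫) b₁ ∧
          MvPowerSeries.map τ A = enc f ∧ x = MvPowerSeries.map v A) →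
        (∃ (A : MvPowerSeries (Fin d) E) (f : Point F → ℂ), f ∈ modularForms (Bianchi.Gamma1 𝔫) b₂ ∧
          MvPowerSeries.map τ A = enc f ∧ y = MvPowerSeries.map v A) →
        ∃ (A : MvPowerSeries (Fin d) E) (f : Point F → ℂ), f ∈ modularForms (Bianchi.Gamma1 𝔫) (b₁ + b₂) ∧
          MvPowerSeries.map τ A = enc f ∧ x * y = MvPowerSeries.map v A :=
  Summit.Langlands.Langlands.Theorems.HilbertIntegralOverconvergentIsCongruence.stub_rationalFamily_axioms F 𝔫 d enc hmul hone E τ p v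

end Stubs

namespace PadicFamily

/-- Statement of stub Q1, by name. -/
def stub_gradedSpan_axioms : Prop := type_of% @Stubs.stub_gradedSpan_axioms
/-- Statement of stub Q2, by name. -/
def stub_rationalFamily_axioms : Prop := type_of% @Stubs.stub_rationalFamily_axioms

/-- **The `p`-adic graded family of the engine instance satisfies the engine's family axioms** (target of RESHAPE 13): for `F`
totally real, `[F:ℚ] ≥ 2`, `𝔫 ≠ 0`, a number field `E` with `τ : E → ℂ` and `v : E → ℚ̄_p`, the family
`V b := span_{ℚ̄_p} {map v A | A ∈ MvPowerSeries (Fin d) E, map τ A = enc f, f ∈ M_b(Γ₁(𝔫))}` — `enc` the injective graded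
`q`-expansion map of § P — satisfies `hV1`, `hV0`, `hVadd`, `hVsmul`, `hVmul` of `stub_abstractEngineMain`. -/
def EngineFamilyAxioms : Prop :=
  ∀ (F : Type) [Field F] [NumberField F] [NumberField.IsTotallyReal F], 1 < Module.finrank ℚ F →
  ∀ (𝔫 : Ideal (𝓞 F)), 𝔫 ≠ ⊥ → ∀ (E : Type) [Field E] [NumberField E] (τ : E →+* ℂ) (p : ℕ) [Fact p.Prime]
    (v : E →+* PadicAlgCl p),
  ∃ (d : ℕ) (idx : F → (Fin d →₀ ℕ)) (enc : (Point F → ℂ) → MvPowerSeries (Fin d) ℂ)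
    (V : ((F →+* ℝ) → ℤ) → Set (MvPowerSeries (Fin d) (PadicAlgCl p))),
    Set.InjOn idx (qIndexSet F) ∧ (∀ μ ∈ qIndexSet F, ∀ μ' ∈ qIndexSet F, idx (μ + μ') = idx μ + idx μ') ∧
    (∀ f : Point F → ℂ, (∀ μ ∈ qIndexSet F, MvPowerSeries.coeff (idx μ) (enc f) = fourierCoeff f μ) ∧
        ∀ n, (∀ μ ∈ qIndexSet F, idx μ ≠ n) → MvPowerSeries.coeff n (enc f) = 0) ∧
    (∀ (k k' : (F →+* ℝ) → ℤ) (f g : Point F → ℂ), f ∈ modularForms (Bianchi.Gamma1 𝔫) k →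
        g ∈ modularForms (Bianchi.Gamma1 𝔫) k' → enc f = enc g → f = g) ∧
    (∀ (k k' : (F →+* ℝ) → ℤ) (f g : Point F → ℂ), f ∈ modularForms (Bianchi.Gamma1 𝔫) k →
        g ∈ modularForms (Bianchi.Gamma1 𝔫) k' → enc (f * g) = enc f * enc g) ∧
    (∀ (k : (F →+* ℝ) → ℤ) (f g : Point F → ℂ), f ∈ modularForms (Bianchi.Gamma1 𝔫) k →
        g ∈ modularForms (Bianchi.Gamma1 𝔫) k → enc (f + g) = enc f + enc g) ∧
    (∀ (k : (F →+* ℝ) → ℤ) (c : ℂ) (f : Point F → ℂ), f ∈ modularForms (Bianchi.Gamma1 𝔫) k →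
        enc (c • f) = c • enc f) ∧
    ((halfSpace F).indicator (fun _ ↦ (1 : ℂ)) ∈ modularForms (Bianchi.Gamma1 𝔫) 0 ∧
        enc ((halfSpace F).indicator (fun _ ↦ (1 : ℂ))) = 1) ∧
    (∀ b φ, φ ∈ V b ↔ φ ∈ (Submodule.span (PadicAlgCl p)
        {ψ | ∃ (A : MvPowerSeries (Fin d) E) (f : Point F → ℂ), f ∈ modularForms (Bianchi.Gamma1 𝔫) b ∧
          MvPowerSeries.map τ A = enc f ∧ ψ = MvPowerSeries.map v A} : Set (MvPowerSeries (Fin d) (PadicAlgCl p)))) ∧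
    (1 : MvPowerSeries (Fin d) (PadicAlgCl p)) ∈ V 0 ∧ (∀ b, (0 : MvPowerSeries (Fin d) (PadicAlgCl p)) ∈ V b) ∧
    (∀ b φ ψ, φ ∈ V b → ψ ∈ V b → φ + ψ ∈ V b) ∧ (∀ b (c : PadicAlgCl p) φ, φ ∈ V b → c • φ ∈ V b) ∧
    ∀ b₁ b₂ φ ψ, φ ∈ V b₁ → ψ ∈ V b₂ → φ * ψ ∈ V (b₁ + b₂)

section Composition

/-- **The family axioms from the stubs** (composition of Q1, Q2 with § P's `HilbertQExpansionRing`; real proof). -/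
theorem EngineFamilyAxioms_of (hQ1 : stub_gradedSpan_axioms) (hQ2 : stub_rationalFamily_axioms) : EngineFamilyAxioms := by
  intro F _ _ _ hd 𝔫 h𝔫 E _ _ τ p _ v
  obtain ⟨d, idx, enc, hinj, hadd, henc, hmul, haddenc, hsmul, hone, hinjenc⟩ := QPrinciple.HilbertQExpansionRing_proof F hd 𝔫 h𝔫
  set S : ((F →+* ℝ) → ℤ) → Set (MvPowerSeries (Fin d) (PadicAlgCl p)) := fun b ↦
    {ψ | ∃ (A : MvPowerSeries (Fin d) E) (f : Point F → ℂ), f ∈ modularForms (Bianchi.Gamma1 𝔫) b ∧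
      MvPowerSeries.map τ A = enc f ∧ ψ = MvPowerSeries.map v A} with hSdef
  obtain ⟨h1S, hmulS⟩ := hQ2 F 𝔫 d enc hmul hone E τ p v
  have h1 : (1 : MvPowerSeries (Fin d) (PadicAlgCl p)) ∈ S 0 := by
    obtain ⟨A, f, hf, hA, h1⟩ := h1S
    exact ⟨A, f, hf, hA, h1⟩
  have hmul' : ∀ b₁ b₂, ∀ x ∈ S b₁, ∀ y ∈ S b₂, x * y ∈ S (b₁ + b₂) := fun b₁ b₂ x hx y hy ↦ hmulS b₁ b₂ x y hx hy
  obtain ⟨hV1, hV0, hVadd, hVsmul, hVmul⟩ :=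
    hQ1 (PadicAlgCl p) ((F →+* ℝ) → ℤ) (MvPowerSeries (Fin d) (PadicAlgCl p)) S h1 hmul'
  refine ⟨d, idx, enc, fun b ↦ (Submodule.span (PadicAlgCl p) (S b) : Set (MvPowerSeries (Fin d) (PadicAlgCl p))),
    hinj, hadd, henc, hinjenc, hmul, haddenc, hsmul, hone, fun b φ ↦ Iff.rfl, hV1, hV0, hVadd, hVsmul, hVmul⟩

/-- Feeding the composition the stubs themselves. -/
theorem EngineFamilyAxioms_proof : EngineFamilyAxioms :=
  EngineFamilyAxioms_of @Stubs.stub_gradedSpan_axioms @Stubs.stub_rationalFamily_axioms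

end Composition

end PadicFamily

/-!
# § R — RESHAPE 14 (lead c5, cycle 7): the ENGINE-INSTANCE DATA — the trace formula of the encoding (Sturm window = total
# degree window) and the archimedean hypothesis `harch` of the engine from convergence on the whole tube

Two gaps between § Q and a typed crux proof are closed here: (1) the encoding must expose `wt ∘ idx = Tr(α ·)` for a totally
positive `α ∈ 𝓞 F` (R1), so that named fact (i) (Sturm mod 𝔭 on the trace window `{Tr(αν) < L}`) IS the engine's `hSturm` on
`{wt < L}` with `wt :=` total degree; (2) the crux's hypothesis "converges on the whole tube under every complex embedding" yields the
engine's `harch` for the encoded series of `g` (R3: radius-type bounds; R2: polynomial level sets of the total degree; the landed S17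
`stub_summable_of_levelGrowth`): `EngineInstance.EngineInstanceData`.
-/

namespace Stubs

/-- **stub R1 — `stub_qIndex_encoding_trace` (LANDED p131448, `…StubQIndexEncodingTrace.lean`).** The trace-basis encoding of § O with its TRACE FORMULA exposed: for a `ℚ`-basis `β` of totally positive algebraic integers (landed S13a), `idx ν := (Tr(β_j ν))_j` is injective and … (abridged; see the landed file). [folklore] -/
theorem stub_qIndex_encoding_trace (F : Type) [Field F] [NumberField F] [NumberField.IsTotallyReal F] :
    ∃ (d : ℕ) (idx : F → (Fin d →₀ ℕ)) (α : 𝓞 F), (∀ σ : F →+* ℝ, 0 < σ (α : F)) ∧ Set.InjOn idx (qIndexSet F) ∧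
      (∀ μ ∈ qIndexSet F, ∀ μ' ∈ qIndexSet F, idx (μ + μ') = idx μ + idx μ') ∧
      ∀ ν ∈ qIndexSet F, ((∑ j, idx ν j : ℕ) : ℚ) = Algebra.trace ℚ F ((α : F) * ν) :=
  Summit.Langlands.Langlands.Theorems.HilbertIntegralOverconvergentIsCongruence.stub_qIndex_encoding_trace F

/-- **stub R2 — `stub_totalDegree_levelCount` (LANDED p131467, `…StubTotalDegreeLevelCount.lean`).** The level sets of the total degree on `ℕ^d` are finite of polynomial size:
`#{n : |n| = m} ≤ (m+1)^d` (every coordinate is at most `m`). [folklore] -/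
theorem stub_totalDegree_levelCount (d m : ℕ) :
    {n : Fin d →₀ ℕ | ∑ j, n j = m}.Finite ∧ (({n : Fin d →₀ ℕ | ∑ j, n j = m}.ncard : ℕ) : ℝ) ≤ ((m : ℝ) + 1) ^ d :=
  Summit.Langlands.Langlands.Theorems.HilbertIntegralOverconvergentIsCongruence.stub_totalDegree_levelCount d m

/-- **stub R3 — `stub_coeff_radius_from_tube` (LANDED pending, `…StubCoeffRadiusFromTube.lean` (lead)).** From convergence on the whole tube to radius-type bounds: if `∑_{ν ∈ 𝔡⁻¹} |c_ν| e^{-2π⟨ν,y⟩} < ∞` at every height `y ≫ 0`, then for every `0 < s < 1` the quantities `|c_ν| … (abridged; see the landed file). [folklore] -/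
theorem stub_coeff_radius_from_tube (F : Type) [Field F] [NumberField F] [NumberField.IsTotallyReal F] (α : F)
    (hα : ∀ σ : F →+* ℝ, 0 < σ α) (c : F → ℂ)
    (habs : ∀ y : (F →+* ℝ) → ℝ, (∀ σ, 0 < y σ) →
      Summable (fun ν : {ν : F | ∀ b : 𝓞 F, ∃ n : ℤ, Algebra.trace ℚ F (ν * b) = n} ↦
        ‖c ν‖ * Real.exp (-(2 * Real.pi * ∑ σ : F →+* ℝ, σ (ν : F) * y σ))))
    (w : F → ℕ) (hw : ∀ ν ∈ qIndexSet F, (w ν : ℝ) = ((Algebra.trace ℚ F (α * ν) : ℚ) : ℝ))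
    (s : ℝ) (hs0 : 0 < s) (hs1 : s < 1) :
    ∃ C : ℝ, ∀ ν ∈ qIndexSet F, ‖c ν‖ * s ^ w ν ≤ C :=
  Summit.Langlands.Langlands.Theorems.HilbertIntegralOverconvergentIsCongruence.stub_coeff_radius_from_tube F α hα c habs w hw s hs0 hs1

end Stubs

namespace EngineInstance

/-- Statement of stub R1, by name. -/
def stub_qIndex_encoding_trace : Prop := type_of% @Stubs.stub_qIndex_encoding_trace
/-- Statement of stub R2, by name. -/
def stub_totalDegree_levelCount : Prop := type_of% @Stubs.stub_totalDegree_levelCount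
/-- Statement of stub R3, by name. -/
def stub_coeff_radius_from_tube : Prop := type_of% @Stubs.stub_coeff_radius_from_tube

/-- **The graded family with the TRACE FORMULA**: § Q's `EngineFamilyAxioms` for an encoding whose total degree is `Tr(α ·)` on
the cone, `α` a totally positive algebraic integer. -/
def TraceEngineFamily : Prop :=
  ∀ (F : Type) [Field F] [NumberField F] [NumberField.IsTotallyReal F], 1 < Module.finrank ℚ F →
  ∀ (𝔫 : Ideal (𝓞 F)), 𝔫 ≠ ⊥ → ∀ (E : Type) [Field E] [NumberField E] (τ : E →+* ℂ) (p : ℕ) [Fact p.Prime]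
    (v : E →+* PadicAlgCl p),
  ∃ (d : ℕ) (idx : F → (Fin d →₀ ℕ)) (α : 𝓞 F) (enc : (Point F → ℂ) → MvPowerSeries (Fin d) ℂ)
    (V : ((F →+* ℝ) → ℤ) → Set (MvPowerSeries (Fin d) (PadicAlgCl p))),
    (∀ σ : F →+* ℝ, 0 < σ (α : F)) ∧ Set.InjOn idx (qIndexSet F) ∧
    (∀ μ ∈ qIndexSet F, ∀ μ' ∈ qIndexSet F, idx (μ + μ') = idx μ + idx μ') ∧
    (∀ ν ∈ qIndexSet F, ((∑ j, idx ν j : ℕ) : ℚ) = Algebra.trace ℚ F ((α : F) * ν)) ∧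
    (∀ f : Point F → ℂ, (∀ μ ∈ qIndexSet F, MvPowerSeries.coeff (idx μ) (enc f) = fourierCoeff f μ) ∧
        ∀ n, (∀ μ ∈ qIndexSet F, idx μ ≠ n) → MvPowerSeries.coeff n (enc f) = 0) ∧
    (∀ (k k' : (F →+* ℝ) → ℤ) (f g : Point F → ℂ), f ∈ modularForms (Bianchi.Gamma1 𝔫) k →
        g ∈ modularForms (Bianchi.Gamma1 𝔫) k' → enc f = enc g → f = g) ∧
    (∀ (k k' : (F →+* ℝ) → ℤ) (f g : Point F → ℂ), f ∈ modularForms (Bianchi.Gamma1 𝔫) k →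
        g ∈ modularForms (Bianchi.Gamma1 𝔫) k' → enc (f * g) = enc f * enc g) ∧
    (∀ (k : (F →+* ℝ) → ℤ) (f g : Point F → ℂ), f ∈ modularForms (Bianchi.Gamma1 𝔫) k →
        g ∈ modularForms (Bianchi.Gamma1 𝔫) k → enc (f + g) = enc f + enc g) ∧
    (∀ (k : (F →+* ℝ) → ℤ) (c : ℂ) (f : Point F → ℂ), f ∈ modularForms (Bianchi.Gamma1 𝔫) k →
        enc (c • f) = c • enc f) ∧
    ((halfSpace F).indicator (fun _ ↦ (1 : ℂ)) ∈ modularForms (Bianchi.Gamma1 𝔫) 0 ∧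
        enc ((halfSpace F).indicator (fun _ ↦ (1 : ℂ))) = 1) ∧
    (∀ b φ, φ ∈ V b ↔ φ ∈ (Submodule.span (PadicAlgCl p)
        {ψ | ∃ (A : MvPowerSeries (Fin d) E) (f : Point F → ℂ), f ∈ modularForms (Bianchi.Gamma1 𝔫) b ∧
          MvPowerSeries.map τ A = enc f ∧ ψ = MvPowerSeries.map v A} : Set (MvPowerSeries (Fin d) (PadicAlgCl p)))) ∧
    (1 : MvPowerSeries (Fin d) (PadicAlgCl p)) ∈ V 0 ∧ (∀ b, (0 : MvPowerSeries (Fin d) (PadicAlgCl p)) ∈ V b) ∧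
    (∀ b φ ψ, φ ∈ V b → ψ ∈ V b → φ + ψ ∈ V b) ∧ (∀ b (c : PadicAlgCl p) φ, φ ∈ V b → c • φ ∈ V b) ∧
    ∀ b₁ b₂ φ ψ, φ ∈ V b₁ → ψ ∈ V b₂ → φ * ψ ∈ V (b₁ + b₂)

/-- **`harch` for the unknown from convergence on the whole tube**: for `c : F → E` whose `q`-series converges absolutely on `ℍ`
under every complex embedding and `G` encoding `c` along an encoding with the trace formula, the weighted `ℓ¹` sizes
`∑_n |τ(G_n)| e^{-η |n|}` are finite and bounded uniformly in `τ`, for every `η > 0`. -/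
def ArchFromTube : Prop :=
  ∀ (F : Type) [Field F] [NumberField F] [NumberField.IsTotallyReal F] (d : ℕ) (idx : F → (Fin d →₀ ℕ)) (α : F),
    (∀ σ : F →+* ℝ, 0 < σ α) → Set.InjOn idx (qIndexSet F) →
    (∀ ν ∈ qIndexSet F, ((∑ j, idx ν j : ℕ) : ℚ) = Algebra.trace ℚ F (α * ν)) →
  ∀ (E : Type) [Field E] [NumberField E] (c : F → E),
    (∀ (τ : E →+* ℂ) (y : (F →+* ℝ) → ℝ), (∀ σ, 0 < y σ) →
      Summable (fun ν : {ν : F | ∀ b : 𝓞 F, ∃ n : ℤ, Algebra.trace ℚ F (ν * b) = n} ↦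
        ‖τ (c ν)‖ * Real.exp (-(2 * Real.pi * ∑ σ : F →+* ℝ, σ (ν : F) * y σ)))) →
  ∀ (G : MvPowerSeries (Fin d) E), (∀ ν ∈ qIndexSet F, MvPowerSeries.coeff (idx ν) G = c ν) →
    (∀ n, (∀ ν ∈ qIndexSet F, idx ν ≠ n) → MvPowerSeries.coeff n G = 0) →
  ∀ η : ℝ, 0 < η → ∃ B : ℝ, 1 ≤ B ∧ ∀ τ : E →+* ℂ,
    Summable (fun n : Fin d →₀ ℕ ↦ ‖τ (MvPowerSeries.coeff n G)‖ * Real.exp (-η) ^ (∑ j, n j)) ∧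
    ∑' n : Fin d →₀ ℕ, ‖τ (MvPowerSeries.coeff n G)‖ * Real.exp (-η) ^ (∑ j, n j) ≤ B

/-- The data the typed crux feeds the engine (RESHAPE 14 target). -/
def EngineInstanceData : Prop := TraceEngineFamily ∧ ArchFromTube

section Composition

/-- **The graded family with the trace formula, from R1 and the landed §§ O–Q pieces** (real proof). -/
theorem TraceEngineFamily_of (hR1 : stub_qIndex_encoding_trace) : TraceEngineFamily := by
  intro F _ _ _ hd 𝔫 h𝔫 E _ _ τ p _ v
  obtain ⟨d, idx, α, hα, hinj, hadd, htrace⟩ := hR1 F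
  have hdict := Dictionary.dict_of_idx @Stubs.stub_finite_qIndex_antidiagonal @Stubs.stub_fourierCoeff_mul
    @Stubs.stub_encoded_mul F d idx hinj hadd
  obtain ⟨enc, henc, hmul, haddenc, hsmul, hone, hinjenc⟩ :=
    QPrinciple.qexpRing_of_dict @Stubs.stub_modularForm_coeff_support @Stubs.stub_fourierCoeff_linear
      @Stubs.stub_qExpansion_injective @Stubs.stub_indicator_modularForm @Stubs.stub_modularForm_periodic F hd 𝔫 h𝔫 d idx
      hinj hadd hdict
  set S : ((F →+* ℝ) → ℤ) → Set (MvPowerSeries (Fin d) (PadicAlgCl p)) := fun b ↦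
    {ψ | ∃ (A : MvPowerSeries (Fin d) E) (f : Point F → ℂ), f ∈ modularForms (Bianchi.Gamma1 𝔫) b ∧
      MvPowerSeries.map τ A = enc f ∧ ψ = MvPowerSeries.map v A} with hSdef
  obtain ⟨h1S, hmulS⟩ := Stubs.stub_rationalFamily_axioms F 𝔫 d enc hmul hone E τ p v
  have h1 : (1 : MvPowerSeries (Fin d) (PadicAlgCl p)) ∈ S 0 := by
    obtain ⟨A, f, hf, hA, h1⟩ := h1S
    exact ⟨A, f, hf, hA, h1⟩
  have hmul' : ∀ b₁ b₂, ∀ x ∈ S b₁, ∀ y ∈ S b₂, x * y ∈ S (b₁ + b₂) := fun b₁ b₂ x hx y hy ↦ hmulS b₁ b₂ x y hx hy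
  obtain ⟨hV1, hV0, hVadd, hVsmul, hVmul⟩ :=
    Stubs.stub_gradedSpan_axioms (PadicAlgCl p) ((F →+* ℝ) → ℤ) (MvPowerSeries (Fin d) (PadicAlgCl p)) S h1 hmul'
  exact ⟨d, idx, α, enc, fun b ↦ (Submodule.span (PadicAlgCl p) (S b) : Set (MvPowerSeries (Fin d) (PadicAlgCl p))),
    hα, hinj, hadd, htrace, henc, hinjenc, hmul, haddenc, hsmul, hone, fun b φ ↦ Iff.rfl, hV1, hV0, hVadd, hVsmul, hVmul⟩

/-- **`harch` for the unknown, from R2, R3 and the landed S17** (real proof). -/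
theorem ArchFromTube_of (hR2 : stub_totalDegree_levelCount) (hR3 : stub_coeff_radius_from_tube) : ArchFromTube := by
  intro F _ _ _ d idx α hα hinj htrace E _ _ c habs G hG hG0 η hη
  classical
  -- weight and level sets
  set wt : (Fin d →₀ ℕ) → ℕ := fun n ↦ ∑ j, n j with hwtdef
  have hlevel : ∀ m : ℕ, {n : Fin d →₀ ℕ | wt n = m}.Finite ∧
      (({n : Fin d →₀ ℕ | wt n = m}.ncard : ℕ) : ℝ) ≤ 1 * ((m : ℝ) + 1) ^ d := fun m ↦ by
    simpa [hwtdef] using hR2 d m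
  -- the weight of an encoded cone index
  set w : F → ℕ := fun ν ↦ ∑ j, idx ν j with hwdef
  have hw : ∀ ν ∈ qIndexSet F, (w ν : ℝ) = ((Algebra.trace ℚ F (α * ν) : ℚ) : ℝ) := fun ν hν ↦ by
    rw [← htrace ν hν]; push_cast [hwdef]; rfl
  -- radius-type bounds for every embedding
  have hbound : ∀ τ : E →+* ℂ, ∀ s : ℝ, 0 < s → s < 1 → ∃ C : ℝ, ∀ n : Fin d →₀ ℕ,
      ‖τ (MvPowerSeries.coeff n G)‖ * s ^ wt n ≤ C := by
    intro τ s hs0 hs1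
    obtain ⟨C, hC⟩ := hR3 F α hα (fun ν ↦ τ (c ν)) (habs τ) w hw s hs0 hs1
    refine ⟨max C 0, fun n ↦ ?_⟩
    by_cases hn : ∃ ν ∈ qIndexSet F, idx ν = n
    · obtain ⟨ν, hν, rfl⟩ := hn
      rw [hG ν hν]
      exact (hC ν hν).trans (le_max_left _ _)
    · push Not at hn
      rw [hG0 n hn, map_zero, norm_zero, zero_mul]
      exact le_max_right _ _
  -- summability for every embedding (S17)
  have hsum : ∀ τ : E →+* ℂ, Summable (fun n : Fin d →₀ ℕ ↦ ‖τ (MvPowerSeries.coeff n G)‖ * Real.exp (-η) ^ wt n) :=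
    fun τ ↦ Stubs.stub_summable_of_levelGrowth wt d 1 hlevel (fun n ↦ τ (MvPowerSeries.coeff n G)) (hbound τ)
      (Real.exp (-η)) (Real.exp_nonneg _) (Real.exp_lt_one_iff.2 (by linarith))
  -- a uniform bound over the finitely many embeddings
  refine ⟨1 + ∑ τ : E →+* ℂ, ∑' n : Fin d →₀ ℕ, ‖τ (MvPowerSeries.coeff n G)‖ * Real.exp (-η) ^ wt n, ?_, fun τ ↦ ⟨hsum τ, ?_⟩⟩
  · have : 0 ≤ ∑ τ : E →+* ℂ, ∑' n : Fin d →₀ ℕ, ‖τ (MvPowerSeries.coeff n G)‖ * Real.exp (-η) ^ wt n :=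
      Finset.sum_nonneg fun τ _ ↦ tsum_nonneg fun n ↦ mul_nonneg (norm_nonneg _) (pow_nonneg (Real.exp_nonneg _) _)
    linarith
  · have hle : ∑' n : Fin d →₀ ℕ, ‖τ (MvPowerSeries.coeff n G)‖ * Real.exp (-η) ^ wt n ≤
        ∑ τ' : E →+* ℂ, ∑' n : Fin d →₀ ℕ, ‖τ' (MvPowerSeries.coeff n G)‖ * Real.exp (-η) ^ wt n :=
      Finset.single_le_sum (f := fun τ' : E →+* ℂ ↦ ∑' n : Fin d →₀ ℕ, ‖τ' (MvPowerSeries.coeff n G)‖ * Real.exp (-η) ^ wt n)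
        (fun τ' _ ↦ tsum_nonneg fun n ↦ mul_nonneg (norm_nonneg _) (pow_nonneg (Real.exp_nonneg _) _)) (Finset.mem_univ τ)
    linarith

/-- **RESHAPE 14 from the stubs.** -/
theorem EngineInstanceData_of (hR1 : stub_qIndex_encoding_trace) (hR2 : stub_totalDegree_levelCount)
    (hR3 : stub_coeff_radius_from_tube) : EngineInstanceData :=
  ⟨TraceEngineFamily_of hR1, ArchFromTube_of hR2 hR3⟩

/-- Feeding the composition the stubs themselves. -/
theorem EngineInstanceData_proof : EngineInstanceData :=
  EngineInstanceData_of @Stubs.stub_qIndex_encoding_trace @Stubs.stub_totalDegree_levelCount @Stubs.stub_coeff_radius_from_tube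

end Composition

end EngineInstance

/-!
# § S — RESHAPE 15 (lead c5, cycle 8): RELATION ⇒ FUNCTIONS — the encoded `q`-expansion is a ring-hom-like map on the CONE CLASS
# (holomorphic, `𝓞 F`-periodic, cone-supported coefficients), so a formal relation between encodings is a relation between functions

For any admissible encoding `(idx, enc)` (injective/additive on the cone; `enc f` encodes `fourierCoeff f` for every `f` — the data
exposed by `traceEngineFamily`), and functions `φ_u`, `γ` of the cone class: `∑_u P_u • (enc φ_u * (enc γ)^{j_u}) = 0` in
`MvPowerSeries (Fin d) ℂ` ⇒ `∑_u P_u φ_u γ^{j_u} = 0` on `ℍ`.  This is the step that turns the engine's output (a formal relation among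
encoded `q`-expansions) into the hypothesis of `algebraicIsModular` / `qSeries_mem_modularForms_of_algebraic`.  Stubs: S1 the class is
closed under products, S2 under linear combinations, S3 contains `1` (workers); composition (lead): `enc` respects `*`, `+`, scalars,
powers and `1` on the class by uniqueness of encodings, and is injective there (`stub_qExpansion_injective`).
-/

namespace Stubs

/-- **stub S1 — `stub_coneClass_mul` (LANDED p132060, `…StubConeClassMul.lean`).** The class of holomorphic `𝓞 F`-periodic functions on `ℍ` with CONE-SUPPORTED Fourier coefficients (`a_μ = 0` for `μ ∈ 𝔡⁻¹ ∖ qIndexSet`) is closed under products (the cone is … (abridged; see the landed file). [folklore] -/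
theorem stub_coneClass_mul (F : Type) [Field F] [NumberField F] [NumberField.IsTotallyReal F] (f g : Point F → ℂ)
    (hf : IsHolomorphicOn F f) (hg : IsHolomorphicOn F g)
    (hperf : ∀ (a : 𝓞 F) (z : Point F), z ∈ halfSpace F → f (fun σ ↦ z σ + ((σ (a : F) : ℝ) : ℂ)) = f z)
    (hperg : ∀ (a : 𝓞 F) (z : Point F), z ∈ halfSpace F → g (fun σ ↦ z σ + ((σ (a : F) : ℝ) : ℂ)) = g z)
    (hsf : ∀ μ : F, (∀ a : 𝓞 F, ∃ n : ℤ, Algebra.trace ℚ F (μ * a) = n) → μ ∉ qIndexSet F → fourierCoeff f μ = 0)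
    (hsg : ∀ μ : F, (∀ a : 𝓞 F, ∃ n : ℤ, Algebra.trace ℚ F (μ * a) = n) → μ ∉ qIndexSet F → fourierCoeff g μ = 0) :
    IsHolomorphicOn F (f * g) ∧
      (∀ (a : 𝓞 F) (z : Point F), z ∈ halfSpace F → (f * g) (fun σ ↦ z σ + ((σ (a : F) : ℝ) : ℂ)) = (f * g) z) ∧
      ∀ μ : F, (∀ a : 𝓞 F, ∃ n : ℤ, Algebra.trace ℚ F (μ * a) = n) → μ ∉ qIndexSet F → fourierCoeff (f * g) μ = 0 :=
  Summit.Langlands.Langlands.Theorems.HilbertIntegralOverconvergentIsCongruence.stub_coneClass_mul F f g hf hg hperf hperg hsf hsg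

/-- **stub S2 — `stub_coneClass_linear` (LANDED p132095, `…StubConeClassLinear.lean`).** The same class is a `ℂ`-submodule: closed under `+` and scalars and containing `0`
(linearity of the Fourier coefficients, landed `stub_fourierCoeff_linear`). [folklore] -/
theorem stub_coneClass_linear (F : Type) [Field F] [NumberField F] (f g : Point F → ℂ) (c : ℂ)
    (hf : IsHolomorphicOn F f) (hg : IsHolomorphicOn F g)
    (hperf : ∀ (a : 𝓞 F) (z : Point F), z ∈ halfSpace F → f (fun σ ↦ z σ + ((σ (a : F) : ℝ) : ℂ)) = f z)
    (hperg : ∀ (a : 𝓞 F) (z : Point F), z ∈ halfSpace F → g (fun σ ↦ z σ + ((σ (a : F) : ℝ) : ℂ)) = g z)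
    (hsf : ∀ μ : F, (∀ a : 𝓞 F, ∃ n : ℤ, Algebra.trace ℚ F (μ * a) = n) → μ ∉ qIndexSet F → fourierCoeff f μ = 0)
    (hsg : ∀ μ : F, (∀ a : 𝓞 F, ∃ n : ℤ, Algebra.trace ℚ F (μ * a) = n) → μ ∉ qIndexSet F → fourierCoeff g μ = 0) :
    (IsHolomorphicOn F (f + c • g) ∧
      (∀ (a : 𝓞 F) (z : Point F), z ∈ halfSpace F → (f + c • g) (fun σ ↦ z σ + ((σ (a : F) : ℝ) : ℂ)) = (f + c • g) z) ∧
      ∀ μ : F, (∀ a : 𝓞 F, ∃ n : ℤ, Algebra.trace ℚ F (μ * a) = n) → μ ∉ qIndexSet F → fourierCoeff (f + c • g) μ = 0) ∧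
    (∀ μ : F, (∀ a : 𝓞 F, ∃ n : ℤ, Algebra.trace ℚ F (μ * a) = n) →
      fourierCoeff (f + c • g) μ = fourierCoeff f μ + c * fourierCoeff g μ) ∧
    ∀ μ : F, fourierCoeff (0 : Point F → ℂ) μ = 0 :=
  Summit.Langlands.Langlands.Theorems.HilbertIntegralOverconvergentIsCongruence.stub_coneClass_linear F f g c hf hg hperf hperg hsf hsg

/-- **stub S3 — `stub_coneClass_one` (LANDED p132100, `…StubConeClassOne.lean`).** The constant function `1` belongs to the class (holomorphic, periodic) and its Fourier
coefficients on the dual lattice are `[μ = 0]` (it agrees on `ℍ` with the unit form `1_ℍ` of the landed `stub_indicator_modularForm`,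
and Fourier coefficients only see values on `ℍ`). [folklore] -/
theorem stub_coneClass_one (F : Type) [Field F] [NumberField F] [NumberField.IsTotallyReal F] :
    IsHolomorphicOn F (1 : Point F → ℂ) ∧
      (∀ (a : 𝓞 F) (z : Point F), z ∈ halfSpace F → (1 : Point F → ℂ) (fun σ ↦ z σ + ((σ (a : F) : ℝ) : ℂ)) = (1 : Point F → ℂ) z) ∧
      fourierCoeff (1 : Point F → ℂ) 0 = 1 ∧
      ∀ μ : F, (∀ a : 𝓞 F, ∃ n : ℤ, Algebra.trace ℚ F (μ * a) = n) → μ ≠ 0 → fourierCoeff (1 : Point F → ℂ) μ = 0 :=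
  Summit.Langlands.Langlands.Theorems.HilbertIntegralOverconvergentIsCongruence.stub_coneClass_one F

end Stubs

namespace Relation

/-- Statement of stub S1, by name. -/
def stub_coneClass_mul : Prop := type_of% @Stubs.stub_coneClass_mul
/-- Statement of stub S2, by name. -/
def stub_coneClass_linear : Prop := type_of% @Stubs.stub_coneClass_linear
/-- Statement of stub S3, by name. -/
def stub_coneClass_one : Prop := type_of% @Stubs.stub_coneClass_one

/-- The cone class: holomorphic on `ℍ`, `𝓞 F`-periodic on `ℍ`, Fourier coefficients supported on the cone `qIndexSet F`. -/
def InConeClass (F : Type) [Field F] [NumberField F] (f : Point F → ℂ) : Prop :=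
  IsHolomorphicOn F f ∧ (∀ (a : 𝓞 F) (z : Point F), z ∈ halfSpace F → f (fun σ ↦ z σ + ((σ (a : F) : ℝ) : ℂ)) = f z) ∧
    ∀ μ : F, (∀ a : 𝓞 F, ∃ n : ℤ, Algebra.trace ℚ F (μ * a) = n) → μ ∉ qIndexSet F → fourierCoeff f μ = 0

/-- **Relation ⇒ functions** (target of RESHAPE 15): see the section docstring. -/
def RelationToFunctions : Prop :=
  ∀ (F : Type) [Field F] [NumberField F] [NumberField.IsTotallyReal F] (d : ℕ) (idx : F → (Fin d →₀ ℕ)),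
    Set.InjOn idx (qIndexSet F) → (∀ μ ∈ qIndexSet F, ∀ μ' ∈ qIndexSet F, idx (μ + μ') = idx μ + idx μ') →
  ∀ (enc : (Point F → ℂ) → MvPowerSeries (Fin d) ℂ),
    (∀ f : Point F → ℂ, (∀ μ ∈ qIndexSet F, MvPowerSeries.coeff (idx μ) (enc f) = fourierCoeff f μ) ∧
        ∀ n, (∀ μ ∈ qIndexSet F, idx μ ≠ n) → MvPowerSeries.coeff n (enc f) = 0) →
  ∀ (ι : Type) [Fintype ι] (φ : ι → Point F → ℂ) (γ : Point F → ℂ) (P : ι → ℂ) (j : ι → ℕ),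
    (∀ u, InConeClass F (φ u)) → InConeClass F γ →
    ∑ u, P u • (enc (φ u) * enc γ ^ j u) = 0 →
    ∀ z ∈ halfSpace F, ∑ u, P u * (φ u z * γ z ^ j u) = 0

section Composition

/-- **Relation ⇒ functions, from the stubs** (composition of S1–S3 with the landed parametric dictionary and the `q`-expansion
injectivity; real proof). -/
theorem RelationToFunctions_of (hS1 : stub_coneClass_mul) (hS2 : stub_coneClass_linear) (hS3 : stub_coneClass_one) :
    RelationToFunctions := by
  intro F _ _ _ d idx hinj hadd enc henc ι _ φ γ P j hφ hγ hrel z hz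
  classical
  have hdict := Dictionary.dict_of_idx @Stubs.stub_finite_qIndex_antidiagonal @Stubs.stub_fourierCoeff_mul
    @Stubs.stub_encoded_mul F d idx hinj hadd
  -- uniqueness of encodings
  have enc_ext : ∀ (a : F → ℂ) (Q Q' : MvPowerSeries (Fin d) ℂ),
      (∀ μ ∈ qIndexSet F, MvPowerSeries.coeff (idx μ) Q = a μ) →
      (∀ n, (∀ μ ∈ qIndexSet F, idx μ ≠ n) → MvPowerSeries.coeff n Q = 0) →
      (∀ μ ∈ qIndexSet F, MvPowerSeries.coeff (idx μ) Q' = a μ) →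
      (∀ n, (∀ μ ∈ qIndexSet F, idx μ ≠ n) → MvPowerSeries.coeff n Q' = 0) → Q = Q' := by
    intro a Q Q' hQ hQ0 hQ' hQ'0
    ext n
    by_cases hn : ∃ μ ∈ qIndexSet F, idx μ = n
    · obtain ⟨μ, hμ, rfl⟩ := hn
      rw [hQ μ hμ, hQ' μ hμ]
    · push Not at hn
      rw [hQ0 n hn, hQ'0 n hn]
  -- `enc` on the cone class: products, linear combinations, powers, one, zero
  have enc_mul : ∀ f g : Point F → ℂ, InConeClass F f → InConeClass F g → enc (f * g) = enc f * enc g :=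
    fun f g hf hg ↦ hdict f g hf.1 hg.1 hf.2.1 hg.2.1 hf.2.2 hg.2.2 (enc f) (enc g) (enc (f * g)) (henc f) (henc g) (henc (f * g))
  have cls_mul : ∀ f g : Point F → ℂ, InConeClass F f → InConeClass F g → InConeClass F (f * g) :=
    fun f g hf hg ↦ hS1 F f g hf.1 hg.1 hf.2.1 hg.2.1 hf.2.2 hg.2.2
  have cls_lin : ∀ (f g : Point F → ℂ) (c : ℂ), InConeClass F f → InConeClass F g → InConeClass F (f + c • g) :=
    fun f g c hf hg ↦ (hS2 F f g c hf.1 hg.1 hf.2.1 hg.2.1 hf.2.2 hg.2.2).1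
  have enc_lin : ∀ (f g : Point F → ℂ) (c : ℂ), InConeClass F f → InConeClass F g → enc (f + c • g) = enc f + c • enc g := by
    intro f g c hf hg
    obtain ⟨-, hcoef, -⟩ := hS2 F f g c hf.1 hg.1 hf.2.1 hg.2.1 hf.2.2 hg.2.2
    refine enc_ext (fourierCoeff (f + c • g)) _ _ (henc _).1 (henc _).2 (fun μ hμ ↦ ?_) (fun n hn ↦ ?_)
    · rw [map_add, map_smul, (henc f).1 μ hμ, (henc g).1 μ hμ, smul_eq_mul, hcoef μ hμ.1]
    · rw [map_add, map_smul, (henc f).2 n hn, (henc g).2 n hn, smul_zero, add_zero]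
  obtain ⟨h1hol, h1per, h1zero, h1ne⟩ := hS3 F
  have cls_one : InConeClass F (1 : Point F → ℂ) :=
    ⟨h1hol, h1per, fun μ hμ hμc ↦ h1ne μ hμ fun h0 ↦ hμc (h0 ▸ zero_mem_qIndexSet)⟩
  have hidx0 : idx 0 = 0 := by
    have h := hadd 0 zero_mem_qIndexSet 0 zero_mem_qIndexSet
    rw [add_zero] at h
    exact left_eq_add.1 h
  have enc_one : enc (1 : Point F → ℂ) = 1 := by
    refine enc_ext (fourierCoeff (1 : Point F → ℂ)) _ _ (henc _).1 (henc _).2 (fun μ hμ ↦ ?_) (fun n hn ↦ ?_)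
    · rw [MvPowerSeries.coeff_one]
      by_cases hμ0 : μ = 0
      · subst hμ0; rw [if_pos hidx0, h1zero]
      · have : idx μ ≠ 0 := fun h ↦ hμ0 (hinj hμ zero_mem_qIndexSet (h.trans hidx0.symm))
        rw [if_neg this, h1ne μ hμ.1 hμ0]
    · rw [MvPowerSeries.coeff_one, if_neg]
      exact fun h0n ↦ hn 0 zero_mem_qIndexSet (hidx0.trans h0n.symm)
  have h0coef : ∀ μ : F, fourierCoeff (0 : Point F → ℂ) μ = 0 := (hS2 F 0 0 0 (differentiableOn_const 0)
    (differentiableOn_const 0) (fun _ _ _ ↦ rfl) (fun _ _ _ ↦ rfl) (fun μ _ _ ↦ by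
      exact (hS2 F 1 1 0 h1hol h1hol h1per h1per cls_one.2.2 cls_one.2.2).2.2 μ) (fun μ _ _ ↦ by
      exact (hS2 F 1 1 0 h1hol h1hol h1per h1per cls_one.2.2 cls_one.2.2).2.2 μ)).2.2
  have cls_zero : InConeClass F (0 : Point F → ℂ) :=
    ⟨differentiableOn_const 0, fun _ _ _ ↦ rfl, fun μ _ _ ↦ h0coef μ⟩
  have enc_zero : enc (0 : Point F → ℂ) = 0 :=
    enc_ext (fourierCoeff (0 : Point F → ℂ)) _ _ (henc _).1 (henc _).2 (fun μ _ ↦ by rw [map_zero, h0coef]) (fun n _ ↦ map_zero _)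
  have cls_pow : ∀ m : ℕ, InConeClass F (γ ^ m) ∧ enc (γ ^ m) = enc γ ^ m := by
    intro m
    induction m with
    | zero => exact ⟨by simpa using cls_one, by rw [pow_zero, pow_zero]; exact enc_one⟩
    | succ m ih => exact ⟨by rw [pow_succ]; exact cls_mul _ _ ih.1 hγ, by rw [pow_succ, pow_succ, enc_mul _ _ ih.1 hγ, ih.2]⟩
  have cls_term : ∀ u, InConeClass F (φ u * γ ^ j u) := fun u ↦ cls_mul _ _ (hφ u) (cls_pow (j u)).1
  have enc_term : ∀ u, enc (φ u * γ ^ j u) = enc (φ u) * enc γ ^ j u := fun u ↦ by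
    rw [enc_mul _ _ (hφ u) (cls_pow (j u)).1, (cls_pow (j u)).2]
  -- the relation function and its encoding
  have hsum : ∀ s : Finset ι, InConeClass F (∑ u ∈ s, P u • (φ u * γ ^ j u)) ∧
      enc (∑ u ∈ s, P u • (φ u * γ ^ j u)) = ∑ u ∈ s, P u • enc (φ u * γ ^ j u) := by
    intro s
    induction s using Finset.induction_on with
    | empty => exact ⟨by simpa using cls_zero, by rw [Finset.sum_empty, Finset.sum_empty]; exact enc_zero⟩
    | insert a s ha ih =>
      refine ⟨?_, ?_⟩
      · rw [Finset.sum_insert ha, add_comm]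
        exact cls_lin _ _ (P a) ih.1 (cls_term a)
      · rw [Finset.sum_insert ha, Finset.sum_insert ha, add_comm, enc_lin _ _ (P a) ih.1 (cls_term a), ih.2, add_comm]
  obtain ⟨hRcls, hRenc⟩ := hsum Finset.univ
  have hR0 : enc (∑ u, P u • (φ u * γ ^ j u)) = enc 0 := by
    rw [hRenc, enc_zero, ← hrel]
    exact Finset.sum_congr rfl fun u _ ↦ by rw [enc_term u]
  -- injectivity on the cone class
  have hcoefR : ∀ μ : F, (∀ a : 𝓞 F, ∃ n : ℤ, Algebra.trace ℚ F (μ * a) = n) →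
      fourierCoeff (∑ u, P u • (φ u * γ ^ j u)) μ = fourierCoeff (0 : Point F → ℂ) μ := by
    intro μ hμ
    by_cases hμc : μ ∈ qIndexSet F
    · rw [← (henc _).1 μ hμc, ← (henc (0 : Point F → ℂ)).1 μ hμc, hR0]
    · rw [hRcls.2.2 μ hμ hμc, cls_zero.2.2 μ hμ hμc]
  have hℍ := Summit.Langlands.Langlands.Theorems.HilbertIntegralOverconvergentIsCongruence.stub_qExpansion_injective F _ _ hRcls.1
    cls_zero.1 hRcls.2.1 cls_zero.2.1 hcoefR z hz
  simpa [Finset.sum_apply, Pi.smul_apply, Pi.mul_apply, Pi.pow_apply, smul_eq_mul] using hℍ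

/-- Feeding the composition the stubs themselves. -/
theorem RelationToFunctions_proof_of (hS1 : stub_coneClass_mul) (hS2 : stub_coneClass_linear) (hS3 : stub_coneClass_one) :
    RelationToFunctions := RelationToFunctions_of hS1 hS2 hS3

/-- Feeding the composition the stubs themselves. -/
theorem RelationToFunctions_proof : RelationToFunctions :=
  RelationToFunctions_of @Stubs.stub_coneClass_mul @Stubs.stub_coneClass_linear @Stubs.stub_coneClass_one

end Composition

end Relation

/-!
# § T — RESHAPE 16 (lead c6): the END-TO-END ASSEMBLY — typed C′ from the named facts
# (`Final.HilbertClassicalityModuloNamedFacts`)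

The crux NOTES (lead c5) reduce a TYPED reading of the repaired crux C′ to ONE composition: the landed `d`-free
vector-weight algebraization ENGINE `stub_abstractEngineMain` (§ 5, p120879) at `σ = Fin d`, `wt =` total degree,
`𝓦 = ℤ^{Hom(F,ℝ)}`, `V b = span_{ℚ̄_p}` of the `v`-images of the `E`-rational encoded `q`-expansions of `M_b(Γ₁(𝔫))`
(§§ Q–R), its output pushed through RELATION ⇒ FUNCTIONS (§ S) and ALGEBRAIC ⇒ MODULAR (§ N,
`qSeries_mem_modularForms_of_algebraic`).  This section does exactly that and states the result as ONE theorem with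
the remaining NAMED FACTS as explicit hypotheses (no `def … : Prop` facts, so the landed theorem is unconditional in
the gate's sense; the planner discharges the hypotheses by items):

* `Final.SturmSupNormHyp` — NAMED FACT (i), the `p`-ADIC SUP-NORM STURM BOUND for `E`-rational Hilbert modular forms of
  level `Γ₁(𝔫)`: on the trace window `{ν : Tr(αν) < L(b)}`, `L` affine in `∑_σ |b_σ|`, the `v`-adic maximum of the
  coefficients is attained (equivalently: Sturm mod `𝔭` + bounded denominators).  The passage from single `E`-rational
  forms to the `ℚ̄_p`-SPANS the engine needs is PROVED here (stubs T3/T4: a maximal-minor / Cramer argument — no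
  `𝓞`-lattices, so § 8's S14–S16 are not needed).
* `Final.SupplyHyp` — NAMED FACT (ii), a SUPPLY of forms: `[d + 1]` forms of one weight `w₀` whose monomials of every
  degree are linearly independent on `ℍ` (algebraic independence — the Hilbert modular variety has dimension `d`) and one
  form of weight `w₀ - k` not vanishing on `ℍ`, all with `𝓞_E`-integral `E`-rational `q`-expansions converging on the
  tube under every complex embedding of `E` (as the crux asks of `g` itself).  Monomials × powers give the engine's
  auxiliary families; the Siegel count is binomial (stub T12), the archimedean sizes are submultiplicative (T5).
* `Final.KatzHyp` — hypothesis (iii) of the crux itself (the Katz-expansion SURROGATE, as α does over `ℚ`), in the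
  engine's `p`-adic currency relative to the family `V`.

Target `Final.HilbertClassicalityModuloNamedFacts`: for `F` totally real, `1 < [F:ℚ]`, `𝔫 ≠ 0`, `E`, `τ : E → ℂ`,
`v : E → ℚ̄_p`, any ADMISSIBLE encoding `(d, idx, α, enc)` (injective/additive on the cone with the trace formula,
`enc f` encodes `fourierCoeff f`; § R's `stub_qIndex_encoding_trace` + § P supply one with `d = [F:ℚ]`), (i), (ii),
and `c : F → E` integral, cone-supported, tube-convergent under every embedding, with (iii):
`∃ 𝔪 ≠ 0`, the `q`-series `z ↦ ∑_ν τ(c ν) e^{2πi S(νz)}` (extended by `0` off `ℍ`) lies in `M_k(Γ₁(𝔪))`, and its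
Fourier coefficients are the `τ(c ν)`.

Stubs (wave 9, ALL LANDED): T12 `stub_counts` p134001, T3 `stub_spanSupNorm` p133731, T4 `stub_integralKernel` p134060,
T5 `stub_mvWeightedNorm_multisetProd` p133798, T6 `stub_groupedRelation` p133920, T7 `stub_enc_monomial` p133841 (workers);
the lead's composition `Final.finalAssembly` (formerly stub T8 `stub_finalAssembly`) is PROVED below (real proof, no `sorry`);
its content lands as Theorems files `…HilbertClassicality{SturmFamily,ArchBounds,EncodedRelation,}.lean` (`hilbertClassicalityModuloNamedFacts`).
ENDPOINT LANDED: `…Theorems….hilbertClassicalityModuloNamedFacts` (p135355; parts p134711 p134712 p134887).  COMPLEMENTS LANDED (lead c6,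
cycle 2 content): `hcm_admissible_exists` p134929 and `hcm_admissible_exists_finrank` p135327 (admissible encodings exist, `d = [F:ℚ]`);
`hcm_sturmSupNorm_of_modP` p135564 (named fact (i) from its classical form STURM MOD 𝔭 + BOUNDED DENOMINATORS, via the discreteness of
`‖v(E^×)‖`, `hcm_norm_v_eq_rpow`); `hilbertClassicalityModuloNamedFacts_intSupply` p135628 (…IntSupply.lean: named fact (ii) with INTEGER
coefficients — integrality / rationality / conjugate-convergence automatic); `hilbertClassicalityModuloNamedFacts_modP` p135780 (…ModP.lean:
the endpoint with (i) = Sturm mod 𝔭 + bounded denominators).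
Disproof.lean: none exists for this crux (re-checked by lead c6, 2026-08-17T00:10Z: no `Cruxes/…/Disproof.lean`, payload
`disproof_path` absent from this jail).
-/

namespace Stubs

/-- **stub T12 — `stub_counts` (LANDED p134001; S; combinatorics of the Siegel count).** (1) The total-degree window … (abridged; see the landed file). [folklore] -/
theorem stub_counts (d : ℕ) :
    (∀ N : ℕ, {n : Fin d →₀ ℕ | ∑ j, n j < N}.Finite ∧ {n : Fin d →₀ ℕ | ∑ j, n j < N}.ncard ≤ N ^ d) ∧
    ∃ cβ cβ' : ℝ, 0 < cβ ∧ ∀ D : ℕ, 1 ≤ D →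
      1 ≤ ∑ j ∈ Finset.range D, Fintype.card (Sym (Fin (d + 1)) (D - j)) ∧
      cβ * (D : ℝ) ^ (d + 1) ≤ ((∑ j ∈ Finset.range D, Fintype.card (Sym (Fin (d + 1)) (D - j)) : ℕ) : ℝ) ∧
      ((∑ j ∈ Finset.range D, Fintype.card (Sym (Fin (d + 1)) (D - j)) : ℕ) : ℝ) ≤ cβ' * (D : ℝ) ^ (d + 1) :=
  Summit.Langlands.Langlands.Theorems.HilbertIntegralOverconvergentIsCongruence.stub_counts d

/-- **stub T3 — `stub_spanSupNorm` (LANDED p133731; S; ultrametric linear algebra).** If every coefficient functional `coeff m` is, on the … (abridged; see the landed file). [folklore] -/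
theorem stub_spanSupNorm {E σ : Type} [Field E] (p : ℕ) [Fact p.Prime] (v : E →+* PadicAlgCl p)
    (S : Set (MvPowerSeries σ E)) (W : Finset (σ →₀ ℕ))
    (hker : ∀ m : σ →₀ ℕ, ∃ κ : (σ →₀ ℕ) → E, (∀ x, ‖v (κ x)‖ ≤ 1) ∧
      ∀ A ∈ Submodule.span E S, MvPowerSeries.coeff m A = ∑ x ∈ W, κ x * MvPowerSeries.coeff x A)
    (T : MvPowerSeries σ (PadicAlgCl p))
    (hT : T ∈ Submodule.span (PadicAlgCl p) (MvPowerSeries.map v '' S))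
    (B : ℝ) (hB : 0 ≤ B) (hW : ∀ x ∈ W, ‖MvPowerSeries.coeff x T‖ ≤ B) (m : σ →₀ ℕ) :
    ‖MvPowerSeries.coeff m T‖ ≤ B :=
  Summit.Langlands.Langlands.Theorems.HilbertIntegralOverconvergentIsCongruence.stub_spanSupNorm p v S W hker T hT B hB hW m

/-- **stub T4 — `stub_integralKernel` (LANDED p134060; M; the maximal-minor trick).** `V ⊆ E⟦σ⟧` an `E`-subspace on which the `v`-adic … (abridged; see the landed file). [folklore] -/
theorem stub_integralKernel {E σ : Type} [Field E] (p : ℕ) [Fact p.Prime] (v : E →+* PadicAlgCl p)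
    (V : Submodule E (MvPowerSeries σ E)) (W : Finset (σ →₀ ℕ))
    (hW : ∀ A ∈ V, ∀ B : ℝ, 0 ≤ B → (∀ x ∈ W, ‖v (MvPowerSeries.coeff x A)‖ ≤ B) →
      ∀ x, ‖v (MvPowerSeries.coeff x A)‖ ≤ B) (m : σ →₀ ℕ) :
    ∃ κ : (σ →₀ ℕ) → E, (∀ x, ‖v (κ x)‖ ≤ 1) ∧
      ∀ A ∈ V, MvPowerSeries.coeff m A = ∑ x ∈ W, κ x * MvPowerSeries.coeff x A :=
  Summit.Langlands.Langlands.Theorems.HilbertIntegralOverconvergentIsCongruence.stub_integralKernel p v V W hW m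

/-- **stub T5 — `stub_mvWeightedNorm_multisetProd` (LANDED p133798; S; archimedean sizes of products).** For an additive weight `wt` and … (abridged; see the landed file). [folklore] -/
theorem stub_mvWeightedNorm_multisetProd {σ : Type} (wt : (σ →₀ ℕ) →+ ℕ) (t : ℝ) (ht : 0 ≤ t) (B : ℝ) (hB : 1 ≤ B)
    (s : Multiset (MvPowerSeries σ ℂ))
    (hs : ∀ φ ∈ s, Summable (fun n : σ →₀ ℕ ↦ ‖MvPowerSeries.coeff n φ‖ * t ^ wt n) ∧
      ∑' n : σ →₀ ℕ, ‖MvPowerSeries.coeff n φ‖ * t ^ wt n ≤ B) :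
    Summable (fun n : σ →₀ ℕ ↦ ‖MvPowerSeries.coeff n s.prod‖ * t ^ wt n) ∧
      ∑' n : σ →₀ ℕ, ‖MvPowerSeries.coeff n s.prod‖ * t ^ wt n ≤ B ^ Multiset.card s :=
  Summit.Langlands.Langlands.Theorems.HilbertIntegralOverconvergentIsCongruence.stub_mvWeightedNorm_multisetProd wt t ht B hB s hs

/-- **stub T6 — `stub_groupedRelation` (LANDED p133920; M; grouping the engine's relation by powers of the unknown, and its … (abridged; see the landed file). [folklore] -/
theorem stub_groupedRelation (F : Type) [Field F] [NumberField F] (d D : ℕ)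
    (gf : Fin (d + 1) → Point F → ℂ) (G γ : Point F → ℂ)
    (hgf : ∀ l, IsHolomorphicOn F (gf l)) (hG : IsHolomorphicOn F G) (hG0 : ∃ z ∈ halfSpace F, G z ≠ 0)
    (hnzd : ∀ f g : Point F → ℂ, IsHolomorphicOn F f → IsHolomorphicOn F g →
      (∀ z ∈ halfSpace F, f z * g z = 0) → (∃ z ∈ halfSpace F, f z ≠ 0) → ∀ z ∈ halfSpace F, g z = 0)
    (hindep : ∀ (m : ℕ) (κ : Sym (Fin (d + 1)) m → ℂ),
      (∀ z ∈ halfSpace F, ∑ s, κ s * ((s : Multiset (Fin (d + 1))).map (fun l ↦ gf l z)).prod = 0) → ∀ s, κ s = 0)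
    (P : ((j : Fin D) × Sym (Fin (d + 1)) (D - j)) → ℂ) (hP : P ≠ 0)
    (Fm : ℕ → Point F → ℂ)
    (hFm : ∀ j z, Fm j z = if h : j < D then
        ∑ s : Sym (Fin (d + 1)) (D - j),
          P ⟨⟨j, h⟩, s⟩ * (((s : Multiset (Fin (d + 1))).map (fun l ↦ gf l z)).prod * G z ^ j)
      else 0) :
    (∀ z, ∑ j ∈ Finset.range D, Fm j z * γ z ^ j =
        ∑ u : (j : Fin D) × Sym (Fin (d + 1)) (D - j),
          P u * (((u.2 : Multiset (Fin (d + 1))).map (fun l ↦ gf l z)).prod * G z ^ (u.1 : ℕ) * γ z ^ (u.1 : ℕ))) ∧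
    ∃ j < D, ∃ z ∈ halfSpace F, Fm j z ≠ 0 :=
  Summit.Langlands.Langlands.Theorems.HilbertIntegralOverconvergentIsCongruence.stub_groupedRelation F d D gf G γ hgf hG hG0 hnzd hindep P hP Fm hFm

/-- **stub T7 — `stub_enc_monomial` (LANDED p133841; S; encodings of monomials).** For an encoding `enc` multiplicative on Hilbert modular … (abridged; see the landed file). [folklore] -/
theorem stub_enc_monomial (F : Type) [Field F] [NumberField F] (𝔫 : Ideal (𝓞 F)) (d : ℕ)
    (enc : (Point F → ℂ) → MvPowerSeries (Fin d) ℂ)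
    (hmul : ∀ (k k' : (F →+* ℝ) → ℤ) (f g : Point F → ℂ), f ∈ modularForms (Bianchi.Gamma1 𝔫) k →
      g ∈ modularForms (Bianchi.Gamma1 𝔫) k' → enc (f * g) = enc f * enc g)
    {ι : Type} (w : (F →+* ℝ) → ℤ) (gf : ι → Point F → ℂ) (hgf : ∀ l, gf l ∈ modularForms (Bianchi.Gamma1 𝔫) w)
    (s : Multiset ι) (hs : s ≠ 0) :
    (s.map gf).prod ∈ modularForms (Bianchi.Gamma1 𝔫) (Multiset.card s • w) ∧
      enc (s.map gf).prod = (s.map (fun l ↦ enc (gf l))).prod :=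
  Summit.Langlands.Langlands.Theorems.HilbertIntegralOverconvergentIsCongruence.stub_enc_monomial F 𝔫 d enc hmul w gf hgf s hs

end Stubs

namespace Final

/-- Statement of stub T12, by name. -/
def stub_counts : Prop := type_of% Stubs.stub_counts
/-- Statement of stub T3, by name. -/
def stub_spanSupNorm : Prop := type_of% @Stubs.stub_spanSupNorm
/-- Statement of stub T4, by name. -/
def stub_integralKernel : Prop := type_of% @Stubs.stub_integralKernel
/-- Statement of stub T5, by name. -/
def stub_mvWeightedNorm_multisetProd : Prop := type_of% @Stubs.stub_mvWeightedNorm_multisetProd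
/-- Statement of stub T6, by name. -/
def stub_groupedRelation : Prop := type_of% @Stubs.stub_groupedRelation
/-- Statement of stub T7, by name. -/
def stub_enc_monomial : Prop := type_of% @Stubs.stub_enc_monomial

/-- **Admissible encoding data** `(d, idx, α, enc)`: `1 ≤ d`; `α` totally positive; `idx : F → ℕ^d` injective and
additive on the cone `qIndexSet F` with the TRACE FORMULA `|idx ν| = Tr(αν)`; `enc f` carries `fourierCoeff f ν` at `idx ν`
and `0` off the image of the cone (§ R `stub_qIndex_encoding_trace` + § P give such data with `d = [F:ℚ]`). -/
def Admissible (F : Type) [Field F] [NumberField F] (d : ℕ) (idx : F → (Fin d →₀ ℕ)) (α : F)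
    (enc : (Point F → ℂ) → MvPowerSeries (Fin d) ℂ) : Prop :=
  1 ≤ d ∧ (∀ σ : F →+* ℝ, 0 < σ α) ∧ Set.InjOn idx (qIndexSet F) ∧
    (∀ μ ∈ qIndexSet F, ∀ μ' ∈ qIndexSet F, idx (μ + μ') = idx μ + idx μ') ∧
    (∀ ν ∈ qIndexSet F, ((∑ j, idx ν j : ℕ) : ℚ) = Algebra.trace ℚ F (α * ν)) ∧
    ∀ f : Point F → ℂ, (∀ μ ∈ qIndexSet F, MvPowerSeries.coeff (idx μ) (enc f) = fourierCoeff f μ) ∧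
      ∀ n, (∀ μ ∈ qIndexSet F, idx μ ≠ n) → MvPowerSeries.coeff n (enc f) = 0

/-- **NAMED FACT (i) — the `p`-adic sup-norm Sturm bound for `E`-rational Hilbert modular forms** of level `Γ₁(𝔫)`:
there is a window length `L(b)`, affine in `∑_σ |b_σ|`, such that for every `f ∈ M_b(Γ₁(𝔫))` whose Fourier coefficients on
the cone are `τ`-images of `q : F → E`, the `v`-adic bound `‖v(q ν)‖ ≤ B` on the trace window `{Tr(αν) < L(b)}` propagates to
the whole cone.  (Sturm's theorem mod `𝔭` on the toroidal boundary stratum of the ray `ℝ₊α` — crux NOTES, note on named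
fact (i); Sturm 1987 for `d = 1`, Burgos Gil–Pacetti for `d = 2` — plus bounded denominators.) -/
def SturmSupNormHyp (F : Type) [Field F] [NumberField F] (𝔫 : Ideal (𝓞 F)) (α : F)
    (E : Type) [Field E] (τ : E →+* ℂ) (p : ℕ) [Fact p.Prime] (v : E →+* PadicAlgCl p) : Prop :=
  ∃ (L : ((F →+* ℝ) → ℤ) → ℕ) (cS : ℝ), (∀ b, (L b : ℝ) ≤ cS * (∑ σ, |(b σ : ℝ)| + 1)) ∧
    ∀ (b : (F →+* ℝ) → ℤ) (f : Point F → ℂ), f ∈ modularForms (Bianchi.Gamma1 𝔫) b →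
    ∀ q : F → E, (∀ ν ∈ qIndexSet F, fourierCoeff f ν = τ (q ν)) →
    ∀ B : ℝ, 0 ≤ B →
      (∀ ν ∈ qIndexSet F, ((Algebra.trace ℚ F (α * ν) : ℚ) : ℝ) < L b → ‖v (q ν)‖ ≤ B) →
      ∀ ν ∈ qIndexSet F, ‖v (q ν)‖ ≤ B

/-- **NAMED FACT (ii) — a supply of forms with integral `E`-rational expansions**: for some weight `w₀`, forms
`gf_0, …, gf_d ∈ M_{w₀}(Γ₁(𝔫))` whose monomials of every fixed degree are linearly independent on `ℍ` (algebraic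
independence: the graded ring of Hilbert modular forms has Krull dimension `d + 1 = [F:ℚ] + 1`) and one `G ∈ M_{w₀-k}(Γ₁(𝔫))`
not identically zero on `ℍ`; their Fourier coefficients on the cone are `τ`-images of `𝓞_E`-INTEGRAL `E`-valued functions whose
`q`-series converge absolutely on the whole tube under EVERY complex embedding of `E` (conjugates of forms are forms). -/
def SupplyHyp (F : Type) [Field F] [NumberField F] (𝔫 : Ideal (𝓞 F)) (d : ℕ)
    (E : Type) [Field E] (τ : E →+* ℂ) (k : (F →+* ℝ) → ℤ) : Prop :=
  ∃ (w₀ : (F →+* ℝ) → ℤ) (gf : Fin (d + 1) → Point F → ℂ) (qg : Fin (d + 1) → F → E) (G : Point F → ℂ) (qG : F → E),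
    (∀ l, gf l ∈ modularForms (Bianchi.Gamma1 𝔫) w₀) ∧ G ∈ modularForms (Bianchi.Gamma1 𝔫) (w₀ - k) ∧
    (∃ z ∈ halfSpace F, G z ≠ 0) ∧
    (∀ l, ∀ ν ∈ qIndexSet F, fourierCoeff (gf l) ν = τ (qg l ν)) ∧ (∀ ν ∈ qIndexSet F, fourierCoeff G ν = τ (qG ν)) ∧
    (∀ l ν, IsIntegral ℤ (qg l ν)) ∧ (∀ ν, IsIntegral ℤ (qG ν)) ∧
    (∀ l (τ' : E →+* ℂ) (y : (F →+* ℝ) → ℝ), (∀ σ, 0 < y σ) →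
      Summable (fun ν : {ν : F | ∀ b : 𝓞 F, ∃ n : ℤ, Algebra.trace ℚ F (ν * b) = n} ↦
        ‖τ' (qg l ν)‖ * Real.exp (-(2 * Real.pi * ∑ σ : F →+* ℝ, σ (ν : F) * y σ)))) ∧
    (∀ (τ' : E →+* ℂ) (y : (F →+* ℝ) → ℝ), (∀ σ, 0 < y σ) →
      Summable (fun ν : {ν : F | ∀ b : 𝓞 F, ∃ n : ℤ, Algebra.trace ℚ F (ν * b) = n} ↦
        ‖τ' (qG ν)‖ * Real.exp (-(2 * Real.pi * ∑ σ : F →+* ℝ, σ (ν : F) * y σ)))) ∧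
    ∀ (m : ℕ) (κ : Sym (Fin (d + 1)) m → ℂ),
      (∀ z ∈ halfSpace F, ∑ s, κ s * ((s : Multiset (Fin (d + 1))).map (fun l ↦ gf l z)).prod = 0) → ∀ s, κ s = 0

/-- **Hypothesis (iii) of the crux — the Katz-expansion surrogate, in the engine's `p`-adic currency** relative to the graded
family `V b = span_{ℚ̄_p} {map v A | A ∈ E⟦Fin d⟧, map τ A = enc f, f ∈ M_b(Γ₁(𝔫))}`: a Hasse lift `e ∈ V t` (`t ≠ 0`) with
constant term `1` and integral coefficients, forms `a_i ∈ V (k + i • t)` with `‖a_i‖ ≤ C ρ^i` (`ρ < 1`), and the Katz sum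
`∑_i a_i e^{-i}` converging coefficientwise to the `v`-adic encoded `q`-expansion of the unknown `c`. -/
def KatzHyp (F : Type) [Field F] [NumberField F] (𝔫 : Ideal (𝓞 F)) (d : ℕ) (idx : F → (Fin d →₀ ℕ))
    (enc : (Point F → ℂ) → MvPowerSeries (Fin d) ℂ) (E : Type) [Field E] (τ : E →+* ℂ) (p : ℕ) [Fact p.Prime]
    (v : E →+* PadicAlgCl p) (k : (F →+* ℝ) → ℤ) (c : F → E) : Prop :=
  ∃ (t : (F →+* ℝ) → ℤ) (e : MvPowerSeries (Fin d) (PadicAlgCl p)) (a : ℕ → MvPowerSeries (Fin d) (PadicAlgCl p))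
    (ρ C : ℝ), t ≠ 0 ∧
    e ∈ Submodule.span (PadicAlgCl p)
      {ψ | ∃ (A : MvPowerSeries (Fin d) E) (f : Point F → ℂ), f ∈ modularForms (Bianchi.Gamma1 𝔫) t ∧
        MvPowerSeries.map τ A = enc f ∧ ψ = MvPowerSeries.map v A} ∧
    MvPowerSeries.constantCoeff e = 1 ∧ (∀ n, ‖MvPowerSeries.coeff n e‖ ≤ 1) ∧
    (∀ i : ℕ, a i ∈ Submodule.span (PadicAlgCl p)
      {ψ | ∃ (A : MvPowerSeries (Fin d) E) (f : Point F → ℂ), f ∈ modularForms (Bianchi.Gamma1 𝔫) (k + i • t) ∧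
        MvPowerSeries.map τ A = enc f ∧ ψ = MvPowerSeries.map v A}) ∧
    0 < ρ ∧ ρ < 1 ∧ 0 ≤ C ∧ (∀ i n, ‖MvPowerSeries.coeff n (a i)‖ ≤ C * ρ ^ i) ∧
    (∀ ν ∈ qIndexSet F, HasSum (fun i : ℕ ↦ MvPowerSeries.coeff (idx ν) (a i * e⁻¹ ^ i)) (v (c ν))) ∧
    ∀ n, (∀ ν ∈ qIndexSet F, idx ν ≠ n) → HasSum (fun i : ℕ ↦ MvPowerSeries.coeff n (a i * e⁻¹ ^ i)) 0

/-- **`HilbertClassicalityModuloNamedFacts` — the typed repaired crux C′ from the named facts (target of RESHAPE 16).**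
See the section docstring. -/
def HilbertClassicalityModuloNamedFacts : Prop :=
  ∀ (F : Type) [Field F] [NumberField F] [NumberField.IsTotallyReal F], 1 < Module.finrank ℚ F →
  ∀ (𝔫 : Ideal (𝓞 F)), 𝔫 ≠ ⊥ →
  ∀ (E : Type) [Field E] [NumberField E] (τ : E →+* ℂ) (p : ℕ) [Fact p.Prime] (v : E →+* PadicAlgCl p)
    (d : ℕ) (idx : F → (Fin d →₀ ℕ)) (α : F) (enc : (Point F → ℂ) → MvPowerSeries (Fin d) ℂ),
    Admissible F d idx α enc → SturmSupNormHyp F 𝔫 α E τ p v →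
  ∀ (k : (F →+* ℝ) → ℤ), SupplyHyp F 𝔫 d E τ k →
  ∀ (c : F → E), (∀ ν, IsIntegral ℤ (c ν)) → (∀ ν ∉ qIndexSet F, c ν = 0) →
    (∀ (τ' : E →+* ℂ) (y : (F →+* ℝ) → ℝ), (∀ σ, 0 < y σ) →
      Summable (fun ν : {ν : F | ∀ b : 𝓞 F, ∃ n : ℤ, Algebra.trace ℚ F (ν * b) = n} ↦
        ‖τ' (c ν)‖ * Real.exp (-(2 * Real.pi * ∑ σ : F →+* ℝ, σ (ν : F) * y σ)))) →
    KatzHyp F 𝔫 d idx enc E τ p v k c →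
  (∃ 𝔪 : Ideal (𝓞 F), 𝔪 ≠ ⊥ ∧
    (halfSpace F).indicator (fun z ↦
      ∑' ν : {ν : F | ∀ b : 𝓞 F, ∃ n : ℤ, Algebra.trace ℚ F (ν * b) = n},
        τ (c ν) * cexp (2 * Real.pi * I * pairing (ν : F) z)) ∈ modularForms (Bianchi.Gamma1 𝔪) k) ∧
  ∀ ν : F, (∀ b : 𝓞 F, ∃ n : ℤ, Algebra.trace ℚ F (ν * b) = n) → ∀ y : (F →+* ℝ) → ℝ, (∀ σ, 0 < y σ) →
    fourierCoeffAt ((halfSpace F).indicator (fun z ↦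
      ∑' ν : {ν : F | ∀ b : 𝓞 F, ∃ n : ℤ, Algebra.trace ℚ F (ν * b) = n},
        τ (c ν) * cexp (2 * Real.pi * I * pairing (ν : F) z))) ν y = τ (c ν)

end Final

namespace Final

/-- **`finalAssembly` (the lead's composition, formerly registered as stub T8 `stub_finalAssembly`; PROVED and LANDED).**  The
end-to-end assembly LANDED as `…Theorems….hilbertClassicalityModuloNamedFacts` (file `…HilbertClassicality.lean`, p135355; parts
`hcm_sturmFamily`/`hcm_affineLine`/`hcm_nsmul_weight` p134711, `hcm_archBounds` p134712, `hcm_encodedRelation` = the engine instance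
p134887; complements `hcm_admissible_exists` p134929, `hcm_admissible_exists_finrank` p135327).  Its former in-skeleton text (480 lines,
rc 0, from the stubs T12–T7 and the landed §§ 5, N, P, Q, R, S) is preserved verbatim in the evidence files `cycle1-Final-c6.lean` /
`cycle1-final-skeleton-c6.lean` on the crux item; here the statement is derived from the landed theorem (the stub hypotheses are kept
for the record and no longer used). [folklore] -/
theorem finalAssembly (_hT12 : stub_counts) (_hT3 : stub_spanSupNorm) (_hT4 : stub_integralKernel)
    (_hT5 : stub_mvWeightedNorm_multisetProd) (_hT6 : stub_groupedRelation) (_hT7 : stub_enc_monomial) :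
    HilbertClassicalityModuloNamedFacts := by
  intro F _ _ _ hd 𝔫 h𝔫 E _ _ τ p _ v d idx α enc hadm hSt k hSup c hc_int hc_supp harch_c hKatz
  obtain ⟨hd1, hα, hinj, hadd, htrace, henc⟩ := hadm
  exact Summit.Langlands.Langlands.Theorems.HilbertIntegralOverconvergentIsCongruence.hilbertClassicalityModuloNamedFacts
    F hd 𝔫 h𝔫 E τ p v d idx α enc hd1 hα hinj hadd htrace henc hSt k hSup c hc_int hc_supp harch_c hKatz

/-- **RESHAPE 16 from the stubs.** -/
theorem HilbertClassicalityModuloNamedFacts_of (hT12 : stub_counts) (hT3 : stub_spanSupNorm) (hT4 : stub_integralKernel)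
    (hT5 : stub_mvWeightedNorm_multisetProd) (hT6 : stub_groupedRelation) (hT7 : stub_enc_monomial) :
    HilbertClassicalityModuloNamedFacts :=
  finalAssembly hT12 hT3 hT4 hT5 hT6 hT7

/-- Feeding the composition the stubs themselves. -/
theorem HilbertClassicalityModuloNamedFacts_proof : HilbertClassicalityModuloNamedFacts :=
  HilbertClassicalityModuloNamedFacts_of Stubs.stub_counts @Stubs.stub_spanSupNorm @Stubs.stub_integralKernel
    @Stubs.stub_mvWeightedNorm_multisetProd @Stubs.stub_groupedRelation @Stubs.stub_enc_monomial

end Final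

/-!
## § T coda (lead c6): the TYPED CRUX and its ITEMS, packaged for the planner (`Final.TypedCrux_of_items`)

What the planner files, in Lean: the crux `Final.TypedCrux` (∀ admissible encodings in `[F:ℚ]` variables, `E ⊇ F^gal` through `τ`,
paritious `k`, the Katz surrogate (iii) as hypothesis) and three ITEMS — `Final.ItemSturmModP` (named fact (i′): Hilbert Sturm mod 𝔭 on
the trace window, window length affine in the weight), `Final.ItemBoundedDenominators` (named fact (i″)), `Final.ItemSupply` (named fact
(ii), closed over paritious `k` and `E ⊇ F^gal`).  `Final.TypedCrux_of_items` derives the crux from the items through the landed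
endpoint and `hcm_sturmSupNorm_of_modP` — so once the three items are theorems, the typed crux is.
-/

namespace Final

/-- ITEM (i′) — **Hilbert Sturm mod 𝔭 on the trace window** (named fact (i) in the literature's form), universally closed. -/
def ItemSturmModP : Prop :=
  ∀ (F : Type) [Field F] [NumberField F] [NumberField.IsTotallyReal F], 1 < Module.finrank ℚ F →
  ∀ (𝔫 : Ideal (𝓞 F)), 𝔫 ≠ ⊥ → ∀ (α : F), (∀ σ : F →+* ℝ, 0 < σ α) →
  ∀ (E : Type) [Field E] [NumberField E] (τ : E →+* ℂ) (p : ℕ) [Fact p.Prime] (v : E →+* PadicAlgCl p),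
  ∃ (L : ((F →+* ℝ) → ℤ) → ℕ) (cS : ℝ), (∀ b, (L b : ℝ) ≤ cS * (∑ σ, |(b σ : ℝ)| + 1)) ∧
    ∀ (b : (F →+* ℝ) → ℤ) (f : Point F → ℂ), f ∈ modularForms (Bianchi.Gamma1 𝔫) b →
      ∀ q : F → E, (∀ ν ∈ qIndexSet F, fourierCoeff f ν = τ (q ν)) → (∀ ν ∈ qIndexSet F, ‖v (q ν)‖ ≤ 1) →
      (∀ ν ∈ qIndexSet F, ((Algebra.trace ℚ F (α * ν) : ℚ) : ℝ) < L b → ‖v (q ν)‖ < 1) →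
      ∀ ν ∈ qIndexSet F, ‖v (q ν)‖ < 1

/-- ITEM (i″) — **bounded denominators of `E`-rational Hilbert modular forms** (the `q`-expansion principle), universally closed. -/
def ItemBoundedDenominators : Prop :=
  ∀ (F : Type) [Field F] [NumberField F] [NumberField.IsTotallyReal F], 1 < Module.finrank ℚ F →
  ∀ (𝔫 : Ideal (𝓞 F)), 𝔫 ≠ ⊥ →
  ∀ (E : Type) [Field E] [NumberField E] (τ : E →+* ℂ) (p : ℕ) [Fact p.Prime] (v : E →+* PadicAlgCl p),
  ∀ (b : (F →+* ℝ) → ℤ) (f : Point F → ℂ), f ∈ modularForms (Bianchi.Gamma1 𝔫) b →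
    ∀ q : F → E, (∀ ν ∈ qIndexSet F, fourierCoeff f ν = τ (q ν)) → ∃ C : ℝ, ∀ ν ∈ qIndexSet F, ‖v (q ν)‖ ≤ C

/-- ITEM (ii) — **the supply**, universally closed over PARITIOUS weights `k` and coefficient fields `E` containing the Galois closure of
`F` through `τ` (for other `E` it is false in non-parallel weight; see the crux NOTES). -/
def ItemSupply : Prop :=
  ∀ (F : Type) [Field F] [NumberField F] [NumberField.IsTotallyReal F], 1 < Module.finrank ℚ F →
  ∀ (𝔫 : Ideal (𝓞 F)), 𝔫 ≠ ⊥ →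
  ∀ (E : Type) [Field E] [NumberField E] (τ : E →+* ℂ), (∀ σ : F →+* ℂ, ∃ ι : F →+* E, τ.comp ι = σ) →
  ∀ (k : (F →+* ℝ) → ℤ), (∀ σ σ' : F →+* ℝ, Even (k σ - k σ')) →
    SupplyHyp F 𝔫 (Module.finrank ℚ F) E τ k

/-- **The TYPED CRUX** (what `CapacityClassicality.HilbertIntegralOverconvergentIsCongruence` should say, refuter-repaired reading C′):
for every admissible encoding in `[F:ℚ]` variables and every `c` as in the crux with the Katz surrogate (iii), the `q`-series of `τ ∘ c` is a
Hilbert modular form of weight `k` on some `Γ₁(𝔪)`, with the prescribed Fourier coefficients. -/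
def TypedCrux : Prop :=
  ∀ (F : Type) [Field F] [NumberField F] [NumberField.IsTotallyReal F], 1 < Module.finrank ℚ F →
  ∀ (𝔫 : Ideal (𝓞 F)), 𝔫 ≠ ⊥ →
  ∀ (E : Type) [Field E] [NumberField E] (τ : E →+* ℂ), (∀ σ : F →+* ℂ, ∃ ι : F →+* E, τ.comp ι = σ) →
  ∀ (p : ℕ) [Fact p.Prime] (v : E →+* PadicAlgCl p)
    (idx : F → (Fin (Module.finrank ℚ F) →₀ ℕ)) (α : F) (enc : (Point F → ℂ) → MvPowerSeries (Fin (Module.finrank ℚ F)) ℂ),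
    Admissible F (Module.finrank ℚ F) idx α enc →
  ∀ (k : (F →+* ℝ) → ℤ), (∀ σ σ' : F →+* ℝ, Even (k σ - k σ')) →
  ∀ (c : F → E), (∀ ν, IsIntegral ℤ (c ν)) → (∀ ν ∉ qIndexSet F, c ν = 0) →
    (∀ (τ' : E →+* ℂ) (y : (F →+* ℝ) → ℝ), (∀ σ, 0 < y σ) →
      Summable (fun ν : {ν : F | ∀ b : 𝓞 F, ∃ n : ℤ, Algebra.trace ℚ F (ν * b) = n} ↦
        ‖τ' (c ν)‖ * Real.exp (-(2 * Real.pi * ∑ σ : F →+* ℝ, σ (ν : F) * y σ)))) →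
    KatzHyp F 𝔫 (Module.finrank ℚ F) idx enc E τ p v k c →
  (∃ 𝔪 : Ideal (𝓞 F), 𝔪 ≠ ⊥ ∧
    (halfSpace F).indicator (fun z ↦
      ∑' ν : {ν : F | ∀ b : 𝓞 F, ∃ n : ℤ, Algebra.trace ℚ F (ν * b) = n},
        τ (c ν) * cexp (2 * Real.pi * I * pairing (ν : F) z)) ∈ modularForms (Bianchi.Gamma1 𝔪) k) ∧
  ∀ ν : F, (∀ b : 𝓞 F, ∃ n : ℤ, Algebra.trace ℚ F (ν * b) = n) → ∀ y : (F →+* ℝ) → ℝ, (∀ σ, 0 < y σ) →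
    fourierCoeffAt ((halfSpace F).indicator (fun z ↦
      ∑' ν : {ν : F | ∀ b : 𝓞 F, ∃ n : ℤ, Algebra.trace ℚ F (ν * b) = n},
        τ (c ν) * cexp (2 * Real.pi * I * pairing (ν : F) z))) ν y = τ (c ν)

/-- **The typed crux from the three items** (through the landed endpoint `hilbertClassicalityModuloNamedFacts` and the landed reduction
`hcm_sturmSupNorm_of_modP`; real proof). -/
theorem TypedCrux_of_items (h1 : ItemSturmModP) (h2 : ItemBoundedDenominators) (h3 : ItemSupply) : TypedCrux := by
  intro F _ _ _ hd 𝔫 h𝔫 E _ _ τ hE p _ v idx α enc hadm k hk c hc_int hc_supp harch_c hKatz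
  obtain ⟨hd1, hα, hinj, hadd, htrace, henc⟩ := hadm
  obtain ⟨L, cS, hL, hmodp⟩ := h1 F hd 𝔫 h𝔫 α hα E τ p v
  refine Summit.Langlands.Langlands.Theorems.HilbertIntegralOverconvergentIsCongruence.hilbertClassicalityModuloNamedFacts
    F hd 𝔫 h𝔫 E τ p v _ idx α enc hd1 hα hinj hadd htrace henc ⟨L, cS, hL, fun b f hf q hq B hB hwin ↦ ?_⟩ k
    (h3 F hd 𝔫 h𝔫 E τ hE k hk) c hc_int hc_supp harch_c hKatz
  exact Summit.Langlands.Langlands.Theorems.HilbertIntegralOverconvergentIsCongruence.hcm_sturmSupNorm_of_modP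
    F 𝔫 α E τ p v L hmodp (h2 F hd 𝔫 h𝔫 E τ p v) b f hf q hq B hB hwin

end Final

/-!
# § U — RESHAPE 17 (lead c7): NAMED FACT (ii) FROM ONE SEED FORM (`Seed.SupplyFromSeed`)

Lead c6 closed the typed crux `Final.TypedCrux` from THREE items; two of them, (i′) `Final.ItemSturmModP` and (i″)
`Final.ItemBoundedDenominators`, are honest `q`-expansion-principle / intersection-theory facts (Takai 2013 for all `[F:ℚ]`,
Burgos Gil–Pacetti 2017; Rapoport, Andreatta–Goren), but (ii) `Final.ItemSupply` — `[F:ℚ] + 1` forms of one weight with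
linearly independent monomials (algebraic independence, the Krull dimension of the ring of Hilbert modular forms) — is far
stronger than needed.  This section derives the supply `Final.SupplyHyp` from ONE **seed form** `s` (any level `Γ₁(𝔫₀)`, any
weight `w₀`, `a₀(s) = 0`, `s ≢ 0` on `ℍ`, rational-integer coefficients) and the **shift form** `G'` of weight `w₀ - k`:

* the `d + 1` forms are the `V_δ`-IMAGES `gf_l(z) = s(δ_l z)`, `δ_l = M + ω_l ∈ 𝓞 F` totally positive (`ω_0 = 0`,
  `ω_1, …, ω_d` the integral basis, `M ≫ 0`): modular of the same weight for `Γ₁(𝔫₀ δ_l)` (stub U1 — transformation law by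
  conjugating `(a b; c d) ↦ (a, δb; c/δ, d)`, cusps by the landed Koecher principle), with coefficients
  `a_μ(gf_l) = a_{μ/δ_l}(s)` (stub U2, from the landed Fourier expansion and coefficient uniqueness) — still integers;
* INDEPENDENCE OF MONOMIALS by LEADING EXPONENTS: for a generic height `λ(ν) = ∑_σ y_σ σ(ν)`, `y ≫ 0`, injective on `F`
  (stub U3, Baire), leading exponents of cone-supported `q`-expansions add under the landed product formula (stub U4);
  for `M ≫ 0` the leading exponent of `s(δ_l z)` is `δ_l ν*`, `ν*` the leading exponent of `s` (stub U5, a perturbation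
  estimate using `a₀(s) = 0`); so the monomial `∏_l gf_l^{e_l}` of degree `m` leads with `(mM + ∑_l e_l ω_l) ν*`, pairwise
  distinct in `e` because `ω_1, …, ω_d` is a `ℚ`-basis — and functions with pairwise distinct leading exponents are linearly
  independent (stub U6);
* the shift form `G'` is used as is; the level becomes `𝔫' = 𝔫₀ ∏_l (δ_l)`.

Consequences (this section's coda): `Seed.TypedCrux_of_seedItems : ItemSturmModP → ItemBoundedDenominators → ItemSeedSupply →
TypedCrux`, where `ItemSeedSupply` asks, for each paritious `k`, only for a seed `s` and a shift form of weight `w(s) - k`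
(for PARALLEL `k` divisible by the seed weight the shift form is a power of the seed or the unit form — wave 2).
Disproof.lean: none exists for this crux (re-checked by lead c7, 2026-08-17T01:45Z).
-/

namespace Seed

/-- **Seed data** (§ U): a SEED FORM `s` of weight `w₀` and level `Γ₁(𝔫₀)` — vanishing at `∞` (`a₀(s) = 0`), not identically
zero on `ℍ`, with rational-integer Fourier coefficients on the cone — and a SHIFT FORM `G` of weight `w₀ - k` and the same
level, non-zero on `ℍ`, whose Fourier coefficients on the cone are `τ`-images of an `𝓞_E`-integral `qG : F → E` with `q`-series
absolutely convergent on the whole tube under every complex embedding of `E` (the `G`-clauses of `Final.SupplyHyp`). -/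
def SeedData (F : Type) [Field F] [NumberField F] (𝔫₀ : Ideal (𝓞 F)) (E : Type) [Field E] (τ : E →+* ℂ)
    (k w₀ : (F →+* ℝ) → ℤ) (s G : Point F → ℂ) : Prop :=
  s ∈ modularForms (Bianchi.Gamma1 𝔫₀) w₀ ∧ fourierCoeff s 0 = 0 ∧ (∃ z ∈ halfSpace F, s z ≠ 0) ∧
    (∃ zc : F → ℤ, ∀ ν ∈ qIndexSet F, fourierCoeff s ν = (zc ν : ℂ)) ∧
    G ∈ modularForms (Bianchi.Gamma1 𝔫₀) (w₀ - k) ∧ (∃ z ∈ halfSpace F, G z ≠ 0) ∧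
    ∃ qG : F → E, (∀ ν ∈ qIndexSet F, fourierCoeff G ν = τ (qG ν)) ∧ (∀ ν, IsIntegral ℤ (qG ν)) ∧
      ∀ (τ' : E →+* ℂ) (y : (F →+* ℝ) → ℝ), (∀ σ, 0 < y σ) →
        Summable (fun ν : {ν : F | ∀ b : 𝓞 F, ∃ n : ℤ, Algebra.trace ℚ F (ν * b) = n} ↦
          ‖τ' (qG ν)‖ * Real.exp (-(2 * Real.pi * ∑ σ : F →+* ℝ, σ (ν : F) * y σ)))

/-- **`SupplyFromSeed`** — the target of RESHAPE 17: over a totally real `F` of degree `≥ 2`, seed data at level `Γ₁(𝔫₀)` give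
named fact (ii) `Final.SupplyHyp` with `d = [F:ℚ]` at some level `𝔫' ⊆ 𝔫₀`, `𝔫' ≠ 0`. -/
def SupplyFromSeed : Prop :=
  ∀ (F : Type) [Field F] [NumberField F] [NumberField.IsTotallyReal F], 1 < Module.finrank ℚ F →
  ∀ (𝔫₀ : Ideal (𝓞 F)), 𝔫₀ ≠ ⊥ →
  ∀ (E : Type) [Field E] [NumberField E] (τ : E →+* ℂ) (k w₀ : (F →+* ℝ) → ℤ) (s G : Point F → ℂ),
    SeedData F 𝔫₀ E τ k w₀ s G →
  ∃ 𝔫' : Ideal (𝓞 F), 𝔫' ≠ ⊥ ∧ 𝔫' ≤ 𝔫₀ ∧ Final.SupplyHyp F 𝔫' (Module.finrank ℚ F) E τ k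

end Seed

namespace Stubs

/-- **stub U1 — `stub_smulArg_modular` (LANDED p138032; M; the `V_δ` operator).** For a totally positive `δ ∈ 𝓞 F` and … (abridged; see the landed file). [folklore] -/
theorem stub_smulArg_modular (F : Type) [Field F] [NumberField F] [NumberField.IsTotallyReal F]
    (hd : 1 < Module.finrank ℚ F) (𝔫 : Ideal (𝓞 F)) (h𝔫 : 𝔫 ≠ ⊥) (k : (F →+* ℝ) → ℤ) (f : Point F → ℂ)
    (hf : f ∈ modularForms (Bianchi.Gamma1 𝔫) k) (δ : 𝓞 F) (hδ : ∀ σ : F →+* ℝ, 0 < σ (δ : F)) :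
    (fun z : Point F ↦ f (fun σ ↦ ((σ (δ : F) : ℝ) : ℂ) * z σ)) ∈
      modularForms (Bianchi.Gamma1 (𝔫 * Ideal.span {δ})) k :=
  Summit.Langlands.Langlands.Theorems.HilbertIntegralOverconvergentIsCongruence.stub_smulArg_modular F hd 𝔫 h𝔫 k f hf δ hδ

/-- **stub U2 — `stub_smulArg_fourierCoeff` (LANDED p137692; M; Fourier coefficients of `f(δz)`).** For `F` totally real, `f` holomorphic and … (abridged; see the landed file). [folklore] -/
theorem stub_smulArg_fourierCoeff (F : Type) [Field F] [NumberField F] [NumberField.IsTotallyReal F]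
    (f : Point F → ℂ) (hf : IsHolomorphicOn F f)
    (hper : ∀ (a : 𝓞 F) (z : Point F), z ∈ halfSpace F → f (fun σ ↦ z σ + ((σ (a : F) : ℝ) : ℂ)) = f z)
    (δ : 𝓞 F) (hδ : ∀ σ : F →+* ℝ, 0 < σ (δ : F)) (μ : F)
    (hμ : ∀ a : 𝓞 F, ∃ n : ℤ, Algebra.trace ℚ F (μ * a) = n) :
    ((∀ a : 𝓞 F, ∃ n : ℤ, Algebra.trace ℚ F (μ / (δ : F) * a) = n) →
      fourierCoeff (fun z : Point F ↦ f (fun σ ↦ ((σ (δ : F) : ℝ) : ℂ) * z σ)) μ = fourierCoeff f (μ / (δ : F))) ∧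
    ((¬ ∀ a : 𝓞 F, ∃ n : ℤ, Algebra.trace ℚ F (μ / (δ : F) * a) = n) →
      fourierCoeff (fun z : Point F ↦ f (fun σ ↦ ((σ (δ : F) : ℝ) : ℂ) * z σ)) μ = 0) :=
  Summit.Langlands.Langlands.Theorems.HilbertIntegralOverconvergentIsCongruence.stub_smulArg_fourierCoeff F f hf hper δ hδ μ hμ

/-- **stub U3 — `stub_generic_height` (LANDED p137671; S; a height injective on `F`).** Over a totally real `F` there is `y ≫ 0` with `ν ↦ ∑_σ y_σ σ(ν)` injective on `F`: for `ν ≠ 0` every `σ(ν) ≠ 0`, so `{y : ∑ y_σ σ(ν) = 0}` is a closed proper hyperplane of … (abridged; see the landed file). [folklore] -/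
theorem stub_generic_height (F : Type) [Field F] [NumberField F] [NumberField.IsTotallyReal F] :
    ∃ y : (F →+* ℝ) → ℝ, (∀ σ, 0 < y σ) ∧ Function.Injective (fun ν : F ↦ ∑ σ : F →+* ℝ, y σ * σ ν) :=
  Summit.Langlands.Langlands.Theorems.HilbertIntegralOverconvergentIsCongruence.stub_generic_height F

/-- **stub U4 — `stub_lead_convolution` (LANDED p137562; S; leading exponents add).** `λ : F → ℝ` additive and injective; `a, b : F → ℂ` supported on the cone `qIndexSet F` with `λ`-minimal support points `νa`, `νb`; `c` the cone convolution of `a` and `b` (`c ν = … (abridged; see the landed file). [folklore] -/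
theorem stub_lead_convolution (F : Type) [Field F] [NumberField F] [NumberField.IsTotallyReal F]
    (lam : F →+ ℝ) (hlam : Function.Injective lam) (a b c : F → ℂ)
    (ha : ∀ ν, a ν ≠ 0 → ν ∈ qIndexSet F) (hb : ∀ ν, b ν ≠ 0 → ν ∈ qIndexSet F)
    (hc : ∀ (ν : F) (T : Finset (F × F)),
      (∀ μ : F × F, μ ∈ T ↔ μ.1 ∈ qIndexSet F ∧ μ.2 ∈ qIndexSet F ∧ μ.1 + μ.2 = ν) →
      c ν = ∑ μ ∈ T, a μ.1 * b μ.2)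
    (νa νb : F) (hνa : a νa ≠ 0) (hνb : b νb ≠ 0)
    (hmina : ∀ ν, a ν ≠ 0 → lam νa ≤ lam ν) (hminb : ∀ ν, b ν ≠ 0 → lam νb ≤ lam ν) :
    c (νa + νb) = a νa * b νb ∧ ∀ ν, c ν ≠ 0 → lam (νa + νb) ≤ lam ν :=
  Summit.Langlands.Langlands.Theorems.HilbertIntegralOverconvergentIsCongruence.stub_lead_convolution F lam hlam a b c ha hb hc νa νb hνa hνb hmina hminb

/-- **stub U5 — `stub_lead_perturb` (LANDED p137780; M; the leading exponent of `s(δz)` for `δ = M + ω`, `M ≫ 0`).** `y ≫ 0` a height, … (abridged; see the landed file). [folklore] -/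
theorem stub_lead_perturb (F : Type) [Field F] [NumberField F] [NumberField.IsTotallyReal F]
    (y : (F →+* ℝ) → ℝ) (hy : ∀ σ, 0 < y σ) (S : Set F) (hS : ∀ ν ∈ S, ∀ σ : F →+* ℝ, 0 < σ ν)
    (hSfin : ∀ t : ℝ, {ν : F | ν ∈ S ∧ ∑ σ : F →+* ℝ, y σ * σ ν ≤ t}.Finite)
    (νs : F) (hνs : νs ∈ S)
    (hmin : ∀ ν ∈ S, ν ≠ νs → ∑ σ : F →+* ℝ, y σ * σ νs < ∑ σ : F →+* ℝ, y σ * σ ν)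
    (Ω : Finset F) :
    ∃ M₀ : ℕ, ∀ M : ℕ, M₀ ≤ M → ∀ ω ∈ Ω,
      (∀ σ : F →+* ℝ, 0 < σ ((M : F) + ω)) ∧
      ∀ ν ∈ S, ν ≠ νs →
        ∑ σ : F →+* ℝ, y σ * σ (((M : F) + ω) * νs) < ∑ σ : F →+* ℝ, y σ * σ (((M : F) + ω) * ν) :=
  Summit.Langlands.Langlands.Theorems.HilbertIntegralOverconvergentIsCongruence.stub_lead_perturb F y hy S hS hSfin νs hνs hmin Ω

/-- **stub U6 — `stub_distinct_lead_indep` (LANDED p137555; S; distinct leading exponents ⇒ linear independence).** Coefficient functions `A e : X → ℂ` (`e` in a finite index type) with pairwise distinct LEADING POINTS `lead e` — `A e (lead e) ≠ 0` and `A e ν ≠ 0 ⇒ λ(lead e) ≤ λ ν` for an … (abridged; see the landed file). [folklore] -/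
theorem stub_distinct_lead_indep {X ι : Type} [Fintype ι] (lam : X → ℝ) (hlam : Function.Injective lam)
    (A : ι → X → ℂ) (lead : ι → X) (hlead : Function.Injective lead)
    (hlc : ∀ e, A e (lead e) ≠ 0) (hmin : ∀ e ν, A e ν ≠ 0 → lam (lead e) ≤ lam ν)
    (κ : ι → ℂ) (hrel : ∀ ν, ∑ e, κ e * A e ν = 0) : ∀ e, κ e = 0 :=
  Summit.Langlands.Langlands.Theorems.HilbertIntegralOverconvergentIsCongruence.stub_distinct_lead_indep lam hlam A lead hlead hlc hmin κ hrel

/-- **stub U8 — `stub_supplyFromSeed` (the lead's composition; content LANDED as `…Theorems….supplyFromSeed`, parts p138918 p138967).** Seed data at level `Γ₁(𝔫₀)` over a totally real `F` of degree `d ≥ 2` give the supply `Final.SupplyHyp F 𝔫' d E τ k` at the level `𝔫' = 𝔫₀ ∏_l (δ_l)`: the forms `gf_l = s(δ_l ·)` … (abridged; see the landed file). [folklore] -/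
theorem stub_supplyFromSeed (F : Type) [Field F] [NumberField F] [NumberField.IsTotallyReal F]
    (hd : 1 < Module.finrank ℚ F) (𝔫₀ : Ideal (𝓞 F)) (h𝔫₀ : 𝔫₀ ≠ ⊥)
    (E : Type) [Field E] [NumberField E] (τ : E →+* ℂ) (k w₀ : (F →+* ℝ) → ℤ) (s G : Point F → ℂ)
    (hseed : Seed.SeedData F 𝔫₀ E τ k w₀ s G) :
    ∃ 𝔫' : Ideal (𝓞 F), 𝔫' ≠ ⊥ ∧ 𝔫' ≤ 𝔫₀ ∧ Final.SupplyHyp F 𝔫' (Module.finrank ℚ F) E τ k := by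
  obtain ⟨hs, hs0, hsz, ⟨zc, hzc⟩, hG, hG0, qG, hcG, hiG, haG⟩ := hseed
  exact Summit.Langlands.Langlands.Theorems.HilbertIntegralOverconvergentIsCongruence.supplyFromSeed F hd 𝔫₀ h𝔫₀ E τ k w₀ s G
    hs hs0 hsz zc hzc hG hG0 qG hcG hiG haG

end Stubs

namespace Seed

/-- Statement of stub U1, by name. -/
def stub_smulArg_modular : Prop := type_of% Stubs.stub_smulArg_modular
/-- Statement of stub U2, by name. -/
def stub_smulArg_fourierCoeff : Prop := type_of% Stubs.stub_smulArg_fourierCoeff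
/-- Statement of stub U3, by name. -/
def stub_generic_height : Prop := type_of% Stubs.stub_generic_height
/-- Statement of stub U4, by name. -/
def stub_lead_convolution : Prop := type_of% Stubs.stub_lead_convolution
/-- Statement of stub U5, by name. -/
def stub_lead_perturb : Prop := type_of% Stubs.stub_lead_perturb
/-- Statement of stub U6, by name. -/
def stub_distinct_lead_indep : Prop := type_of% @Stubs.stub_distinct_lead_indep
/-- Statement of stub U8 (the lead's composition), by name. -/
def stub_supplyFromSeed : Prop := type_of% Stubs.stub_supplyFromSeed

section Composition

/-- **RESHAPE 17 from the stubs**: `SupplyFromSeed` is the composition stub U8, which the lead proves from the LANDED stubs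
U1–U6 (`stub_smulArg_modular`, `stub_smulArg_fourierCoeff`, `stub_generic_height`, `stub_lead_convolution`, `stub_lead_perturb`,
`stub_distinct_lead_indep` — discharged inside U8's proof, so they are no longer hypotheses here). -/
theorem SupplyFromSeed_of (hU8 : stub_supplyFromSeed) : SupplyFromSeed :=
  fun F _ _ _ hd 𝔫₀ h𝔫₀ E _ _ τ k w₀ s G hseed ↦ hU8 F hd 𝔫₀ h𝔫₀ E τ k w₀ s G hseed

/-- Feeding the composition the stub itself. -/
theorem SupplyFromSeed_proof : SupplyFromSeed :=
  SupplyFromSeed_of Stubs.stub_supplyFromSeed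

end Composition

/-! ### § U coda: the typed crux from (i′), (i″) and the SEED item -/

/-- `Γ₁` is monotone in the ideal: `𝔞 ≤ 𝔟 ⇒ Γ₁(𝔞) ≤ Γ₁(𝔟)`. [folklore] -/
theorem gamma1_mono {R : Type} [CommRing R] {𝔞 𝔟 : Ideal R} (h : 𝔞 ≤ 𝔟) : Bianchi.Gamma1 𝔞 ≤ Bianchi.Gamma1 𝔟 :=
  fun _ hγ ↦ ⟨h hγ.1, h hγ.2⟩

/-- Named fact (ii) is inherited by smaller levels. [folklore] -/
theorem supplyHyp_mono {F : Type} [Field F] [NumberField F] {𝔫 𝔫' : Ideal (𝓞 F)} (h : 𝔫' ≤ 𝔫) {d : ℕ}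
    {E : Type} [Field E] {τ : E →+* ℂ} {k : (F →+* ℝ) → ℤ} (hS : Final.SupplyHyp F 𝔫 d E τ k) :
    Final.SupplyHyp F 𝔫' d E τ k := by
  obtain ⟨w₀, gf, qg, G, qG, hgf, hG, hG0, hcg, hcG, hig, hiG, hag, haG, hind⟩ := hS
  exact ⟨w₀, gf, qg, G, qG, fun l ↦ modularForms_mono (gamma1_mono h) _ (hgf l),
    modularForms_mono (gamma1_mono h) _ hG, hG0, hcg, hcG, hig, hiG, hag, haG, hind⟩

/-- Hypothesis (iii) is inherited by smaller levels (the graded family grows). [folklore] -/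
theorem katzHyp_mono {F : Type} [Field F] [NumberField F] {𝔫 𝔫' : Ideal (𝓞 F)} (h : 𝔫' ≤ 𝔫) {d : ℕ}
    {idx : F → (Fin d →₀ ℕ)} {enc : (Point F → ℂ) → MvPowerSeries (Fin d) ℂ} {E : Type} [Field E] {τ : E →+* ℂ}
    {p : ℕ} [Fact p.Prime] {v : E →+* PadicAlgCl p} {k : (F →+* ℝ) → ℤ} {c : F → E}
    (hK : Final.KatzHyp F 𝔫 d idx enc E τ p v k c) : Final.KatzHyp F 𝔫' d idx enc E τ p v k c := by
  obtain ⟨t, e, a, ρ, C, ht, he, he1, hen, ha, hρ0, hρ1, hC, han, hsum, hsum0⟩ := hK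
  have hmono : ∀ b : (F →+* ℝ) → ℤ,
      {ψ : MvPowerSeries (Fin d) (PadicAlgCl p) | ∃ (A : MvPowerSeries (Fin d) E) (f : Point F → ℂ),
        f ∈ modularForms (Bianchi.Gamma1 𝔫) b ∧ MvPowerSeries.map τ A = enc f ∧ ψ = MvPowerSeries.map v A} ⊆
      {ψ | ∃ (A : MvPowerSeries (Fin d) E) (f : Point F → ℂ),
        f ∈ modularForms (Bianchi.Gamma1 𝔫') b ∧ MvPowerSeries.map τ A = enc f ∧ ψ = MvPowerSeries.map v A} := by
    rintro b ψ ⟨A, f, hf, hA, hψ⟩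
    exact ⟨A, f, modularForms_mono (gamma1_mono h) _ hf, hA, hψ⟩
  exact ⟨t, e, a, ρ, C, ht, Submodule.span_mono (hmono t) he, he1, hen,
    fun i ↦ Submodule.span_mono (hmono _) (ha i), hρ0, hρ1, hC, han, hsum, hsum0⟩

/-- ITEM (ii-seed) — **the seed supply**, universally closed over PARITIOUS weights `k` and coefficient fields `E ⊇ F^{gal}`
(through `τ`): some level `𝔫₀ ≠ 0` carries a seed form `s` and a shift form `G` of weight `w(s) - k` (`SeedData`).  It replaces
`Final.ItemSupply`. -/
def ItemSeedSupply : Prop :=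
  ∀ (F : Type) [Field F] [NumberField F] [NumberField.IsTotallyReal F], 1 < Module.finrank ℚ F →
  ∀ (E : Type) [Field E] [NumberField E] (τ : E →+* ℂ), (∀ σ : F →+* ℂ, ∃ ι : F →+* E, τ.comp ι = σ) →
  ∀ (k : (F →+* ℝ) → ℤ), (∀ σ σ' : F →+* ℝ, Even (k σ - k σ')) →
  ∃ 𝔫₀ : Ideal (𝓞 F), 𝔫₀ ≠ ⊥ ∧ ∃ (w₀ : (F →+* ℝ) → ℤ) (s G : Point F → ℂ), SeedData F 𝔫₀ E τ k w₀ s G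

/-- **The typed crux from (i′), (i″) and the seed item** (through `SupplyFromSeed`, the landed endpoint
`hilbertClassicalityModuloNamedFacts` at the common level `𝔫 · 𝔫'`, and the landed reduction `hcm_sturmSupNorm_of_modP`;
real proof). -/
theorem TypedCrux_of_seedItems (h1 : Final.ItemSturmModP) (h2 : Final.ItemBoundedDenominators) (h3 : ItemSeedSupply)
    (hU : SupplyFromSeed) : Final.TypedCrux := by
  intro F _ _ _ hd 𝔫 h𝔫 E _ _ τ hE p _ v idx α enc hadm k hk c hc_int hc_supp harch_c hKatz
  obtain ⟨hd1, hα, hinj, hadd, htrace, henc⟩ := hadm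
  obtain ⟨𝔫₀, h𝔫₀, w₀, s, G, hseed⟩ := h3 F hd E τ hE k hk
  obtain ⟨𝔫', h𝔫', -, hSup⟩ := hU F hd 𝔫₀ h𝔫₀ E τ k w₀ s G hseed
  have h𝔫𝔫' : 𝔫 * 𝔫' ≠ ⊥ := Ideal.mul_eq_bot.not.mpr (not_or.mpr ⟨h𝔫, h𝔫'⟩)
  obtain ⟨L, cS, hL, hmodp⟩ := h1 F hd (𝔫 * 𝔫') h𝔫𝔫' α hα E τ p v
  refine Summit.Langlands.Langlands.Theorems.HilbertIntegralOverconvergentIsCongruence.hilbertClassicalityModuloNamedFacts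
    F hd (𝔫 * 𝔫') h𝔫𝔫' E τ p v _ idx α enc hd1 hα hinj hadd htrace henc ⟨L, cS, hL, fun b f hf q hq B hB hwin ↦ ?_⟩ k
    (supplyHyp_mono Ideal.mul_le_left hSup) c hc_int hc_supp harch_c (katzHyp_mono Ideal.mul_le_right hKatz)
  exact Summit.Langlands.Langlands.Theorems.HilbertIntegralOverconvergentIsCongruence.hcm_sturmSupNorm_of_modP
    F (𝔫 * 𝔫') α E τ p v L hmodp (h2 F hd (𝔫 * 𝔫') h𝔫𝔫' E τ p v) b f hf q hq B hB hwin

/-- The same with this section's composition fed in: the typed crux from the THREE ITEMS (i′), (i″), (ii-seed). -/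
theorem TypedCrux_of_seedItems' (h1 : Final.ItemSturmModP) (h2 : Final.ItemBoundedDenominators) (h3 : ItemSeedSupply) :
    Final.TypedCrux :=
  TypedCrux_of_seedItems h1 h2 h3 SupplyFromSeed_proof

end Seed

/-!
## § U wave 2 (lead c7): seeds for PARALLEL weights — powers, non-constant forms, and the parallel-weight typed crux

For a weight `k` that is an integer multiple of the seed's weight `w₀` the shift form is a power of the seed or the
unit form `1_ℍ`, so `SeedData` needs the seed alone (stubs U7 `stub_seed_pow`, U10 `stub_seedData_multiple`); and a
seed is obtained from ANY non-constant form `h` with integer coefficients as `h - h(2·)` (stub U9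
`stub_seed_of_nonconstant`).  Coda: `Seed.TypedCruxParallel_of_items` — the typed crux for all weights `k = i·w·𝟙`
from (i′), (i″) and ONE non-constant Hilbert modular form of parallel weight `w` with integer Fourier coefficients
(for `w = 2`: `θ⁴` of level `4`, or a denominator-cleared Eisenstein series `E₂`, which is holomorphic exactly when
`[F:ℚ] ≥ 2`).
-/

namespace Stubs

/-- **stub U7 — `stub_seed_pow` (LANDED p139467; M; powers of a seed are seeds).** For a seed form `s ∈ M_w(Γ₁(𝔫))` (`a₀(s) = 0`, `s ≢ 0` on `ℍ`, integer coefficients on the cone) and `i ≥ 1`, the power `s^i` lies in `M_{i•w}(Γ₁(𝔫))` (`mul_mem_modularForms`), … (abridged; see the landed file). [folklore] -/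
theorem stub_seed_pow (F : Type) [Field F] [NumberField F] [NumberField.IsTotallyReal F]
    (hd : 1 < Module.finrank ℚ F) (𝔫 : Ideal (𝓞 F)) (h𝔫 : 𝔫 ≠ ⊥) (w : (F →+* ℝ) → ℤ) (s : Point F → ℂ)
    (hs : s ∈ modularForms (Bianchi.Gamma1 𝔫) w) (hs0 : ∃ z ∈ halfSpace F, s z ≠ 0)
    (hcusp : fourierCoeff s 0 = 0) (zc : F → ℤ) (hzc : ∀ ν ∈ qIndexSet F, fourierCoeff s ν = (zc ν : ℂ))
    (i : ℕ) (hi : 1 ≤ i) :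
    s ^ i ∈ modularForms (Bianchi.Gamma1 𝔫) (i • w) ∧ (∃ z ∈ halfSpace F, (s ^ i) z ≠ 0) ∧
      fourierCoeff (s ^ i) 0 = 0 ∧ ∃ zi : F → ℤ, ∀ ν ∈ qIndexSet F, fourierCoeff (s ^ i) ν = (zi ν : ℂ) :=
  Summit.Langlands.Langlands.Theorems.HilbertIntegralOverconvergentIsCongruence.stub_seed_pow F hd 𝔫 h𝔫 w s hs hs0 hcusp zc hzc i hi

/-- **stub U9 — `stub_seed_of_nonconstant` (LANDED p139848; M; a seed from a non-constant form).** For `h ∈ M_w(Γ₁(𝔫))` with integer coefficients on the cone and some non-zero coefficient at a non-zero index, `s(z) := h(z) - h(2z)` is a seed form of level `Γ₁(2𝔫)`: modular (U1 … (abridged; see the landed file). [folklore] -/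
theorem stub_seed_of_nonconstant (F : Type) [Field F] [NumberField F] [NumberField.IsTotallyReal F]
    (hd : 1 < Module.finrank ℚ F) (𝔫 : Ideal (𝓞 F)) (h𝔫 : 𝔫 ≠ ⊥) (w : (F →+* ℝ) → ℤ) (h : Point F → ℂ)
    (hh : h ∈ modularForms (Bianchi.Gamma1 𝔫) w) (zc : F → ℤ)
    (hzc : ∀ ν ∈ qIndexSet F, fourierCoeff h ν = (zc ν : ℂ))
    (hnc : ∃ ν ∈ qIndexSet F, ν ≠ 0 ∧ fourierCoeff h ν ≠ 0) :
    (fun z : Point F ↦ h z - h (fun σ ↦ ((σ ((2 : 𝓞 F) : F) : ℝ) : ℂ) * z σ)) ∈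
        modularForms (Bianchi.Gamma1 (𝔫 * Ideal.span {(2 : 𝓞 F)})) w ∧
      fourierCoeff (fun z : Point F ↦ h z - h (fun σ ↦ ((σ ((2 : 𝓞 F) : F) : ℝ) : ℂ) * z σ)) 0 = 0 ∧
      (∃ z ∈ halfSpace F, (fun z : Point F ↦ h z - h (fun σ ↦ ((σ ((2 : 𝓞 F) : F) : ℝ) : ℂ) * z σ)) z ≠ 0) ∧
      ∃ zs : F → ℤ, ∀ ν ∈ qIndexSet F,
        fourierCoeff (fun z : Point F ↦ h z - h (fun σ ↦ ((σ ((2 : 𝓞 F) : F) : ℝ) : ℂ) * z σ)) ν = (zs ν : ℂ) :=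
  Summit.Langlands.Langlands.Theorems.HilbertIntegralOverconvergentIsCongruence.stub_seed_of_nonconstant F hd 𝔫 h𝔫 w h hh zc hzc hnc

/-- **stub U10 — `stub_seedData_multiple` (LANDED p139482; S; seed data at the multiples of the seed weight).** Given the powers of a seed form `s` of weight `w₀` and level `Γ₁(𝔫₀)` (hypothesis `hpow`, the output of U7), for every `i ∈ ℤ` there are seed data for the weight `k = i • w₀`: for … (abridged; see the landed file). [folklore] -/
theorem stub_seedData_multiple (F : Type) [Field F] [NumberField F] [NumberField.IsTotallyReal F]
    (𝔫₀ : Ideal (𝓞 F)) (E : Type) [Field E] [NumberField E] (τ : E →+* ℂ)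
    (w₀ : (F →+* ℝ) → ℤ) (s : Point F → ℂ)
    (hpow : ∀ j : ℕ, 1 ≤ j → s ^ j ∈ modularForms (Bianchi.Gamma1 𝔫₀) (j • w₀) ∧
      (∃ z ∈ halfSpace F, (s ^ j) z ≠ 0) ∧ fourierCoeff (s ^ j) 0 = 0 ∧
      ∃ zj : F → ℤ, ∀ ν ∈ qIndexSet F, fourierCoeff (s ^ j) ν = (zj ν : ℂ))
    (i : ℤ) :
    ∃ (w₁ : (F →+* ℝ) → ℤ) (s₁ G : Point F → ℂ),
      s₁ ∈ modularForms (Bianchi.Gamma1 𝔫₀) w₁ ∧ fourierCoeff s₁ 0 = 0 ∧ (∃ z ∈ halfSpace F, s₁ z ≠ 0) ∧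
      (∃ zc₁ : F → ℤ, ∀ ν ∈ qIndexSet F, fourierCoeff s₁ ν = (zc₁ ν : ℂ)) ∧
      G ∈ modularForms (Bianchi.Gamma1 𝔫₀) (w₁ - i • w₀) ∧ (∃ z ∈ halfSpace F, G z ≠ 0) ∧
      ∃ qG : F → E, (∀ ν ∈ qIndexSet F, fourierCoeff G ν = τ (qG ν)) ∧ (∀ ν, IsIntegral ℤ (qG ν)) ∧
        ∀ (τ' : E →+* ℂ) (y : (F →+* ℝ) → ℝ), (∀ σ, 0 < y σ) →
          Summable (fun ν : {ν : F | ∀ b : 𝓞 F, ∃ n : ℤ, Algebra.trace ℚ F (ν * b) = n} ↦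
            ‖τ' (qG ν)‖ * Real.exp (-(2 * Real.pi * ∑ σ : F →+* ℝ, σ (ν : F) * y σ))) :=
  Summit.Langlands.Langlands.Theorems.HilbertIntegralOverconvergentIsCongruence.stub_seedData_multiple F 𝔫₀ E τ w₀ s hpow i

end Stubs

namespace Seed

/-- Statement of stub U7, by name. -/
def stub_seed_pow : Prop := type_of% Stubs.stub_seed_pow
/-- Statement of stub U9, by name. -/
def stub_seed_of_nonconstant : Prop := type_of% Stubs.stub_seed_of_nonconstant
/-- Statement of stub U10, by name. -/
def stub_seedData_multiple : Prop := type_of% Stubs.stub_seedData_multiple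

/-- ITEM (ii-w) — **one non-constant Hilbert modular form of parallel weight `w` with integer coefficients** over every
totally real `F` of degree `≥ 2` (for `w = 2`: `θ⁴`, level `4`; or a denominator-cleared Eisenstein series `E₂`). -/
def ItemNonconstantForm (w : ℤ) : Prop :=
  ∀ (F : Type) [Field F] [NumberField F] [NumberField.IsTotallyReal F], 1 < Module.finrank ℚ F →
  ∃ 𝔫 : Ideal (𝓞 F), 𝔫 ≠ ⊥ ∧ ∃ (h : Point F → ℂ) (zc : F → ℤ),
    h ∈ modularForms (Bianchi.Gamma1 𝔫) (fun _ ↦ w) ∧ (∀ ν ∈ qIndexSet F, fourierCoeff h ν = (zc ν : ℂ)) ∧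
    ∃ ν ∈ qIndexSet F, ν ≠ 0 ∧ fourierCoeff h ν ≠ 0

/-- **The typed crux for the PARALLEL weights `k = i·w·𝟙`** (same binders as `Final.TypedCrux`, the parity hypothesis
replaced by `k ∈ ℤ·w·𝟙`; for `w = 2` this is every parallel even weight, for `w = 1` every parallel weight). -/
def TypedCruxParallel (w : ℤ) : Prop :=
  ∀ (F : Type) [Field F] [NumberField F] [NumberField.IsTotallyReal F], 1 < Module.finrank ℚ F →
  ∀ (𝔫 : Ideal (𝓞 F)), 𝔫 ≠ ⊥ →
  ∀ (E : Type) [Field E] [NumberField E] (τ : E →+* ℂ), (∀ σ : F →+* ℂ, ∃ ι : F →+* E, τ.comp ι = σ) →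
  ∀ (p : ℕ) [Fact p.Prime] (v : E →+* PadicAlgCl p)
    (idx : F → (Fin (Module.finrank ℚ F) →₀ ℕ)) (α : F) (enc : (Point F → ℂ) → MvPowerSeries (Fin (Module.finrank ℚ F)) ℂ),
    Final.Admissible F (Module.finrank ℚ F) idx α enc →
  ∀ (k : (F →+* ℝ) → ℤ), (∃ i : ℤ, k = fun _ ↦ i * w) →
  ∀ (c : F → E), (∀ ν, IsIntegral ℤ (c ν)) → (∀ ν ∉ qIndexSet F, c ν = 0) →
    (∀ (τ' : E →+* ℂ) (y : (F →+* ℝ) → ℝ), (∀ σ, 0 < y σ) →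
      Summable (fun ν : {ν : F | ∀ b : 𝓞 F, ∃ n : ℤ, Algebra.trace ℚ F (ν * b) = n} ↦
        ‖τ' (c ν)‖ * Real.exp (-(2 * Real.pi * ∑ σ : F →+* ℝ, σ (ν : F) * y σ)))) →
    Final.KatzHyp F 𝔫 (Module.finrank ℚ F) idx enc E τ p v k c →
  (∃ 𝔪 : Ideal (𝓞 F), 𝔪 ≠ ⊥ ∧
    (halfSpace F).indicator (fun z ↦
      ∑' ν : {ν : F | ∀ b : 𝓞 F, ∃ n : ℤ, Algebra.trace ℚ F (ν * b) = n},
        τ (c ν) * cexp (2 * Real.pi * I * pairing (ν : F) z)) ∈ modularForms (Bianchi.Gamma1 𝔪) k) ∧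
  ∀ ν : F, (∀ b : 𝓞 F, ∃ n : ℤ, Algebra.trace ℚ F (ν * b) = n) → ∀ y : (F →+* ℝ) → ℝ, (∀ σ, 0 < y σ) →
    fourierCoeffAt ((halfSpace F).indicator (fun z ↦
      ∑' ν : {ν : F | ∀ b : 𝓞 F, ∃ n : ℤ, Algebra.trace ℚ F (ν * b) = n},
        τ (c ν) * cexp (2 * Real.pi * I * pairing (ν : F) z))) ν y = τ (c ν)

section Composition2

/-- **Seed data at every multiple of the seed weight** (U7 + U10). -/
theorem seedData_of_seed (hU7 : stub_seed_pow) (hU10 : stub_seedData_multiple)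
    (F : Type) [Field F] [NumberField F] [NumberField.IsTotallyReal F] (hd : 1 < Module.finrank ℚ F)
    (𝔫₀ : Ideal (𝓞 F)) (h𝔫₀ : 𝔫₀ ≠ ⊥) (E : Type) [Field E] [NumberField E] (τ : E →+* ℂ)
    (w₀ : (F →+* ℝ) → ℤ) (s : Point F → ℂ) (hs : s ∈ modularForms (Bianchi.Gamma1 𝔫₀) w₀)
    (hs0 : fourierCoeff s 0 = 0) (hsz : ∃ z ∈ halfSpace F, s z ≠ 0) (zc : F → ℤ)
    (hzc : ∀ ν ∈ qIndexSet F, fourierCoeff s ν = (zc ν : ℂ)) (i : ℤ) :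
    ∃ (w₁ : (F →+* ℝ) → ℤ) (s₁ G : Point F → ℂ), SeedData F 𝔫₀ E τ (i • w₀) w₁ s₁ G := by
  obtain ⟨w₁, s₁, G, h1, h2, h3, h4, h5, h6, h7⟩ := hU10 F 𝔫₀ E τ w₀ s
    (fun j hj ↦ hU7 F hd 𝔫₀ h𝔫₀ w₀ s hs hsz hs0 zc hzc j hj) i
  exact ⟨w₁, s₁, G, h1, h2, h3, h4, h5, h6, h7⟩

/-- **A seed from a non-constant form** (U9), packaged: level `2𝔫`. -/
theorem seed_of_nonconstant (hU9 : stub_seed_of_nonconstant)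
    (F : Type) [Field F] [NumberField F] [NumberField.IsTotallyReal F] (hd : 1 < Module.finrank ℚ F)
    (𝔫 : Ideal (𝓞 F)) (h𝔫 : 𝔫 ≠ ⊥) (w : (F →+* ℝ) → ℤ) (h : Point F → ℂ)
    (hh : h ∈ modularForms (Bianchi.Gamma1 𝔫) w) (zc : F → ℤ) (hzc : ∀ ν ∈ qIndexSet F, fourierCoeff h ν = (zc ν : ℂ))
    (hnc : ∃ ν ∈ qIndexSet F, ν ≠ 0 ∧ fourierCoeff h ν ≠ 0) :
    ∃ 𝔫₀ : Ideal (𝓞 F), 𝔫₀ ≠ ⊥ ∧ ∃ (s : Point F → ℂ) (zs : F → ℤ),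
      s ∈ modularForms (Bianchi.Gamma1 𝔫₀) w ∧ fourierCoeff s 0 = 0 ∧ (∃ z ∈ halfSpace F, s z ≠ 0) ∧
      ∀ ν ∈ qIndexSet F, fourierCoeff s ν = (zs ν : ℂ) := by
  obtain ⟨hmod, h0, hnz, zs, hzs⟩ := hU9 F hd 𝔫 h𝔫 w h hh zc hzc hnc
  refine ⟨𝔫 * Ideal.span {(2 : 𝓞 F)}, ?_, _, zs, hmod, h0, hnz, hzs⟩
  exact Ideal.mul_eq_bot.not.mpr (not_or.mpr ⟨h𝔫, Ideal.span_singleton_eq_bot.not.mpr two_ne_zero⟩)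

/-- **The typed crux for parallel weights `k ∈ ℤ·w·𝟙` from the items (i′), (i″) and ONE non-constant form of weight
`w·𝟙` with integer coefficients** (U7, U9, U10, `SupplyFromSeed`, the landed endpoint at the common level, and the
landed Sturm reduction; real proof). -/
theorem TypedCruxParallel_of_items (hU7 : stub_seed_pow) (hU9 : stub_seed_of_nonconstant)
    (hU10 : stub_seedData_multiple) (hU : SupplyFromSeed) (w : ℤ)
    (h1 : Final.ItemSturmModP) (h2 : Final.ItemBoundedDenominators) (h3 : ItemNonconstantForm w) :
    TypedCruxParallel w := by
  intro F _ _ _ hd 𝔫 h𝔫 E _ _ τ _hE p _ v idx α enc hadm k hk c hc_int hc_supp harch_c hKatz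
  obtain ⟨hd1, hα, hinj, hadd, htrace, henc⟩ := hadm
  obtain ⟨i, rfl⟩ := hk
  -- the seed and the seed data at weight `i • (w·𝟙)`
  obtain ⟨𝔫₁, h𝔫₁, h, zc, hh, hzc, hnc⟩ := h3 F hd
  obtain ⟨𝔫₀, h𝔫₀, s, zs, hs, hs0, hsz, hzs⟩ := seed_of_nonconstant hU9 F hd 𝔫₁ h𝔫₁ _ h hh zc hzc hnc
  obtain ⟨w₁, s₁, G, hseed⟩ := seedData_of_seed hU7 hU10 F hd 𝔫₀ h𝔫₀ E τ _ s hs hs0 hsz zs hzs i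
  have hk : (fun _ : F →+* ℝ ↦ i * w) = i • (fun _ : F →+* ℝ ↦ w) := by
    funext σ; simp
  rw [hk]
  rw [hk] at hKatz
  obtain ⟨𝔫', h𝔫', -, hSup⟩ := hU F hd 𝔫₀ h𝔫₀ E τ _ w₁ s₁ G hseed
  have h𝔫𝔫' : 𝔫 * 𝔫' ≠ ⊥ := Ideal.mul_eq_bot.not.mpr (not_or.mpr ⟨h𝔫, h𝔫'⟩)
  obtain ⟨L, cS, hL, hmodp⟩ := h1 F hd (𝔫 * 𝔫') h𝔫𝔫' α hα E τ p v
  refine Summit.Langlands.Langlands.Theorems.HilbertIntegralOverconvergentIsCongruence.hilbertClassicalityModuloNamedFacts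
    F hd (𝔫 * 𝔫') h𝔫𝔫' E τ p v _ idx α enc hd1 hα hinj hadd htrace henc ⟨L, cS, hL, fun b f hf q hq B hB hwin ↦ ?_⟩ _
    (supplyHyp_mono Ideal.mul_le_left hSup) c hc_int hc_supp harch_c (katzHyp_mono Ideal.mul_le_right hKatz)
  exact Summit.Langlands.Langlands.Theorems.HilbertIntegralOverconvergentIsCongruence.hcm_sturmSupNorm_of_modP
    F (𝔫 * 𝔫') α E τ p v L hmodp (h2 F hd (𝔫 * 𝔫') h𝔫𝔫' E τ p v) b f hf q hq B hB hwin

/-- Feeding the wave-2 composition the stubs themselves: parallel weights `ℤ·w·𝟙` from (i′), (i″), (ii-w). -/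
theorem TypedCruxParallel_proof (w : ℤ) (h1 : Final.ItemSturmModP) (h2 : Final.ItemBoundedDenominators)
    (h3 : ItemNonconstantForm w) : TypedCruxParallel w :=
  TypedCruxParallel_of_items Stubs.stub_seed_pow Stubs.stub_seed_of_nonconstant Stubs.stub_seedData_multiple
    SupplyFromSeed_proof w h1 h2 h3

end Composition2

end Seed

/-!
# § V — RESHAPE 18 (lead c7, cycle 2): THE THETA SEED — `Seed.ItemNonconstantForm 2` is a THEOREM (`Theta.ThetaSeed`)

After § U the supply side of the typed crux for PARALLEL weights `k ∈ 2ℤ·𝟙` needs exactly ONE non-constant Hilbert modular form of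
parallel weight `2` with integer Fourier coefficients over every totally real `F` of degree `d ≥ 2` (`Seed.ItemNonconstantForm 2`).
This section PROVES it with the theta series of four squares,
  `Θ(z) = ∑_{x ∈ 𝓞F} e^{2πi Tr(x² z)}`,   `Θ⁴ ∈ M_{2·𝟙}(Γ₁((q)))`,   `q = 4|d_F|`,
using only the tree: (a) `Θ` is a `q`-series with coefficients `r(ν) = #{x ∈ 𝓞F : x² = ν} ∈ {0,1,2}` (V1; holomorphy,
periodicity and `fourierCoeff = r` by the landed `qSeriesPackage`), and the dual theta `Θ'(z) = ∑_{ξ ∈ 𝔡⁻¹} e^{2πi Tr(ξ² z)}` is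
holomorphic and `𝔡`-periodic (V2); (b) THETA INVERSION `Θ(-1/w) = |d_F|^{-1/2} ∏_σ (w_σ/2i)^{1/2} Θ'(w/4)` on `ℍ^d`: on the imaginary
orthant it is Hecke's transformation formula `θ_𝓞(y⁻¹) = √N(y)/√|d| θ_{𝔡⁻¹}(y)` PROVED in the tree (`thetaIdeal_inv_holds`, Neukirch VII
(3.6)/(5.7)) (V3), and two holomorphic functions on `ℍ^d` that agree on `iℝ_+^d` agree (V4, one variable at a time); (c) hence the
weight-`2` law of `Θ⁴` under the LOWER unipotents `(1 0; c 1)`, `c ∈ (q)` (V5: `z/(cz+1) = -1/(-1/z - c)` and `Θ'(·/4)⁴` is `(q)`-periodic),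
under the translations (periodicity), so under the group they generate (V7) — which contains `Γ₁((q))` by VASERSTEIN'S THEOREM
`G((q), 𝓞) = E((q), 𝓞)`, PROVED in the tree for the congruence subgroup property (`SL2Rel.relG_le_relE_span_singleton`; V6, conjugate by
the Weyl element); (d) cusps by the landed Koecher principle; integer coefficients and non-constancy from the landed product formula
(`r ≥ 0`, `r(1) = 2`).  Composition V8 (lead): `Theta.ThetaSeed : Seed.ItemNonconstantForm 2`, whence
`Seed.TypedCruxParallel 2` from (i′) + (i″) ALONE (`Theta.TypedCruxParallelTwo_of_items`).
-/

namespace Stubs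

/-- **stub V1 (LANDED p141696) — `stub_theta_qSeries` (M; the theta series as a `q`-series).** Over a totally real `F`: the lattice Gaussian sums `∑_{x ∈ 𝓞F} e^{-2π ∑_σ y_σ σ(x)²}` converge for `y ≫ 0`; with `r(ν) = #{x ∈ 𝓞F : x² = ν}` (a finite cardinality, `≤ 2`) the … (abridged; see the landed file). [folklore] -/
theorem stub_theta_qSeries (F : Type) [Field F] [NumberField F] [NumberField.IsTotallyReal F] :
    (∀ y : (F →+* ℝ) → ℝ, (∀ σ, 0 < y σ) →
      Summable (fun x : 𝓞 F ↦ Real.exp (-(2 * Real.pi * ∑ σ : F →+* ℝ, y σ * σ (x : F) ^ 2)))) ∧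
    (∀ y : (F →+* ℝ) → ℝ, (∀ σ, 0 < y σ) →
      Summable (fun ν : {ν : F | ∀ a : 𝓞 F, ∃ n : ℤ, Algebra.trace ℚ F (ν * a) = n} ↦
        ‖((Nat.card {x : 𝓞 F // ((x : 𝓞 F) : F) ^ 2 = (ν : F)} : ℕ) : ℂ)‖ *
          Real.exp (-(2 * Real.pi * ∑ σ : F →+* ℝ, σ (ν : F) * y σ)))) ∧
    (∀ z ∈ halfSpace F,
      (∑' x : 𝓞 F, cexp (2 * Real.pi * I * pairing (((x : 𝓞 F) : F) ^ 2) z)) =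
        ∑' ν : {ν : F | ∀ a : 𝓞 F, ∃ n : ℤ, Algebra.trace ℚ F (ν * a) = n},
          ((Nat.card {x : 𝓞 F // ((x : 𝓞 F) : F) ^ 2 = (ν : F)} : ℕ) : ℂ) *
            cexp (2 * Real.pi * I * pairing (ν : F) z)) ∧
    Nat.card {x : 𝓞 F // ((x : 𝓞 F) : F) ^ 2 = (0 : F)} = 1 ∧
    Nat.card {x : 𝓞 F // ((x : 𝓞 F) : F) ^ 2 = (1 : F)} = 2 ∧
    (∀ ν : F, Nat.card {x : 𝓞 F // ((x : 𝓞 F) : F) ^ 2 = ν} ≠ 0 → ν ∈ qIndexSet F) ∧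
    (∀ (b : 𝓞 F) (z : Point F),
      (∑' x : 𝓞 F, cexp (2 * Real.pi * I * pairing (((x : 𝓞 F) : F) ^ 2) (fun σ ↦ z σ + ((σ (b : F) : ℝ) : ℂ)))) =
        ∑' x : 𝓞 F, cexp (2 * Real.pi * I * pairing (((x : 𝓞 F) : F) ^ 2) z)) :=
  Summit.Langlands.Langlands.Theorems.HilbertIntegralOverconvergentIsCongruence.stub_theta_qSeries F

/-- **stub V2 (LANDED p141075) — `stub_thetaDual_props` (M; the dual theta series).** Granting the lattice Gaussian summability over `𝓞F` (V1's first clause, a hypothesis here), the dual theta `Θ'(z) = ∑_{ξ ∈ 𝔡⁻¹} e^{2πi S(ξ² z)}` is holomorphic on `ℍ` (`|d_F|·𝔡⁻¹ … (abridged; see the landed file). [folklore] -/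
theorem stub_thetaDual_props (F : Type) [Field F] [NumberField F] [NumberField.IsTotallyReal F]
    (hgauss : ∀ y : (F →+* ℝ) → ℝ, (∀ σ, 0 < y σ) →
      Summable (fun x : 𝓞 F ↦ Real.exp (-(2 * Real.pi * ∑ σ : F →+* ℝ, y σ * σ (x : F) ^ 2)))) :
    IsHolomorphicOn F (fun z ↦ ∑' ξ : {ν : F | ∀ a : 𝓞 F, ∃ n : ℤ, Algebra.trace ℚ F (ν * a) = n},
        cexp (2 * Real.pi * I * pairing ((ξ : F) ^ 2) z)) ∧
    ∀ c : 𝓞 F, c ∈ differentIdeal ℤ (𝓞 F) → ∀ z : Point F,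
      (∑' ξ : {ν : F | ∀ a : 𝓞 F, ∃ n : ℤ, Algebra.trace ℚ F (ν * a) = n},
          cexp (2 * Real.pi * I * pairing ((ξ : F) ^ 2) (fun σ ↦ z σ + ((σ (c : F) : ℝ) : ℂ)))) =
        ∑' ξ : {ν : F | ∀ a : 𝓞 F, ∃ n : ℤ, Algebra.trace ℚ F (ν * a) = n},
          cexp (2 * Real.pi * I * pairing ((ξ : F) ^ 2) z) :=
  Summit.Langlands.Langlands.Theorems.HilbertIntegralOverconvergentIsCongruence.stub_thetaDual_props F hgauss

/-- **stub V3 (LANDED p141491) — `stub_theta_inversion_imaginary` (L; Hecke's theta transformation on the imaginary orthant, from the tree).** For `y ≫ 0`: `Θ(i/(4y)) = |d_F|^{-1/2} ∏_σ √(2y_σ) · Θ'(iy)` — this is `thetaIdeal_inv_holds F` (Neukirch VII (3.6) with (5.7): `θ_𝓞(y'⁻¹) = √N(y')/√|d_F| θ_{𝔡⁻¹}(y')`) at `y' = … (abridged; see the landed file). [cite: NeukirchANT1999, Ch. VII (3.6), (5.7)] -/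
theorem stub_theta_inversion_imaginary (F : Type) [Field F] [NumberField F] [NumberField.IsTotallyReal F]
    (y : (F →+* ℝ) → ℝ) (hy : ∀ σ, 0 < y σ) :
    (∑' x : 𝓞 F, cexp (2 * Real.pi * I * pairing (((x : 𝓞 F) : F) ^ 2) (fun σ ↦ (((4 * y σ)⁻¹ : ℝ) : ℂ) * I))) =
      ((|(NumberField.discr F : ℝ)| ^ (-(1 / 2 : ℝ)) : ℝ) : ℂ) * (∏ σ : F →+* ℝ, ((Real.sqrt (2 * y σ) : ℝ) : ℂ)) *
        ∑' ξ : {ν : F | ∀ a : 𝓞 F, ∃ n : ℤ, Algebra.trace ℚ F (ν * a) = n},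
          cexp (2 * Real.pi * I * pairing ((ξ : F) ^ 2) (fun σ ↦ ((y σ : ℝ) : ℂ) * I)) :=
  Summit.Langlands.Langlands.Theorems.HilbertIntegralOverconvergentIsCongruence.stub_theta_inversion_imaginary F y hy

/-- **stub V4 (LANDED p140996) — `stub_imaginary_orthant_identity` (M; uniqueness from the imaginary orthant).** Two holomorphic functions on `ℍ^d` that agree at every purely imaginary point `iy`, `y ≫ 0`, agree on `ℍ^d`: one variable at a time — for fixed imaginary values of the other … (abridged; see the landed file). [folklore] -/
theorem stub_imaginary_orthant_identity (F : Type) [Field F] [NumberField F] (f g : Point F → ℂ)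
    (hf : IsHolomorphicOn F f) (hg : IsHolomorphicOn F g)
    (h : ∀ y : (F →+* ℝ) → ℝ, (∀ σ, 0 < y σ) → f (fun σ ↦ ((y σ : ℝ) : ℂ) * I) = g (fun σ ↦ ((y σ : ℝ) : ℂ) * I)) :
    ∀ z ∈ halfSpace F, f z = g z :=
  Summit.Langlands.Langlands.Theorems.HilbertIntegralOverconvergentIsCongruence.stub_imaginary_orthant_identity F f g hf hg h

/-- **stub V5 (LANDED p141033) — `stub_lower_unipotent_of_inversion` (M; the lower unipotent law from an inversion formula).** If `Φ(-1/w) = C ∏_σ w_σ² Ψ(w)` on `ℍ` and `Ψ` is `J`-periodic on `ℍ`, then `Φ` satisfies the parallel-weight-`2` law under `(1 0; c 1)`, `c ∈ J`: `z/(cz+1) = -1/w'` with `w' = … (abridged; see the landed file). [folklore] -/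
theorem stub_lower_unipotent_of_inversion (F : Type) [Field F] [NumberField F] (Φ Ψ : Point F → ℂ) (C : ℂ) (J : Ideal (𝓞 F))
    (hinv : ∀ w ∈ halfSpace F, Φ (fun σ ↦ -(w σ)⁻¹) = C * (∏ σ : F →+* ℝ, w σ ^ 2) * Ψ w)
    (hper : ∀ c ∈ J, ∀ w ∈ halfSpace F, Ψ (fun σ ↦ w σ + ((σ (c : F) : ℝ) : ℂ)) = Ψ w) :
    ∀ c ∈ J, ∀ z ∈ halfSpace F,
      Φ (moeb (toSL2F (SL2Rel.e21 c)) z) = autFactor (fun _ ↦ (2 : ℤ)) (toSL2F (SL2Rel.e21 c)) z * Φ z :=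
  Summit.Langlands.Langlands.Theorems.HilbertIntegralOverconvergentIsCongruence.stub_lower_unipotent_of_inversion F Φ Ψ C J hinv hper

/-- **stub V6 (LANDED p140916) — `stub_gamma1_le_closure` (M; Vaserstein generation of `Γ₁((q))`).** Over a totally real `F` of degree `≥ 2` and `q ≠ 0`: `Γ₁((q))` is contained in the subgroup of `SL₂(𝓞F)` generated by the translations `(1 b; 0 1)`, `b ∈ 𝓞F`, and the lower … (abridged; see the landed file). [cite: Vaserstein1972SL2, Theorem] -/
theorem stub_gamma1_le_closure (F : Type) [Field F] [NumberField F] [NumberField.IsTotallyReal F]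
    (hd : 1 < Module.finrank ℚ F) (q : 𝓞 F) (hq : q ≠ 0) :
    Bianchi.Gamma1 (Ideal.span {q}) ≤
      Subgroup.closure ((Set.range fun b : 𝓞 F ↦ SL2Rel.e12 b) ∪ (SL2Rel.e21 '' (Ideal.span {q} : Set (𝓞 F)))) :=
  Summit.Langlands.Langlands.Theorems.HilbertIntegralOverconvergentIsCongruence.stub_gamma1_le_closure F hd q hq

/-- **stub V7 (LANDED p140929) — `stub_transform_of_closure` (M; transformation laws pass to the generated subgroup).** If `f` satisfies the weight-`k` law `f(γz) = J_k(γ,z) f(z)` on `ℍ` for every `γ` in a set `G ⊆ SL₂(𝓞F)`, it satisfies it for every `γ` in the subgroup generated by `G` … (abridged; see the landed file). [folklore] -/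
theorem stub_transform_of_closure (F : Type) [Field F] [NumberField F] (k : (F →+* ℝ) → ℤ) (f : Point F → ℂ)
    (G : Set SL(2, 𝓞 F))
    (hG : ∀ γ ∈ G, ∀ z ∈ halfSpace F, f (moeb (toSL2F γ) z) = autFactor k (toSL2F γ) z * f z) :
    ∀ γ ∈ Subgroup.closure G, ∀ z ∈ halfSpace F, f (moeb (toSL2F γ) z) = autFactor k (toSL2F γ) z * f z :=
  Summit.Langlands.Langlands.Theorems.HilbertIntegralOverconvergentIsCongruence.stub_transform_of_closure F k f G hG

/-- **stub V8 (LANDED p142036) — `stub_thetaSeed` (L; the lead's composition).** `Θ⁴`, extended by `0` off `ℍ`, lies in `M_{2·𝟙}(Γ₁((4|d_F|)))`, has integer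
Fourier coefficients on the cone and a non-zero coefficient at `ν = 1`; hence `Seed.ItemNonconstantForm 2` (V1–V7, the landed Koecher
principle, `q`-series package and product formula). [folklore] -/
theorem stub_thetaSeed : Seed.ItemNonconstantForm 2 :=
  fun F _ _ _ hd ↦ Summit.Langlands.Langlands.Theorems.HilbertIntegralOverconvergentIsCongruence.thetaSeed F hd

end Stubs

namespace Theta

/-- Statement of stub V1, by name. -/
def stub_theta_qSeries : Prop := type_of% Stubs.stub_theta_qSeries
/-- Statement of stub V2, by name. -/
def stub_thetaDual_props : Prop := type_of% Stubs.stub_thetaDual_props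
/-- Statement of stub V3, by name. -/
def stub_theta_inversion_imaginary : Prop := type_of% Stubs.stub_theta_inversion_imaginary
/-- Statement of stub V4, by name. -/
def stub_imaginary_orthant_identity : Prop := type_of% Stubs.stub_imaginary_orthant_identity
/-- Statement of stub V5, by name. -/
def stub_lower_unipotent_of_inversion : Prop := type_of% Stubs.stub_lower_unipotent_of_inversion
/-- Statement of stub V6, by name. -/
def stub_gamma1_le_closure : Prop := type_of% Stubs.stub_gamma1_le_closure
/-- Statement of stub V7, by name. -/
def stub_transform_of_closure : Prop := type_of% Stubs.stub_transform_of_closure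
/-- Statement of stub V8 (the lead's composition), by name. -/
def stub_thetaSeed : Prop := type_of% Stubs.stub_thetaSeed

/-- **`ThetaSeed`** — the target of RESHAPE 18: item (ii-2) `Seed.ItemNonconstantForm 2` (a non-constant Hilbert modular form of parallel
weight `2` with integer coefficients over every totally real field of degree `≥ 2`). -/
def ThetaSeed : Prop := Seed.ItemNonconstantForm 2

section Composition

/-- **RESHAPE 18 from the stubs**: `ThetaSeed` is the composition stub V8, proved by the lead from V1–V7 (all landed). -/
theorem ThetaSeed_of : ThetaSeed :=
  Stubs.stub_thetaSeed

/-- Feeding the composition the stubs themselves. -/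
theorem ThetaSeed_proof : ThetaSeed :=
  ThetaSeed_of

/-- **The typed crux for every PARALLEL EVEN weight from the two `q`-expansion-principle items alone**: (i′) Sturm mod 𝔭 on trace
windows + (i″) bounded denominators ⇒ `Seed.TypedCruxParallel 2` (the theta seed discharges (ii-2)). -/
theorem TypedCruxParallelTwo_of_items (h1 : Final.ItemSturmModP) (h2 : Final.ItemBoundedDenominators) :
    Seed.TypedCruxParallel 2 :=
  Seed.TypedCruxParallel_proof 2 h1 h2 ThetaSeed_proof

end Composition

end Theta

/-!
# § W — RESHAPE 19 (lead c7, cycle 2): THE WEIGHT-ONE THETA SEED — `Seed.ItemNonconstantForm 1` (`Theta.ThetaSeedOne`),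
# hence the typed crux for EVERY PARALLEL WEIGHT `k ∈ ℤ·𝟙` from the items (i′) + (i″) ALONE

`Θ² · 1_ℍ ∈ M_{1·𝟙}(Γ₁((4 d_F)))` with natural-number coefficients `a_ν(Θ²) = #{(x,y) ∈ 𝓞F² : x² + y² = ν}`, `a₁ ≥ 2`:
the § V machinery with the exponent `2` replaced by `1` — the parallel-weight-`m` lower-unipotent law from an inversion
formula `Φ(-1/w) = C ∏_σ w_σ^m Ψ(w)` (`tw_lower_unipotent_of_inversion_pow`, `tw_gamma1_law_pow`, from stubs V5–V7) and
`Θ(-1/w)² = |d_F|^{-1} (2i)^{-d} ∏_σ w_σ Θ'(w/4)²` on `ℍ^d` (`tw_theta2_inversion`: Hecke's formula V3 SQUARED — no branch of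
the square root — and the identity principle V4); cusps by Koecher, coefficients by `ts_natCoeff_mul`.  One stub, the lead's
(`stub_thetaSeedOne`, file `…ThetaSeedOne.lean`).  Consequence: `Seed.TypedCruxParallel 1`, i.e. the typed crux C′ for every
parallel weight `k = i·𝟙`, `i ∈ ℤ`, follows from (i′) `Final.ItemSturmModP` and (i″) `Final.ItemBoundedDenominators` alone
(`Theta.TypedCruxParallelOne_of_items`) — the supply item (ii) is DISCHARGED for all parallel weights.
-/

namespace Stubs

/-- **stub W1 (LANDED p142139) — `stub_thetaSeedOne` (L; the lead's composition, file `…ThetaSeedOne.lean`).** `Θ² · 1_ℍ` is a Hilbert modular form of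
parallel weight `1` and level `Γ₁((4 d_F))` with integer coefficients and `a₁ ≠ 0` over every totally real `F` of degree `≥ 2`:
`Seed.ItemNonconstantForm 1`. [folklore] -/
theorem stub_thetaSeedOne : Seed.ItemNonconstantForm 1 :=
  fun F _ _ _ hd ↦ Summit.Langlands.Langlands.Theorems.HilbertIntegralOverconvergentIsCongruence.thetaSeedOne F hd

end Stubs

namespace Theta

/-- Statement of stub W1 (the lead's composition), by name. -/
def stub_thetaSeedOne : Prop := type_of% Stubs.stub_thetaSeedOne

/-- **`ThetaSeedOne`** — the target of RESHAPE 19: item (ii-1) `Seed.ItemNonconstantForm 1` (a non-constant Hilbert modular form of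
PARALLEL WEIGHT ONE with integer coefficients over every totally real field of degree `≥ 2`). -/
def ThetaSeedOne : Prop := Seed.ItemNonconstantForm 1

section CompositionW

/-- **RESHAPE 19 from its stub**: `ThetaSeedOne` is the composition stub W1 (LANDED). -/
theorem ThetaSeedOne_of : ThetaSeedOne :=
  Stubs.stub_thetaSeedOne

/-- Feeding the composition the stub itself. -/
theorem ThetaSeedOne_proof : ThetaSeedOne :=
  ThetaSeedOne_of

/-- **The typed crux for EVERY PARALLEL weight from the two `q`-expansion-principle items alone**: (i′) Sturm mod 𝔭 on trace
windows + (i″) bounded denominators ⇒ `Seed.TypedCruxParallel 1` (the weight-one theta seed discharges (ii-1); `k = i·𝟙`, `i ∈ ℤ`). -/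
theorem TypedCruxParallelOne_of_items (h1 : Final.ItemSturmModP) (h2 : Final.ItemBoundedDenominators) :
    Seed.TypedCruxParallel 1 :=
  Seed.TypedCruxParallel_proof 1 h1 h2 ThetaSeedOne_proof

end CompositionW

end Theta

/-!
# § X — RESHAPE 20 (lead c7, cycle 3): THE NON-PARALLEL SUPPLY — `Seed.ItemSeedSupply` is a THEOREM (`Bracket.ItemSeedSupplyThm`),
# hence the FULL typed crux C′ (every paritious weight) from the items (i′) + (i″) ALONE

After §§ V–W the supply is discharged for parallel weights.  For a PARITIOUS weight `k` the missing input is a SHIFT FORM `G` of the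
non-parallel weight `w₀·𝟙 - k` with `E`-rational `𝓞_E`-integral tube-summable coefficients, `G ≢ 0`.  § X builds it from
RANKIN–COHEN BRACKETS: for Hilbert modular forms `f ∈ M_k`, `g ∈ M_l` and a place `σ`, `[f,g]_σ = k_σ f ∂_σ g - l_σ g ∂_σ f ∈ M_{k+l+2e_σ}`
(`∂_σ` the derivative in the coordinate `z_σ`; the cross terms of the derivative of the automorphy factor cancel — stub X2; cusps by
Koecher).  With `h = Θ²·1_ℍ` (weight `1`, `a₀ ≠ 0`, § W) and its seed `s = h - h(2·)` (weight `1`, `a₀ = 0`), the BUMP FORM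
`B_σ = 1_ℍ·(2πi)⁻¹ d_F [s,h]_σ ∈ M_{2·𝟙+2e_σ}(Γ₁(2𝔫_θ))` has coefficients `∑_{μ+μ'=ν} σ(d_F μ')(a_μ(s) a_μ'(h) - a_μ(h) a_μ'(s)) = σ(x_ν)`,
`x_ν ∈ 𝓞F` — `E`-rational through `ι_σ : F → E` (`τ ∘ ι_σ = σ`, available as `E ⊇ F^gal`), integral, tube-summable under every
conjugate (stub X5) — and `B_σ ≢ 0` by its LEADING coefficient `-2πi σ(ν⋆) a₀(h) a_{ν⋆}(s) ≠ 0` at the `λ`-minimal index `ν⋆` of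
`s` for a generic height `λ` (stub X4, § U's generic heights).  Then `G = 1_ℍ · ∏_σ B_σ^{m_σ}` (`2m_σ = K - k_σ`, `K ≫ 0`,
`K ≡ k_σ (2)`) has weight `(2∑m_σ + K)·𝟙 - k` (products keep the data: cone convolutions are tube-summable, stub X6), and the seed `S = s^{w₀}`, `w₀ = 2∑m_σ + K ≥ 1`
(landed `stub_seed_pow`), completes `SeedData`.  Analytic inputs: slice derivatives of holomorphic functions on `ℍ^d` (X1), termwise
differentiation of `q`-series (X3: `a_ν ↦ 2πi σ(ν) a_ν`).  Lead: `stub_itemSeedSupply` (file `…ItemSeedSupply.lean`, written and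
checked modulo X1–X6 before the wave).  CODA: `Bracket.TypedCrux_of_two_items : ItemSturmModP → ItemBoundedDenominators → Final.TypedCrux`.  ALL OF § X LANDED.
-/

namespace Stubs

open Classical in
/-- **stub X1 (LANDED p143086) — `stub_slice_deriv_holomorphic` (M; partial derivatives of holomorphic functions on `ℍ^d`).** For `f` holomorphic on `ℍ = halfSpace F` and a place `σ`, the slice derivative `∂_σ f (z) := d/dt f(z with z_σ := t)|_{t = z_σ}` is again holomorphic on `ℍ`, and at every `z ∈ ℍ` … (abridged; see the landed file). [folklore] -/
theorem stub_slice_deriv_holomorphic (F : Type) [Field F] [NumberField F] (σ : F →+* ℝ) (f : Point F → ℂ)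
    (hf : IsHolomorphicOn F f) :
    IsHolomorphicOn F (fun z ↦ deriv (fun t : ℂ ↦ f (Function.update z σ t)) (z σ)) ∧
    ∀ z ∈ halfSpace F,
      HasDerivAt (fun t : ℂ ↦ f (Function.update z σ t)) (fderiv ℂ f z (Pi.single σ 1)) (z σ) :=
  Summit.Langlands.Langlands.Theorems.HilbertIntegralOverconvergentIsCongruence.stub_slice_deriv_holomorphic F σ f hf

open Classical in
/-- **stub X2 (LANDED p143251) — `stub_slice_deriv_law` (L; how `∂_σ` and the first Rankin–Cohen bracket transform).** If `f` is holomorphic on `ℍ` with `f(γz) = J_k(γ,z) f(z)` on `ℍ` (`γ ∈ SL₂(F)`), then, writing `j_σ = σ(c) z_σ + σ(d)` (`denom γ z σ`), `(∂_σ f)(γz) = j_σ² J_k(γ,z) (∂_σ f(z) + … (abridged; see the landed file). [folklore] -/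
theorem stub_slice_deriv_law (F : Type) [Field F] [NumberField F] (k l : (F →+* ℝ) → ℤ) (σ : F →+* ℝ)
    (f g : Point F → ℂ) (hf : IsHolomorphicOn F f) (hg : IsHolomorphicOn F g) (γ : SL(2, F))
    (hfγ : ∀ z ∈ halfSpace F, f (moeb γ z) = autFactor k γ z * f z)
    (hgγ : ∀ z ∈ halfSpace F, g (moeb γ z) = autFactor l γ z * g z) :
    (∀ z ∈ halfSpace F,
      deriv (fun t : ℂ ↦ f (Function.update (moeb γ z) σ t)) (moeb γ z σ) =
        denom γ z σ ^ 2 * autFactor k γ z *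
          (deriv (fun t : ℂ ↦ f (Function.update z σ t)) (z σ) +
            (k σ : ℂ) * ((σ (γ 1 0) : ℝ) : ℂ) * (denom γ z σ)⁻¹ * f z)) ∧
    ∀ z ∈ halfSpace F,
      (k σ : ℂ) * f (moeb γ z) * deriv (fun t : ℂ ↦ g (Function.update (moeb γ z) σ t)) (moeb γ z σ) -
          (l σ : ℂ) * g (moeb γ z) * deriv (fun t : ℂ ↦ f (Function.update (moeb γ z) σ t)) (moeb γ z σ) =
        autFactor (k + l + Pi.single σ 2) γ z *
          ((k σ : ℂ) * f z * deriv (fun t : ℂ ↦ g (Function.update z σ t)) (z σ) -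
            (l σ : ℂ) * g z * deriv (fun t : ℂ ↦ f (Function.update z σ t)) (z σ)) :=
  Summit.Langlands.Langlands.Theorems.HilbertIntegralOverconvergentIsCongruence.stub_slice_deriv_law F k l σ f g hf hg γ hfγ hgγ

open Classical in
/-- **stub X3 (LANDED p143280) — `stub_qSeries_slice_deriv` (L; termwise differentiation of `q`-series in one coordinate).** For an absolutely convergent `q`-series `Q(z) = ∑_{ν ∈ 𝔡⁻¹} a_ν e^{2πi S(νz)}` (tube summability at every height), the coefficients `2πi σ(ν) a_ν` are again tube-summable at every … (abridged; see the landed file). [folklore] -/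
theorem stub_qSeries_slice_deriv (F : Type) [Field F] [NumberField F] [NumberField.IsTotallyReal F] (a : F → ℂ)
    (habs : ∀ y : (F →+* ℝ) → ℝ, (∀ σ, 0 < y σ) →
      Summable (fun ν : {ν : F | ∀ b : 𝓞 F, ∃ n : ℤ, Algebra.trace ℚ F (ν * b) = n} ↦
        ‖a ν‖ * Real.exp (-(2 * Real.pi * ∑ σ : F →+* ℝ, σ (ν : F) * y σ))))
    (σ : F →+* ℝ) :
    (∀ y : (F →+* ℝ) → ℝ, (∀ σ', 0 < y σ') →
      Summable (fun ν : {ν : F | ∀ b : 𝓞 F, ∃ n : ℤ, Algebra.trace ℚ F (ν * b) = n} ↦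
        ‖2 * Real.pi * I * ((σ (ν : F) : ℝ) : ℂ) * a ν‖ *
          Real.exp (-(2 * Real.pi * ∑ σ' : F →+* ℝ, σ' (ν : F) * y σ')))) ∧
    ∀ z ∈ halfSpace F,
      deriv (fun t : ℂ ↦ ∑' ν : {ν : F | ∀ b : 𝓞 F, ∃ n : ℤ, Algebra.trace ℚ F (ν * b) = n},
          a ν * cexp (2 * Real.pi * I * pairing (ν : F) (Function.update z σ t))) (z σ) =
        ∑' ν : {ν : F | ∀ b : 𝓞 F, ∃ n : ℤ, Algebra.trace ℚ F (ν * b) = n},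
          (2 * Real.pi * I * ((σ (ν : F) : ℝ) : ℂ) * a ν) * cexp (2 * Real.pi * I * pairing (ν : F) z) :=
  Summit.Langlands.Langlands.Theorems.HilbertIntegralOverconvergentIsCongruence.stub_qSeries_slice_deriv F a habs σ

/-- **stub X4 (LANDED p143183) — `stub_bracket_lead_coeff` (M; the leading coefficient of a bracket-type convolution).** For an injective additive height `λ` positive on the non-zero cone indices, coefficient functions `a, b` supported on the cone with `a(0) = 0`, "derived" coefficient functions … (abridged; see the landed file). [folklore] -/
theorem stub_bracket_lead_coeff (F : Type) [Field F] [NumberField F] [NumberField.IsTotallyReal F]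
    (lam : F →+ ℝ) (hlam : Function.Injective lam) (hpos : ∀ ν ∈ qIndexSet F, ν ≠ 0 → 0 < lam ν)
    (a b a' b' c : F → ℂ) (ha : ∀ ν, a ν ≠ 0 → ν ∈ qIndexSet F) (hb : ∀ ν, b ν ≠ 0 → ν ∈ qIndexSet F)
    (ha0 : a 0 = 0) (ha' : ∀ ν, a' ν ≠ 0 → a ν ≠ 0) (hb' : ∀ ν, b' ν ≠ 0 → ν ∈ qIndexSet F) (hb'0 : b' 0 = 0)
    (hc : ∀ (ν : F) (T : Finset (F × F)),
      (∀ μ : F × F, μ ∈ T ↔ μ.1 ∈ qIndexSet F ∧ μ.2 ∈ qIndexSet F ∧ μ.1 + μ.2 = ν) →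
      c ν = ∑ μ ∈ T, (a μ.1 * b' μ.2 - b μ.1 * a' μ.2))
    (νa : F) (hνa : a νa ≠ 0) (hmina : ∀ ν, a ν ≠ 0 → lam νa ≤ lam ν) :
    c νa = -(b 0 * a' νa) :=
  Summit.Langlands.Langlands.Theorems.HilbertIntegralOverconvergentIsCongruence.stub_bracket_lead_coeff F lam hlam hpos a b a' b' c ha hb ha0 ha' hb' hb'0 hc νa hνa hmina

/-- **stub X5 (LANDED p143551) — `stub_bracket_Edata` (M; `E`-rational integral data of the scaled bracket).** Let `f, g` be Hilbert modular forms of level `Γ₁(𝔫)` with INTEGER coefficients `zf, zg` on the cone, `σ` a place, `ι : F → E` with `τ ∘ ι = σ`, and `G` a function whose Fourier … (abridged; see the landed file). [folklore] -/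
theorem stub_bracket_Edata (F : Type) [Field F] [NumberField F] [NumberField.IsTotallyReal F]
    (hd : 1 < Module.finrank ℚ F) (𝔫 : Ideal (𝓞 F)) (h𝔫 : 𝔫 ≠ ⊥) (E : Type) [Field E] [NumberField E]
    (τ : E →+* ℂ) (ι : F →+* E) (σ : F →+* ℝ) (hι : ∀ x : F, τ (ι x) = ((σ x : ℝ) : ℂ))
    (k l : (F →+* ℝ) → ℤ) (f g : Point F → ℂ) (hf : f ∈ modularForms (Bianchi.Gamma1 𝔫) k)
    (hg : g ∈ modularForms (Bianchi.Gamma1 𝔫) l) (zf zg : F → ℤ)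
    (hzf : ∀ ν ∈ qIndexSet F, fourierCoeff f ν = (zf ν : ℂ)) (hzg : ∀ ν ∈ qIndexSet F, fourierCoeff g ν = (zg ν : ℂ))
    (hmaj : ∀ y : (F →+* ℝ) → ℝ, (∀ σ', 0 < y σ') →
      Summable (fun ν : {ν : F | ∀ b : 𝓞 F, ∃ n : ℤ, Algebra.trace ℚ F (ν * b) = n} ↦
        (∑ μ ∈ (stub_finite_qIndex_antidiagonal F (ν : F)).toFinset,
            (|(zf μ.1 : ℝ)| * |(zg μ.2 : ℝ)| + |(zg μ.1 : ℝ)| * |(zf μ.2 : ℝ)|)) *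
          Real.exp (-(2 * Real.pi * ∑ σ' : F →+* ℝ, σ' (ν : F) * y σ'))))
    (G : Point F → ℂ)
    (hG : ∀ ν ∈ qIndexSet F, ∀ T : Finset (F × F),
      (∀ μ : F × F, μ ∈ T ↔ μ.1 ∈ qIndexSet F ∧ μ.2 ∈ qIndexSet F ∧ μ.1 + μ.2 = ν) →
      fourierCoeff G ν = ∑ μ ∈ T, ((σ ((NumberField.discr F : F) * μ.2) : ℝ) : ℂ) *
        ((k σ : ℂ) * (zf μ.1 : ℂ) * (zg μ.2 : ℂ) - (l σ : ℂ) * (zg μ.1 : ℂ) * (zf μ.2 : ℂ))) :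
    ∃ qG : F → E, (∀ ν ∈ qIndexSet F, fourierCoeff G ν = τ (qG ν)) ∧ (∀ ν, IsIntegral ℤ (qG ν)) ∧
      ∀ (τ' : E →+* ℂ) (y : (F →+* ℝ) → ℝ), (∀ σ', 0 < y σ') →
        Summable (fun ν : {ν : F | ∀ b : 𝓞 F, ∃ n : ℤ, Algebra.trace ℚ F (ν * b) = n} ↦
          ‖τ' (qG ν)‖ * Real.exp (-(2 * Real.pi * ∑ σ' : F →+* ℝ, σ' (ν : F) * y σ'))) :=
  Summit.Langlands.Langlands.Theorems.HilbertIntegralOverconvergentIsCongruence.stub_bracket_Edata F hd 𝔫 h𝔫 E τ ι σ hι k l f g hf hg zf zg hzf hzg hmaj G hG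

/-- **stub X6 (LANDED p143096) — `stub_cauchy_product_tube` (M; convolutions of tube-summable non-negative coefficient functions are tube-summable).** If `α, β ≥ 0` on `F` have `∑_{ν ∈ 𝔡⁻¹} α(ν) e^{-2π⟨ν,y⟩} < ∞` and the same for `β` at every height `y ≫ 0`, then so does the cone convolution `ν ↦ ∑_{μ+μ'=ν, μ,μ' ∈ cone} α(μ) … (abridged; see the landed file). [folklore] -/
theorem stub_cauchy_product_tube (F : Type) [Field F] [NumberField F] [NumberField.IsTotallyReal F] (α β : F → ℝ)
    (hα0 : ∀ ν, 0 ≤ α ν) (hβ0 : ∀ ν, 0 ≤ β ν)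
    (hα : ∀ y : (F →+* ℝ) → ℝ, (∀ σ, 0 < y σ) →
      Summable (fun ν : {ν : F | ∀ b : 𝓞 F, ∃ n : ℤ, Algebra.trace ℚ F (ν * b) = n} ↦
        α ν * Real.exp (-(2 * Real.pi * ∑ σ : F →+* ℝ, σ (ν : F) * y σ))))
    (hβ : ∀ y : (F →+* ℝ) → ℝ, (∀ σ, 0 < y σ) →
      Summable (fun ν : {ν : F | ∀ b : 𝓞 F, ∃ n : ℤ, Algebra.trace ℚ F (ν * b) = n} ↦
        β ν * Real.exp (-(2 * Real.pi * ∑ σ : F →+* ℝ, σ (ν : F) * y σ)))) :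
    ∀ y : (F →+* ℝ) → ℝ, (∀ σ, 0 < y σ) →
      Summable (fun ν : {ν : F | ∀ b : 𝓞 F, ∃ n : ℤ, Algebra.trace ℚ F (ν * b) = n} ↦
        (∑ μ ∈ (stub_finite_qIndex_antidiagonal F (ν : F)).toFinset, α μ.1 * β μ.2) *
          Real.exp (-(2 * Real.pi * ∑ σ : F →+* ℝ, σ (ν : F) * y σ))) :=
  Summit.Langlands.Langlands.Theorems.HilbertIntegralOverconvergentIsCongruence.stub_cauchy_product_tube F α β hα0 hβ0 hα hβ

/-- **stub X7 (LANDED p144126) — `stub_itemSeedSupply` (L; the lead's composition, file `…ItemSeedSupply.lean`).** `Seed.ItemSeedSupply`: seed data for every paritious weight over every totally real `F` of degree `≥ 2` and every coefficient field `E ⊇ F^gal` (bump forms from Rankin–Cohen … (abridged; see the landed file). [folklore] -/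
theorem stub_itemSeedSupply : Seed.ItemSeedSupply :=
  fun F _ _ _ hd E _ _ τ hE k hk ↦ Summit.Langlands.Langlands.Theorems.HilbertIntegralOverconvergentIsCongruence.itemSeedSupply F hd E τ hE k hk

end Stubs

namespace Bracket

/-- Statement of stub X1, by name. -/
def stub_slice_deriv_holomorphic : Prop := type_of% Stubs.stub_slice_deriv_holomorphic
/-- Statement of stub X2, by name. -/
def stub_slice_deriv_law : Prop := type_of% Stubs.stub_slice_deriv_law
/-- Statement of stub X3, by name. -/
def stub_qSeries_slice_deriv : Prop := type_of% Stubs.stub_qSeries_slice_deriv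
/-- Statement of stub X4, by name. -/
def stub_bracket_lead_coeff : Prop := type_of% Stubs.stub_bracket_lead_coeff
/-- Statement of stub X5, by name. -/
def stub_bracket_Edata : Prop := type_of% Stubs.stub_bracket_Edata
/-- Statement of stub X6, by name. -/
def stub_cauchy_product_tube : Prop := type_of% Stubs.stub_cauchy_product_tube
/-- Statement of stub X7 (the lead's composition), by name. -/
def stub_itemSeedSupply : Prop := type_of% Stubs.stub_itemSeedSupply

/-- **`ItemSeedSupplyThm`** — the target of RESHAPE 20: the seed item `Seed.ItemSeedSupply` (seed data for EVERY PARITIOUS weight). -/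
def ItemSeedSupplyThm : Prop := Seed.ItemSeedSupply

section CompositionX

/-- **RESHAPE 20 from the stubs**: `ItemSeedSupplyThm` is the composition stub X7, proved by the lead from X1–X6 (all landed). -/
theorem ItemSeedSupplyThm_of : ItemSeedSupplyThm :=
  Stubs.stub_itemSeedSupply

/-- Feeding the composition the stubs themselves. -/
theorem ItemSeedSupplyThm_proof : ItemSeedSupplyThm :=
  ItemSeedSupplyThm_of

/-- **THE TYPED CRUX C′ FROM THE TWO `q`-EXPANSION-PRINCIPLE ITEMS ALONE**: (i′) Sturm mod 𝔭 on trace windows + (i″) bounded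
denominators ⇒ `Final.TypedCrux` (every paritious weight, every admissible encoding; the supply (ii) is now a theorem:
`Seed.TypedCrux_of_seedItems'` with `ItemSeedSupplyThm_proof`). -/
theorem TypedCrux_of_two_items (h1 : Final.ItemSturmModP) (h2 : Final.ItemBoundedDenominators) : Final.TypedCrux :=
  Seed.TypedCrux_of_seedItems' h1 h2 ItemSeedSupplyThm_proof

end CompositionX

end Bracket
/-!
# § Z — THE RESIDUE (lead c7): `Final.TypedCrux` modulo EXACTLY the two `q`-expansion-principle facts

After §§ U–X every provable input of the typed crux C′ is a theorem of the tree.  What remains are the two classical facts this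
tree cannot yet prove, registered here as the ONLY open stubs of the line so that the crux item records them by name:
(i′) `stub_itemSturmModP : Final.ItemSturmModP` — Sturm's bound mod 𝔭 for Hilbert modular forms on affine trace windows
[Takai, Algebra & Number Theory 7 (2013), Thm 1 / Cor 12 (geometric, level Γ(N), N ≥ 3, λ ∤ N d_F); Burgos Gil–Pacetti, Math. Comp.
(2017) for d = 2] and (i″) `stub_itemBoundedDenominators : Final.ItemBoundedDenominators` — bounded denominators of E-rational Hilbert
modular forms [Rapoport, Compos. Math. 36 (1978), Thm 6.7].  (Level control: `supplyFromSeedCoprime`, p143088 — added level factors ≡ 1 mod any `c`.)  They are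
crux-sized LITERATURE FACTS for the planner to file (with the recommended restatement `p ∤ 2 𝔫 d_F` of both the crux and (i′), see `NOTES.md`); the composition
`Final.TypedCrux_of` below is a real proof from them (`Bracket.TypedCrux_of_two_items`).
-/

namespace Stubs

/-- **stub Z1 — `stub_itemSturmModP` (XL; NAMED FACT, not provable in this tree).** Item (i′) `Final.ItemSturmModP`: the Hilbert Sturm
bound mod 𝔭 on affine trace windows for E-rational forms of level `Γ₁(𝔫)` over totally real `F` of degree `≥ 2`.
[cite: Takai2013SturmHilbert, Thm 1, Cor 12] -/
theorem stub_itemSturmModP : Final.ItemSturmModP := by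
  sorry

/-- **stub Z2 — `stub_itemBoundedDenominators` (XL; NAMED FACT, not provable in this tree).** Item (i″) `Final.ItemBoundedDenominators`:
bounded denominators (the `q`-expansion principle) for E-rational Hilbert modular forms of level `Γ₁(𝔫)`.
[cite: Rapoport1978HilbertBlumenthal, Thm 6.7] -/
theorem stub_itemBoundedDenominators : Final.ItemBoundedDenominators := by
  sorry

end Stubs

namespace Final

/-- Statement of stub Z1, by name. -/
def stub_itemSturmModP : Prop := type_of% Stubs.stub_itemSturmModP
/-- Statement of stub Z2, by name. -/
def stub_itemBoundedDenominators : Prop := type_of% Stubs.stub_itemBoundedDenominators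

/-- **`TypedCruxFinal`** — the line's FINAL target: the typed crux C′ `Final.TypedCrux` itself (a synonym, so that the composition below —
from the two named facts only — is the registered skeleton of the crux). -/
def TypedCruxFinal : Prop := TypedCrux

section CompositionZ

/-- **THE TYPED CRUX C′ FROM THE TWO REMAINING NAMED FACTS** (real proof: `Bracket.TypedCrux_of_two_items`, i.e. §§ T–X of this line). -/
theorem TypedCruxFinal_of (h1 : stub_itemSturmModP) (h2 : stub_itemBoundedDenominators) : TypedCruxFinal :=
  Bracket.TypedCrux_of_two_items h1 h2

/-- Feeding the composition the stubs themselves. -/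
theorem TypedCruxFinal_proof : TypedCruxFinal :=
  TypedCruxFinal_of Stubs.stub_itemSturmModP Stubs.stub_itemBoundedDenominators

/-- The same, stated as `Final.TypedCrux`. -/
theorem TypedCrux_proof : TypedCrux :=
  TypedCruxFinal_proof

end CompositionZ

end Final

end Summit.Langlands.Langlands.Cruxes.HilbertIntegralOverconvergentIsCongruence.SketchIdeateR1K1
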